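import Summits.AtomisticToContinuum.BoseEinsteinCondensation.Theses.BECThomsonPrinciple
import Literature.MathematicalPhysics.QuantumManyBody.SquareWellScatteringLength
import Literature.MathematicalPhysics.QuantumManyBody.PeriodicBoseGasThm31
import Literature.MathematicalPhysics.QuantumManyBody.BoseGasThermodynamicLimitRuelle
import Literature.MathematicalPhysics.QuantumManyBody.TorusFockSectorDictionary
import Literature.Probability.Distributions.GaussianPiDensity
import Literature.MathematicalPhysics.QuantumManyBody.LangevinGenerator
import Literature.MathematicalPhysics.QuantumManyBody.PeriodicBoseGasImpurity
import Literature.MathematicalPhysics.QuantumManyBody.PeriodicBoseGasImpurityTranslation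
import Literature.MathematicalPhysics.QuantumManyBody.PeriodicHeatFlowSpectralProofs
import Summits.AtomisticToContinuum.BoseEinsteinCondensation.Theorems.BECThomsonPrincipleDensityResponseKineticSignCoherence
import Summits.AtomisticToContinuum.BoseEinsteinCondensation.Theorems.DensityResponse.Negative.ForceBalanceStubMutations
import Literature.MathematicalPhysics.QuantumManyBody.TorusFockSectorInteraction

/-!
# Disproof work file — crux `DensityResponse` (stmt-AtomisticToContinuum-9481), generations 2–3

Standing adversary file of the crux disprover (cdisprove, route `BECThomsonPrinciple`, rank 4).
Prose only in docstrings.  `lean check`: rc 0, 0 sorry, axioms {propext, Classical.choice, Quot.sound}.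

The crux: `∀ v ∀ M ∃ ρ₀ C N₀ ∀ N ≥ N₀ ∀ L (N ≤ ρ₀L³) ∀ n ≠ 0 (k∞ = 2π‖n‖∞/L ≤ M√ρ) ∀ s ≥ 0 ∀ Φ :
E₀^per + s|⟨Σᵢ 2cos k·xᵢ⟩_Φ| ≤ E(Φ) + C s² N/(k∞² + ρa)`, i.e. the static density response obeys
`χ(k) ≤ 2CN/(k² + ρa)` uniformly down to `k = 2π/L` (Bogoliubov value `2N/(k² + 16πρa)`).

## Findings index

### Generation 1 (evidence `run/gate/evidence/stmt-AtomisticToContinuum-9481/2026081[5]T2*-Disproof.lean`,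
1642 lines, rc 0 — not importable; summarised from its evidence notes)
* (a) `n ≠ 0` is load-bearing: `¬ DensityResponseWithoutModeNeZero` (free gas, constant state, n = 0).
* (b) TIGHTNESS `two_le_of_holds_free`: for `v = 0` every admissible constant has `C ≥ 2`
  (one-phonon states `1 + ηΣᵢ2cos(2πx_{i0}/L)` at `L = M²N/4π²`).
* (c) `not_holds_uniform_constant_lt_two`.
* (d) `0 ≤ s` is decoration (`densityResponseAllSigns_iff`); `Holds.mono`, `Holds.anti_M`.
* (f) THE FREE GAS SATISFIES THE CRUX WITH `C = 4` (`holds_free_four`, torus IBP + AM–GM) and the same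
  bound RELATIVE TO ZERO ENERGY holds for every `v` (`free_type_bound_all_v`): the content of the crux
  is exactly the subtraction of `E₀(v)`.
* (g) chord structure: `abs_source_le` (`|⟨V_k⟩| ≤ 2N`), `chord_trivial_large_s` (only
  `0 ≤ s ≤ 2(k²+ρa)/C` matters), `forall_chord_iff` (chord ⇔ `|⟨V_k⟩|² ≤ 4CN(E−E₀)/(k²+ρa)`).
* (h) `densityResponseNoAbs_iff`: the absolute value is decoration (half-wavelength translation).

### Generation 2 (this file §1–§12; all of it LANDED as `Theorems/DensityResponse/Negative/{PeriodisedWell,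
  ModulatedOrbital, ModulatedProductState, LoadBearingDilute, FreeChord, ModeZeroEtaOrbital, Decorations,
  Tightness}.lean`, namespace `…Theorems.DensityResponse.Negative`, importable)
* §1 `latCount_le` / `le_latCount`: `ω(r−1)³ ≤ #(ℤ³ ∩ B(c,r)) ≤ ω(r+1)³`, `ω = |B₁| ≤ 8`
  (unit cubes around lattice points vs. balls; `Measure.addHaar_closedBall'`).
* §2 `periodizedPotential_sqWell`: for the square well `K·1_{r≤R}` the periodised potential is
  `K·latCount(x/L, R/L)`, hence squeezed in `[K ω (R/L−1)³, K ω (R/L+1)³]`: for `L ≪ R` it is CONSTANT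
  up to a relative error `O(L/R)` (every particle sees `≈ (4π/3)(R/L)³` images of every other).
* §3 `le_periodicGroundStateEnergy_of_le` (`E₀ ≥ #pairs · inf v^per`, kinetic energy dropped) and
  `periodicEnergy_le_of_pointwise` (`E(Ψ) ≤ t + #pairs · sup v^per` under a pointwise kinetic bound).
* §4–§5 the modulated product state `Φ = ∏ᵢ c(1 + ½cos(2πx_{i,0}/L))`: a genuine `PeriodicTrialState`
  (`prodState`), `|∇Φ|² ≤ 3N(2π/L)²|Φ|²` pointwise (`kineticDensity_prodState_le`), source
  `⟨Σᵢ2cos θᵢ⟩ = (8/9)N` (`source_prodState`, Fubini on `[0,L)^{3N}` + plane-wave orthogonality).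
* §6–§7 **`densityResponse_false_without_dilute : ¬ DensityResponseWithoutDilute`** — the crux with
  the single hypothesis `N ≤ ρ₀L³` deleted is FALSE (`densityResponse_of_withoutDilute` checks that the
  variant is the crux minus that hypothesis).  Witness: `v = 8·1_{r≤1}` (`a ∈ [½,1]` by the tree's
  `scatteringLength_squareWell_bounds`), `M = 1`, `L = 1/(10368·max(C,1))`, `N = max(N₀,1)`, `n = e₀`,
  `s = (8/9)(k²+ρa)/(2C)`, `Φ = prodState`: the chord fails by `E₀ + s⟨V⟩ − E(Φ) − Cs²N/(k²+ρa)
  ≥ (1024 − 704)·N²/L² > 0` (`final_ineq`).  MECHANISM: at density `ρ ≫ 1/(aR²)` the stiffness in the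
  Bogoliubov denominator is `ρ·v̂(k)`, not `ρa`; in the extreme `L ≪ R` the gas is free
  (`χ/N = 2/k²`) while `ρa/k² → ∞`.  Hence ANY PROOF MUST USE DILUTENESS, and uses it exactly to make
  `8πa` the effective coupling at the window's momenta (`k ≤ M√ρ ≪ 1/R`).

* §8 (re-derived from gen 1, now importable) `abs_source_le` (`|⟨Σᵢ2cos k·xᵢ⟩_Φ| ≤ 2N`, with the
  Bochner normalisation `integral_cellN_norm_sq`) and `chord_trivial_large_s`: for
  `s ≥ 2(k∞² + ρa)/C` the chord holds for EVERY `v` and state — the content is `0 ≤ s ≤ 2(k∞²+ρa)/C`;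
  `forall_tilt_iff_sq_le`: `(∀ s ≥ 0, sA ≤ B + Ds²) ↔ A² ≤ 4BD`, i.e. the chord over all tilts IS the
  static-response bound `|⟨V_k⟩_Φ|² ≤ 4CN(E(Φ)−E₀)/(k∞²+ρa)` (gen 1's `forall_chord_iff`, real core).

* §9 (gen 1's (f), re-derived importably) `free_chord`: for EVERY `N`, `L > 0`, `n ≠ 0`, `s ≥ 0`, `Φ`:
  `ofReal(s|⟨Σᵢ2cos k·xᵢ⟩_Φ|) ≤ ∫⁻|∇Φ|² + ofReal(4s²N/k∞²)` (torus IBP `integral_cellN_pderiv_eq_zero`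
  against `sin θᵢ|Φ|²` along the sup-norm axis of `n`, `HasFDerivAt.norm_sq`, pointwise AM–GM with
  `ε = k∞/2s`); `free_chord_energy` (relative to `E_v(Φ)` for every `v`); `holds_free_four`: THE FREE
  GAS SATISFIES THE CRUX'S CONCLUSION WITH `C = 4` for any `M, ρ₀, N₀` (`E₀(0) = 0` by `constState`,
  `a(0) = 0`).  So the crux = "subtract `E₀(v)` while keeping the `ρa` stiffness".
* §10 (gen 1 (a), importable) `densityResponse_false_without_modeNeZero : ¬ DensityResponseWithoutModeNeZero`
  — with `n ≠ 0` deleted the crux fails at `n = 0` already for the free gas (source `= 2N`, the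
  bound's denominator `k∞² + ρ·a(0)` vanishes, `x/0 = 0`): constant state, `s = 1`.
* §11 (gen 1 (b), importable) TIGHTNESS `two_le_of_holdsFree : HoldsFree M ρ₀ C N₀ → 2 ≤ C`: if the
  crux's conclusion holds for `v = 0` with constants `(M, ρ₀, C, N₀)` then `C ≥ 2` — one-parameter
  family of modulated product states `prodStateη` (`∏ᵢ c_η(1 + 2η cos θᵢ)`) with EXACT kinetic energy
  `2η²k²N/(1+2η²)` (`periodicEnergy_zero_prodStateη`, Fubini with one marked factor) and source
  `4ηN/(1+2η²)` at `L = M²N/(4π²)`, `n = e₀`, optimal tilt: ratio `2/(1+2η²) ↑ 2`.  With §9 the free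
  optimal constant lies in `[2, 4]` (Bogoliubov predicts `2`).
* §12 (gen 1 (d),(h), importable) DECORATIONS: `densityResponseAllSigns_iff` (`∀ s : ℝ` ↔ `∀ s ≥ 0`)
  and `densityResponseNoAbs_iff` (signed source ↔ `|source|`, by the half-wavelength translate
  `exists_translate_source_neg`, `t = Ln/(2|n|²)`): provers may read the crux as
  `∀ s ∀ Φ, E₀ + ofReal(s⟨V_k⟩_Φ) ≤ E(Φ) + ofReal(Cs²N/(k∞²+ρa))`.
* Remark (not formalised): the weaker repair "`2R₀ < L`" without a density ceiling is refuted by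
  the same mechanism at `ρ ≫ 1/(aR₀²)` (mean-field stiffness `ρ·v̂(k) ≪ ρa` for `R₀⁻¹ ≪ k ≤ M√ρ`,
  positive-type `v`); it needs the positive-type bound `E₀ ≥ N²v̂(0)/(2L³) − Nv(0)/2` on the torus.
  The minimal repair is the diluteness hypothesis the crux already has.

### Generation 3 (this file §13–§17; landing targets `Theorems/DensityResponse/Negative/{StiffnessSwitch,ThresholdAndCeiling,TightnessInteracting}.lean`)
* §13 **THE SCATTERING LENGTH IS ONLY A SWITCH.**  `HoldsWith v b M ρ₀ C N₀` := the crux's conclusion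
  for `v` with denominator `k∞² + ρ·b` at a free stiffness parameter `b` (`densityResponse_iff_holdsWith`:
  the crux is `∀ v M ∃ ρ₀ C N₀, HoldsWith v a(v) …`).  `HoldsWith.stiffness`: for `b, b' > 0`,
  `HoldsWith v b … C → HoldsWith v b' … (C·max 1 (b'/b))` — positive stiffness parameters are
  interchangeable because `C` is chosen after `v`.  `holdsWith_zero_of_ae`: `v = 0` a.e. (⟺ `a(v) = 0`,
  LSSY App. C, `LSSY2005_zeroScatteringLength_holds`) ⟹ `HoldsWith v 0 M ρ₀ 4 N₀` (free chord + `E₀ = 0`).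
  **`not_holdsWith_of_ae_pos`**: `v = 0` a.e. ⟹ `¬ HoldsWith v b M ρ₀ C N₀` for EVERY `b, M, ρ₀, C > 0`
  (one-phonon product states `prodStateη ½` on the torus of integer side `K → ∞`, `N = ⌈ρ₀K³/2⌉`,
  `k = 2π/K`, tilt `s = k²/2`: `χ_free/N = 2/k²` is not `O(1/(k² + ρb))`).  Hence
  **`densityResponse_iff_stiffness` / `densityResponse_iff_unit`**: for every fixed `b > 0`,
  `DensityResponse ↔ ∀ v admissible with a(v) ≠ 0, ∀ M, ∃ ρ₀ C N₀, HoldsWith v b M ρ₀ C N₀`, and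
  `not_stiffness_without_pos`: the guard `a(v) ≠ 0` cannot be dropped (`v = 0`).  MESSAGE: no proof
  has to produce `8πa` or any `a`-dependence; it must produce SOME `ρ`-proportional stiffness
  `χ(k) ≤ 2C_v N/(k² + ρ)` uniformly down the density scale, and it must DETECT `a(v) > 0` (use that
  `v ≠ 0` a.e.) — the crux is the qualitative incompressibility statement "repulsion ⟹ modulus ≳_v ρ"
  in the thermodynamic regime; even its `a`-free shadow (`b = 0`: response `≤ 2CN/k∞²` relative to
  `E₀(v)`, implied by `HoldsWith.anti`) is not known there.
* §14 **`N₀` IS DECORATION; the admissible region.**  `side_le_of_window`: window + `n ≠ 0` ⟹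
  `4π²L ≤ M²N`; `const_le_sq_of_window_dilute`: + diluteness ⟹ `(4π²)³ ≤ ρ₀M⁶N²`, i.e. the crux only
  ever speaks about `(N/ρ₀)^{1/3} ≤ L ≤ M²N/(4π²)`, `N ≥ (4π²)^{3/2}/(M³√ρ₀)`.  `HoldsWith.noThreshold`:
  shrinking `ρ₀` to `min ρ₀ ((4π²)³/(M⁶(N₀+1)²))` one may take `N₀ = 0`; `densityResponse_iff_noThreshold`.
* §15 **LARGE TILTS ARE FREE UNDER AN ENERGY CEILING.**  `chord_of_energy_ceiling`: `E₀ ≤ B` and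
  `Bk∞² ≤ s²N` ⟹ chord with `5s²N/k∞²`; `chord_of_energy_ceiling_particle`: `≤ 5(1+Λ)s²N/(k∞²+ρb)` when
  `ρb ≤ Λk∞²`.  With Dyson's ceiling `B = 8πρaN` (tree: `LSSY2005_upperBound_periodic_holds`) the OPEN
  set of parameters is `{ρa ≳ k∞² (phonons), 0 ≤ s ≤ 2(k∞²+ρa)/C} ∪ {ρa ≲ k∞² (particles), 0 ≤ s ≲ k∞√(ρa)}`.
* §16 **TARGETS (picked line `force-balance-constitutive`): S2 ⟸ crux up to `t`-uniformity.**
  `sourceMean_le_of_holdsWith`: the chord on a sub-ground state at drive `s` IS the linear-response bound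
  `m ≤ 4CsN/(k∞²+ρa)` (no stationarity / `s ≤ ρa` / sign needed); `coreIneq_of_holdsWith`:
  `HoldsWith w a M ρ₀ C N₀ → CoreIneq w a M ρ₀ κ (4C·max κ (3/4)) N₀` (via the landed `coreIneq_of_lr_bound`);
  `constitutiveCore_bounded_of_densityResponse`: S2|bounded ⟸ crux; `coreIneq_trunc_of_densityResponse`:
  for every `v`, `t` with `a(v_t) ≠ 0`: `CoreIneq (v_t) a(v) M ρ₀(t) κ C₁(t) N₀(t)`.  With the skeleton's
  `DensityResponse_of` this closes the loop: S2 is EQUIVALENT to the crux for bounded `v`, and for hard cores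
  the only extra content of S2 is the uniformity of `(ρ₀, C₁, N₀)` in the truncation height — no stub of the
  line is cheaper than the crux except S1, S3 (proved), S4.
* §17 **TIGHTNESS FOR EVERY SOFT POTENTIAL.**  `lintegral_cellN_pair_prod_le` (one pair against a product
  density: Fubini at slot 0 + `∫_cell v^per(x−y)dx = ∫v`), `periodicEnergy_prodStateη_le`
  (`E_v(Φ_η) ≤ T_η + N²‖φ_η‖∞²∫v`); **`two_le_of_holdsWith_soft`**: `HoldsWith v b M ρ₀ C N₀` with `∫v < ∞`
  ⟹ `2 ≤ C(1+2η²)(1 + (1+2η)²∫v/(2η²M²))` for every `η > 0` (GP corner: the test state's interaction is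
  `O(∫v/M²)` of its kinetic energy, `ρb/k² = b/M²` only helps); **`two_le_of_holdsWith_forall_window`**: a
  window-uniform constant is `≥ 2` for EVERY soft repulsive `v` — repulsion cannot beat the free value.
* Cycle-3 attacks without a kill (see "Why the crux itself resists", unchanged): stub audit of the picked
  line `force-balance-constitutive` (S1 hypervirial identities re-derived against the defs — correct;
  S4 = no Lavrentiev gap for radial measurable `v` — true via ray-wise continuity of `r ↦ ‖Ψ(r·)‖_{L²(S²)}`
  + Hedberg; S3 proved by the lead; S2 ≡ crux content + `t`-uniformity); crystalline/Bragg response is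
  outside the window (`k ≤ M√ρ ≪ ρ^{1/3}` once `ρ₀ < (c/M)⁶`); f-sum/Feynman bounds go the wrong way
  (`χ ≥ 2NS(k)²/k²`); multi-phonon bottom of the momentum-`k` sector `≈ c|k| ≪ k²` in the particle regime,
  so even a sector gap would not give `C = O(1)` — single-mode saturation is the real content.

### Why the crux itself resists (cycle 2 sweep; no kill)
* In every admissible regime the claim is Bogoliubov/LDA physics with room to spare: linear response
  `2N/(k²+16πρa) ≤ 2N/(k²+ρa)`; nonlinear `s`: LDA (`k ≪ 1/ξ`) is linear up to `s = 4πρa` then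
  saturates (concave drop), GP corner `L = M²N/(4π²J)` (`Na/L = 4π²Ja/M²` fixed, BBCS-2019 regime) idem,
  deep wells `s ≫ k²`: `drop ≤ E₀ + drop_free ≤ 4πaρN + 4s²N/k²` already covers `s ≥ k√(8πρa)`.
* QUANTITATIVELY: since `C` is existential, a counterexample must exhibit a static response exceeding the
  Bogoliubov value by an UNBOUNDED factor along a sequence of admissible `(N, L, n, s)` — an `O(1)`
  (indeed divergent) relative anomaly of `χ(k)(k² + ρa)/N`, not an LHY-size correction; no such
  mechanism exists for `v ≥ 0` at `ρ ≤ ρ₀(v, M)` (the only divergence, `ρ·v̂(k) ≪ ρa`, needs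
  `ρ ≫ 1/(aR₀²)`, §6–§7).
* A DISPROOF in the dilute regime needs `E₀(v)` from below to relative accuracy `o(1)` AND a modulated
  trial state with energy `4πaρN(1+o(1))` (Dyson/LSSY upper-bound technology) — and physics says the
  sign goes the wrong way (repulsion stiffens).  The formalisation is faithful: Bochner source is
  integrable (continuous on a bounded cell), `a < ⊤` for finite range, `E₀ = ⊤ ⇒` chord trivial,
  sup-norm `k∞ ≤ |k|₂` only weakens the bound, `N = 0` excluded by the prover's `N₀`.
* Not load-bearing (for truth): the window `k∞ ≤ M√ρ` (large `k` is free-like, repulsion only helps),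
  finite range (dropping it can only make `a = ⊤ ↦ 0`, a weaker claim), `N₀` (N = 0, 1 are trivial/free).
* Load-bearing: `n ≠ 0` (gen 1), diluteness (gen 2, this file).  Decorations: `0 ≤ s`, `|·|` (gen 1).
* Message to provers: the open content is `E₀(H) − E₀(H − sV_k) ≤ Cs²N/(k²+ρa)` for
  `0 ≤ s ≤ 2(k²+ρa)/C`, `C ≥ 2`, uniformly for `(N/ρ₀)^{1/3} ≤ L ≤ M²N/(4π²‖n‖²)`; the free part
  (`C = 4`, relative to zero energy) holds for all `v`; what is missing is a LOWER bound on the tilted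
  ground-state energy that retains the `ρa` stiffness — a compressibility statement in the
  thermodynamic regime, i.e. exactly the route's `why_might_fail`.
-/

noncomputable section

open MeasureTheory Set Filter Metric
open scoped ENNReal NNReal BigOperators Classical

namespace Summit.AtomisticToContinuum.BoseEinsteinCondensation.Cruxes.DensityResponse.Disproof

open Literature.MathematicalPhysics.QuantumManyBody.BoseGas

/-! ## §1 Lattice points in a ball -/

/-- The integer point `m ∈ ℤ³ ⊂ ℝ³`. [folklore] -/
def intVec (m : Fin 3 → ℤ) : Space := WithLp.toLp 2 fun k => (m k : ℝ)

@[simp] theorem intVec_apply (m : Fin 3 → ℤ) (k : Fin 3) : intVec m k = (m k : ℝ) := rfl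

/-- `L·m = L • m`. [folklore] -/
theorem latticeVec_eq_smul_intVec (L : ℝ) (m : Fin 3 → ℤ) : latticeVec L m = L • intVec m := by
  ext k
  simp [latticeVec, intVec]

/-- The half-open unit cube of `ℝ³` centred at the integer point `m`. [folklore] -/
def intCube (m : Fin 3 → ℤ) : Set Space :=
  {x | ∀ k, x k - (m k : ℝ) ∈ Set.Ico (-(1 / 2 : ℝ)) (1 / 2)}

/-- The cubes are measurable. [folklore] -/
theorem measurableSet_intCube (m : Fin 3 → ℤ) : MeasurableSet (intCube m) := by
  have : intCube m = ⋂ k : Fin 3, (fun x : Space => x k - (m k : ℝ)) ⁻¹' Set.Ico (-(1 / 2 : ℝ)) (1 / 2) := by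
    ext x; simp [intCube]
  rw [this]
  exact MeasurableSet.iInter fun k => measurableSet_Ico.preimage (by fun_prop)

/-- Each cube has volume `1`. [folklore] -/
theorem volume_intCube (m : Fin 3 → ℤ) : volume (intCube m) = 1 := by
  have h : intCube m = WithLp.ofLp ⁻¹'
      (Set.univ.pi fun k : Fin 3 => Set.Ico ((m k : ℝ) - 1 / 2) ((m k : ℝ) + 1 / 2)) := by
    ext x
    simp only [intCube, Set.mem_Ico, Set.mem_setOf_eq, Set.mem_preimage, Set.mem_univ_pi]
    refine forall_congr' fun k => ?_
    constructor <;> rintro ⟨h1, h2⟩ <;> constructor <;> linarith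
  rw [h, (PiLp.volume_preserving_ofLp (Fin 3)).measure_preimage
    (MeasurableSet.univ_pi fun _ => measurableSet_Ico).nullMeasurableSet, volume_pi_pi]
  simp only [Real.volume_Ico]
  norm_num

/-- Distinct cubes are disjoint. [folklore] -/
theorem intCube_disjoint {m m' : Fin 3 → ℤ} (h : m ≠ m') : Disjoint (intCube m) (intCube m') := by
  rw [Set.disjoint_left]
  intro x hx hx'
  apply h
  funext k
  have h1 := hx k
  have h2 := hx' k
  simp only [Set.mem_Ico] at h1 h2
  have h3 : ((m k : ℤ) : ℝ) - (m' k : ℝ) < 1 := by linarith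
  have h4 : (-1 : ℝ) < ((m k : ℤ) : ℝ) - (m' k : ℝ) := by linarith
  have h5 : (m k : ℤ) - m' k < 1 := by exact_mod_cast h3
  have h6 : (-1 : ℤ) < m k - m' k := by exact_mod_cast h4
  omega

/-- Coordinatewise rounding puts every point in a cube. [folklore] -/
theorem mem_intCube_round (y : Space) : y ∈ intCube fun k => ⌊y k + 1 / 2⌋ := by
  intro k
  simp only [Set.mem_Ico]
  constructor
  · have := Int.floor_le (y k + 1 / 2); linarith
  · have := Int.lt_floor_add_one (y k + 1 / 2); linarith

/-- A point of the cube is within distance `1` of its centre (`√3/2 ≤ 1`). [folklore] -/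
theorem norm_sub_intVec_le {m : Fin 3 → ℤ} {x : Space} (hx : x ∈ intCube m) : ‖x - intVec m‖ ≤ 1 := by
  have hk : ∀ k, ‖(x - intVec m) k‖ ^ 2 ≤ 1 / 4 := by
    intro k
    rw [PiLp.sub_apply, intVec_apply, Real.norm_eq_abs, sq_abs]
    have := hx k
    simp only [Set.mem_Ico] at this
    nlinarith [this.1, this.2]
  have h2 : ‖x - intVec m‖ ^ 2 ≤ 1 := by
    rw [EuclideanSpace.norm_sq_eq]
    calc ∑ k, ‖(x - intVec m) k‖ ^ 2 ≤ ∑ _k : Fin 3, (1 / 4 : ℝ) := Finset.sum_le_sum fun k _ => hk k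
      _ ≤ 1 := by simp; norm_num
  nlinarith [norm_nonneg (x - intVec m)]

/-- The number of integer points in the closed ball `B(c, r)`, in `[0, ∞]`. [folklore] -/
def latCount (c : Space) (r : ℝ) : ℝ≥0∞ :=
  ∑' m : Fin 3 → ℤ, (closedBall c r).indicator (fun _ => (1 : ℝ≥0∞)) (intVec m)

/-- The count is the volume of the union of the cubes centred in the ball. [folklore] -/
theorem latCount_eq_volume (c : Space) (r : ℝ) :
    latCount c r = volume (⋃ m : Fin 3 → ℤ, if intVec m ∈ closedBall c r then intCube m else ∅) := by
  rw [measure_iUnion]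
  · unfold latCount
    congr 1
    funext m
    by_cases hm : intVec m ∈ closedBall c r
    · rw [Set.indicator_of_mem hm, if_pos hm, volume_intCube]
    · rw [Set.indicator_of_notMem hm, if_neg hm, measure_empty]
  · intro m m' hmm'
    simp only [Function.onFun]
    split_ifs
    · exact intCube_disjoint hmm'
    · exact Set.disjoint_empty _
    · exact Set.empty_disjoint _
    · exact Set.disjoint_empty _
  · intro m
    split_ifs
    · exact measurableSet_intCube m
    · exact MeasurableSet.empty

/-- **Upper count**: `#(ℤ³ ∩ B(c,r)) ≤ |B₁| (r+1)³`. [folklore] -/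
theorem latCount_le (c : Space) {r : ℝ} (hr : 0 ≤ r) :
    latCount c r ≤ ENNReal.ofReal ((r + 1) ^ 3) * volume (closedBall (0 : Space) 1) := by
  rw [latCount_eq_volume]
  have hsub : (⋃ m : Fin 3 → ℤ, if intVec m ∈ closedBall c r then intCube m else ∅) ⊆
      closedBall c (r + 1) := by
    intro x hx
    simp only [Set.mem_iUnion] at hx
    obtain ⟨m, hm⟩ := hx
    split_ifs at hm with h
    · rw [mem_closedBall] at h ⊢
      calc dist x c ≤ dist x (intVec m) + dist (intVec m) c := dist_triangle _ _ _
        _ ≤ 1 + r := add_le_add (by rw [dist_eq_norm]; exact norm_sub_intVec_le hm) h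
        _ = r + 1 := add_comm _ _
    · exact absurd hm (Set.notMem_empty x)
  calc volume _ ≤ volume (closedBall c (r + 1)) := measure_mono hsub
    _ = ENNReal.ofReal ((r + 1) ^ 3) * volume (closedBall (0 : Space) 1) := by
        rw [Measure.addHaar_closedBall' volume c (by linarith), finrank_euclideanSpace_fin]

/-- **Lower count**: `|B₁| (r-1)³ ≤ #(ℤ³ ∩ B(c,r))` for `r ≥ 1`. [folklore] -/
theorem le_latCount (c : Space) {r : ℝ} (hr : 1 ≤ r) :
    ENNReal.ofReal ((r - 1) ^ 3) * volume (closedBall (0 : Space) 1) ≤ latCount c r := by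
  rw [latCount_eq_volume]
  have hsub : closedBall c (r - 1) ⊆
      ⋃ m : Fin 3 → ℤ, if intVec m ∈ closedBall c r then intCube m else ∅ := by
    intro y hy
    have hym : y ∈ intCube (fun k => ⌊y k + 1 / 2⌋) := mem_intCube_round y
    have hmS : intVec (fun k => ⌊y k + 1 / 2⌋) ∈ closedBall c r := by
      rw [mem_closedBall] at hy ⊢
      calc dist (intVec fun k => ⌊y k + 1 / 2⌋) c
          ≤ dist (intVec fun k => ⌊y k + 1 / 2⌋) y + dist y c := dist_triangle _ _ _
        _ ≤ 1 + (r - 1) :=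
            add_le_add (by rw [dist_comm, dist_eq_norm]; exact norm_sub_intVec_le hym) hy
        _ = r := by ring
    simp only [Set.mem_iUnion]
    exact ⟨fun k => ⌊y k + 1 / 2⌋, by rw [if_pos hmS]; exact hym⟩
  calc ENNReal.ofReal ((r - 1) ^ 3) * volume (closedBall (0 : Space) 1)
        = volume (closedBall c (r - 1)) := by
          rw [Measure.addHaar_closedBall' volume c (by linarith), finrank_euclideanSpace_fin]
    _ ≤ _ := measure_mono hsub

/-- `|B₁| ≤ |[-1,1]³| = 8`. [folklore] -/
theorem volume_closedBall_one_le_eight : volume (closedBall (0 : Space) 1) ≤ 8 := by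
  have hsub : closedBall (0 : Space) 1 ⊆
      WithLp.ofLp ⁻¹' (Set.univ.pi fun _ : Fin 3 => Set.Icc (-1 : ℝ) 1) := by
    intro x hx
    rw [mem_closedBall, dist_zero_right] at hx
    simp only [Set.mem_preimage, Set.mem_univ_pi, Set.mem_Icc]
    intro k
    have := (PiLp.norm_apply_le x k).trans hx
    rw [Real.norm_eq_abs, abs_le] at this
    exact this
  calc volume (closedBall (0 : Space) 1)
      ≤ volume (WithLp.ofLp ⁻¹' (Set.univ.pi fun _ : Fin 3 => Set.Icc (-1 : ℝ) 1)) :=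
        measure_mono hsub
    _ = 8 := by
      rw [(PiLp.volume_preserving_ofLp (Fin 3)).measure_preimage
        (MeasurableSet.univ_pi fun _ => measurableSet_Icc).nullMeasurableSet, volume_pi_pi]
      simp only [Real.volume_Icc, Finset.prod_const, Finset.card_univ, Fintype.card_fin]
      norm_num

/-- The volume of the unit ball of `ℝ³`, as a real number (`= 4π/3`; only `0 ≤ ω₃ ≤ 8` is used).
[folklore] -/
def ω₃ : ℝ := (volume (closedBall (0 : Space) 1)).toReal

theorem volume_closedBall_one_eq : volume (closedBall (0 : Space) 1) = ENNReal.ofReal ω₃ := by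
  rw [ω₃, ENNReal.ofReal_toReal]
  exact ne_top_of_le_ne_top (by norm_num) volume_closedBall_one_le_eight

theorem ω₃_nonneg : 0 ≤ ω₃ := ENNReal.toReal_nonneg

theorem ω₃_le_eight : ω₃ ≤ 8 := by
  have h := volume_closedBall_one_le_eight
  rw [volume_closedBall_one_eq] at h
  have : ENNReal.ofReal ω₃ ≤ ENNReal.ofReal 8 := by simpa using h
  exact (ENNReal.ofReal_le_ofReal_iff (by norm_num)).1 this

/-! ## §2 The periodised square well is nearly constant for `L ≪ R` -/

/-- The finite spherical well of height `K` and radius `R` (the tree's square well). [folklore] -/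
abbrev sqWell (K R : ℝ) : ℝ → ℝ≥0∞ := (Set.Iic R).indicator fun _ => ENNReal.ofReal K

theorem isRepulsiveFiniteRange_sqWell (K R : ℝ) : IsRepulsiveFiniteRange (sqWell K R) :=
  ⟨measurable_squareWell K R, R, fun _ hr => squareWell_eq_zero hr⟩

/-- `v^per(x) = K · #{m ∈ ℤ³ : |x/L - m| ≤ R/L}`. [folklore] -/
theorem periodizedPotential_sqWell {K R L : ℝ} (hL : 0 < L) (x : Space) :
    periodizedPotential (sqWell K R) L x = ENNReal.ofReal K * latCount (L⁻¹ • x) (R / L) := by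
  unfold periodizedPotential latCount
  rw [← ENNReal.tsum_mul_left]
  congr 1
  funext m
  have hnorm : ‖x - latticeVec L m‖ = L * ‖L⁻¹ • x - intVec m‖ := by
    rw [latticeVec_eq_smul_intVec]
    have : x - L • intVec m = L • (L⁻¹ • x - intVec m) := by
      rw [smul_sub, smul_inv_smul₀ hL.ne']
    rw [this, norm_smul, Real.norm_of_nonneg hL.le]
  by_cases h : ‖L⁻¹ • x - intVec m‖ ≤ R / L
  · have h1 : ‖x - latticeVec L m‖ ∈ Set.Iic R := by
      rw [Set.mem_Iic, hnorm]; rwa [le_div_iff₀' hL] at h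
    have h2 : intVec m ∈ closedBall (L⁻¹ • x) (R / L) := by
      rw [mem_closedBall, dist_comm, dist_eq_norm]; exact h
    simp only [sqWell]
    rw [Set.indicator_of_mem h1, Set.indicator_of_mem h2, mul_one]
  · have h1 : ‖x - latticeVec L m‖ ∉ Set.Iic R := by
      rw [Set.mem_Iic, hnorm, ← le_div_iff₀' hL]; exact h
    have h2 : intVec m ∉ closedBall (L⁻¹ • x) (R / L) := by
      rw [mem_closedBall, dist_comm, dist_eq_norm]; exact h
    simp only [sqWell]
    rw [Set.indicator_of_notMem h1, Set.indicator_of_notMem h2, mul_zero]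

/-- Upper squeeze: `v^per ≤ K ω₃ (R/L + 1)³`. [folklore] -/
theorem periodizedPotential_sqWell_le {K R L : ℝ} (hK : 0 ≤ K) (hR : 0 ≤ R) (hL : 0 < L) (x : Space) :
    periodizedPotential (sqWell K R) L x ≤ ENNReal.ofReal (K * ((R / L + 1) ^ 3 * ω₃)) := by
  rw [periodizedPotential_sqWell hL, ENNReal.ofReal_mul hK]
  gcongr
  rw [ENNReal.ofReal_mul (by positivity), ← volume_closedBall_one_eq]
  exact latCount_le _ (by positivity)

/-- Lower squeeze: `K ω₃ (R/L - 1)³ ≤ v^per` when `L ≤ R`. [folklore] -/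
theorem le_periodizedPotential_sqWell {K R L : ℝ} (hK : 0 ≤ K) (hL : 0 < L) (hLR : L ≤ R) (x : Space) :
    ENNReal.ofReal (K * ((R / L - 1) ^ 3 * ω₃)) ≤ periodizedPotential (sqWell K R) L x := by
  rw [periodizedPotential_sqWell hL, ENNReal.ofReal_mul hK]
  gcongr
  rw [ENNReal.ofReal_mul (pow_nonneg (by rw [sub_nonneg, one_le_div hL]; exact hLR) 3),
    ← volume_closedBall_one_eq]
  exact le_latCount _ (by rw [one_le_div hL]; exact hLR)


/-! ## §3 Pair sums: constant bounds on the interaction and on `E₀` -/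

/-- Number of ordered pairs `i < j` in `Fin N` (`= N(N-1)/2`; only `≤ N²` is used). [folklore] -/
def pairCount (N : ℕ) : ℕ := ∑ i : Fin N, (Finset.univ.filter fun j : Fin N => i < j).card

theorem pairCount_le (N : ℕ) : pairCount N ≤ N ^ 2 := by
  unfold pairCount
  calc ∑ i : Fin N, (Finset.univ.filter fun j : Fin N => i < j).card ≤ ∑ _i : Fin N, N :=
        Finset.sum_le_sum fun i _ => (Finset.card_filter_le _ _).trans (by simp)
    _ = N ^ 2 := by simp [sq]

/-- A uniform lower bound on `v^per` bounds the interaction from below. [folklore] -/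
theorem le_periodicInteraction_of_le {N : ℕ} {v : ℝ → ℝ≥0∞} {L : ℝ} {a : ℝ≥0∞}
    (h : ∀ y, a ≤ periodizedPotential v L y) (X : Config N) :
    (pairCount N : ℝ≥0∞) * a ≤ periodicInteraction v L X := by
  unfold periodicInteraction pairCount
  push_cast
  rw [Finset.sum_mul]
  refine Finset.sum_le_sum fun i _ => ?_
  rw [← nsmul_eq_mul, ← Finset.sum_const]
  exact Finset.sum_le_sum fun j _ => h _

/-- A uniform upper bound on `v^per` bounds the interaction from above. [folklore] -/
theorem periodicInteraction_le_of_le {N : ℕ} {v : ℝ → ℝ≥0∞} {L : ℝ} {b : ℝ≥0∞}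
    (h : ∀ y, periodizedPotential v L y ≤ b) (X : Config N) :
    periodicInteraction v L X ≤ (pairCount N : ℝ≥0∞) * b := by
  unfold periodicInteraction pairCount
  push_cast
  rw [Finset.sum_mul]
  refine Finset.sum_le_sum fun i _ => ?_
  rw [← nsmul_eq_mul, ← Finset.sum_const]
  exact Finset.sum_le_sum fun j _ => h _

/-- **`E₀ ≥ #pairs · inf v^per`** (drop the kinetic energy, use the normalisation). [folklore] -/
theorem le_periodicGroundStateEnergy_of_le {N : ℕ} {v : ℝ → ℝ≥0∞} {L : ℝ} {a : ℝ≥0∞}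
    (ha : a ≠ ⊤) (h : ∀ y, a ≤ periodizedPotential v L y) :
    (pairCount N : ℝ≥0∞) * a ≤ periodicGroundStateEnergy v N L := by
  refine le_iInf fun Ψ => ?_
  calc (pairCount N : ℝ≥0∞) * a
      = (pairCount N : ℝ≥0∞) * a * ∫⁻ X in cellN N L, (‖Ψ.ψ X‖₊ : ℝ≥0∞) ^ 2 := by
        rw [Ψ.norm_eq, mul_one]
    _ = ∫⁻ X in cellN N L, (pairCount N : ℝ≥0∞) * a * (‖Ψ.ψ X‖₊ : ℝ≥0∞) ^ 2 :=
        (lintegral_const_mul' _ _ (ENNReal.mul_ne_top (by simp) ha)).symm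
    _ ≤ ∫⁻ X in cellN N L,
          kineticDensity Ψ.ψ X + periodicInteraction v L X * (‖Ψ.ψ X‖₊ : ℝ≥0∞) ^ 2 :=
        lintegral_mono fun X => le_add_left (by gcongr; exact le_periodicInteraction_of_le h X)
    _ = periodicEnergy v Ψ := rfl

/-- **Energy of a state with a pointwise kinetic bound**: `E(Ψ) ≤ t + #pairs · sup v^per`.
[folklore] -/
theorem periodicEnergy_le_of_pointwise {N : ℕ} {v : ℝ → ℝ≥0∞} {L : ℝ} (Ψ : PeriodicTrialState N L)
    {t b : ℝ≥0∞} (ht : t ≠ ⊤) (hb : b ≠ ⊤)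
    (hkin : ∀ X, kineticDensity Ψ.ψ X ≤ t * (‖Ψ.ψ X‖₊ : ℝ≥0∞) ^ 2)
    (hpot : ∀ y, periodizedPotential v L y ≤ b) :
    periodicEnergy v Ψ ≤ t + (pairCount N : ℝ≥0∞) * b := by
  calc periodicEnergy v Ψ
      = ∫⁻ X in cellN N L,
          kineticDensity Ψ.ψ X + periodicInteraction v L X * (‖Ψ.ψ X‖₊ : ℝ≥0∞) ^ 2 := rfl
    _ ≤ ∫⁻ X in cellN N L, (t + (pairCount N : ℝ≥0∞) * b) * (‖Ψ.ψ X‖₊ : ℝ≥0∞) ^ 2 := by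
        refine lintegral_mono fun X => ?_
        rw [add_mul]
        gcongr
        · exact hkin X
        · exact periodicInteraction_le_of_le hpot X
    _ = (t + (pairCount N : ℝ≥0∞) * b) * ∫⁻ X in cellN N L, (‖Ψ.ψ X‖₊ : ℝ≥0∞) ^ 2 :=
        lintegral_const_mul' _ _ (ENNReal.add_ne_top.2 ⟨ht, ENNReal.mul_ne_top (by simp) hb⟩)
    _ = t + (pairCount N : ℝ≥0∞) * b := by rw [Ψ.norm_eq, mul_one]

/-! ## §4 The modulated orbital `φ_L(x) = c (1 + ½ cos(2πx₀/L))` -/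

/-- The phase `θ(x) = 2πx₀/L`. [folklore] -/
def θL (L : ℝ) (x : Space) : ℝ := 2 * Real.pi / L * x 0

/-- The real profile `1 + ½ cos θ` (modulation `η = 1/4` of the constant state). [folklore] -/
def prof (L : ℝ) (x : Space) : ℝ := 1 + 1 / 2 * Real.cos (θL L x)

/-- The normalisation `c = (9L³/8)^{-1/2}`. [folklore] -/
def cL (L : ℝ) : ℝ := (Real.sqrt (9 / 8 * L ^ 3))⁻¹

/-- The orbital `φ_L = c (1 + ½ cos θ)`, as a complex-valued function. [folklore] -/
def orb (L : ℝ) (x : Space) : ℂ := ((cL L * prof L x : ℝ) : ℂ)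

theorem prof_bounds (L : ℝ) (x : Space) : 1 / 2 ≤ prof L x ∧ prof L x ≤ 3 / 2 := by
  unfold prof
  constructor <;> nlinarith [Real.neg_one_le_cos (θL L x), Real.cos_le_one (θL L x)]

theorem cL_pos {L : ℝ} (hL : 0 < L) : 0 < cL L := by
  unfold cL; positivity

theorem cL_sq {L : ℝ} (hL : 0 < L) : cL L ^ 2 = 8 / (9 * L ^ 3) := by
  unfold cL
  rw [inv_pow, Real.sq_sqrt (by positivity)]
  field_simp

theorem norm_orb {L : ℝ} (hL : 0 < L) (x : Space) : ‖orb L x‖ = cL L * prof L x := by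
  unfold orb
  rw [Complex.norm_real, Real.norm_of_nonneg]
  exact mul_nonneg (cL_pos hL).le (by linarith [(prof_bounds L x).1])

theorem norm_orb_pos {L : ℝ} (hL : 0 < L) (x : Space) : 0 < ‖orb L x‖ := by
  rw [norm_orb hL]
  exact mul_pos (cL_pos hL) (by linarith [(prof_bounds L x).1])

theorem half_cL_le_norm_orb {L : ℝ} (hL : 0 < L) (x : Space) : cL L * (1 / 2) ≤ ‖orb L x‖ := by
  rw [norm_orb hL]
  exact mul_le_mul_of_nonneg_left (prof_bounds L x).1 (cL_pos hL).le

theorem contDiff_prof (L : ℝ) : ContDiff ℝ ⊤ (prof L) := by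
  unfold prof θL; fun_prop

theorem contDiff_orb (L : ℝ) : ContDiff ℝ ⊤ (orb L) := by
  have : orb L = fun x => Complex.ofRealCLM (cL L * prof L x) := by
    funext x; rw [Complex.ofRealCLM_apply]; rfl
  rw [this]
  exact Complex.ofRealCLM.contDiff.comp (contDiff_const.mul (contDiff_prof L))

theorem continuous_orb (L : ℝ) : Continuous (orb L) := (contDiff_orb L).continuous

/-- `φ_L` is `L`-periodic along every axis. [folklore] -/
theorem orb_periodic {L : ℝ} (hL : L ≠ 0) (x : Space) (k : Fin 3) :
    orb L (x + EuclideanSpace.single k L) = orb L x := by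
  have hθ : Real.cos (θL L (x + EuclideanSpace.single k L)) = Real.cos (θL L x) := by
    unfold θL
    simp only [PiLp.add_apply, PiLp.single_apply]
    split_ifs
    · rw [mul_add, div_mul_cancel₀ _ hL, Real.cos_add_two_pi]
    · rw [add_zero]
  unfold orb prof
  rw [hθ]

/-- The derivative of the profile. [folklore] -/
theorem hasFDerivAt_prof (L : ℝ) (x : Space) :
    HasFDerivAt (prof L)
      ((1 / 2 : ℝ) • (-Real.sin (θL L x) •
        ((2 * Real.pi / L) • EuclideanSpace.proj (𝕜 := ℝ) (0 : Fin 3)))) x := by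
  have h0 : HasFDerivAt (fun y : Space => θL L y)
      ((2 * Real.pi / L) • EuclideanSpace.proj (𝕜 := ℝ) (0 : Fin 3)) x :=
    ((EuclideanSpace.proj (𝕜 := ℝ) (0 : Fin 3)).hasFDerivAt).const_mul (2 * Real.pi / L)
  exact ((h0.cos).const_mul (1 / 2)).const_add 1

/-- `|∂_w prof| ≤ (π/L) |w|`. [folklore] -/
theorem norm_fderiv_prof_le {L : ℝ} (hL : 0 < L) (x w : Space) :
    ‖fderiv ℝ (prof L) x w‖ ≤ Real.pi / L * ‖w‖ := by
  rw [(hasFDerivAt_prof L x).fderiv]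
  simp only [smul_apply, smul_eq_mul]
  have hproj : ‖(EuclideanSpace.proj (𝕜 := ℝ) (0 : Fin 3)) w‖ ≤ ‖w‖ := PiLp.norm_apply_le w 0
  have hsin : |Real.sin (θL L x)| ≤ 1 := Real.abs_sin_le_one _
  rw [Real.norm_eq_abs, abs_mul, abs_mul, abs_mul, abs_neg,
    abs_of_pos (show (0 : ℝ) < 1 / 2 by norm_num), abs_of_pos (by positivity : (0 : ℝ) < 2 * Real.pi / L)]
  rw [Real.norm_eq_abs] at hproj
  calc 1 / 2 * (|Real.sin (θL L x)| * (2 * Real.pi / L * |(EuclideanSpace.proj (𝕜 := ℝ) (0 : Fin 3)) w|))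
      ≤ 1 / 2 * (1 * (2 * Real.pi / L * ‖w‖)) := by gcongr
    _ = Real.pi / L * ‖w‖ := by ring

theorem hasFDerivAt_orb (L : ℝ) (x : Space) :
    HasFDerivAt (orb L) (Complex.ofRealCLM.comp (cL L • fderiv ℝ (prof L) x)) x := by
  have h1 : HasFDerivAt (fun y => cL L * prof L y) (cL L • fderiv ℝ (prof L) x) x :=
    ((hasFDerivAt_prof L x).differentiableAt.hasFDerivAt).const_mul (cL L)
  have h2 := Complex.ofRealCLM.hasFDerivAt.comp x h1
  have : orb L = fun y => Complex.ofRealCLM (cL L * prof L y) := by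
    funext y; rw [Complex.ofRealCLM_apply]; rfl
  rw [this]
  exact h2

/-- **`|∂_w φ_L| ≤ (2π/L) |w| |φ_L|`** (the profile never drops below half its mean). [folklore] -/
theorem norm_fderiv_orb_le {L : ℝ} (hL : 0 < L) (x w : Space) :
    ‖fderiv ℝ (orb L) x w‖ ≤ 2 * Real.pi / L * ‖w‖ * ‖orb L x‖ := by
  rw [(hasFDerivAt_orb L x).fderiv, ContinuousLinearMap.comp_apply, smul_apply,
    Complex.ofRealCLM_apply, Complex.norm_real, norm_smul, Real.norm_of_nonneg (cL_pos hL).le]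
  have h := norm_fderiv_prof_le hL x w
  calc cL L * ‖fderiv ℝ (prof L) x w‖ ≤ cL L * (Real.pi / L * ‖w‖) :=
        mul_le_mul_of_nonneg_left h (cL_pos hL).le
    _ = 2 * Real.pi / L * ‖w‖ * (cL L * (1 / 2)) := by ring
    _ ≤ 2 * Real.pi / L * ‖w‖ * ‖orb L x‖ :=
        mul_le_mul_of_nonneg_left (half_cL_le_norm_orb hL x) (by positivity)

/-! ### Cell integrals of the orbital -/

/-- Bounded continuous functions are integrable on the cell. [folklore] -/
theorem integrableOn_cell_of_bound {E : Type*} [NormedAddCommGroup E] {g : Space → E}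
    (hg : Continuous g) {M : ℝ} (hM : ∀ x, ‖g x‖ ≤ M) (L : ℝ) : IntegrableOn g (cell L) :=
  Measure.integrableOn_of_bounded (by rw [volume_cell]; exact ENNReal.pow_ne_top ENNReal.ofReal_ne_top)
    hg.aestronglyMeasurable (ae_of_all _ hM)

theorem volume_cell_ne_top (L : ℝ) : volume (cell L) ≠ ⊤ := by
  rw [volume_cell]; exact ENNReal.pow_ne_top ENNReal.ofReal_ne_top

theorem volume_real_cell {L : ℝ} (hL : 0 ≤ L) : volume.real (cell L) = L ^ 3 := by
  rw [measureReal_def, volume_cell, ENNReal.toReal_pow, ENNReal.toReal_ofReal hL]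

theorem continuous_θL (L : ℝ) : Continuous (θL L) := by unfold θL; fun_prop

/-- **`∫_cell cos(jθ) = 0`** for `j ≠ 0` (plane-wave orthogonality on the torus). [folklore] -/
theorem integral_cell_cos {L : ℝ} (hL : 0 < L) {j : ℤ} (hj : j ≠ 0) :
    ∫ x in cell L, Real.cos (j * θL L x) = 0 := by
  have hw : ∀ x, Real.cos (j * θL L x) = RCLike.re (cellWave L (Pi.single 0 j) x) := by
    intro x
    rw [cellWave_apply, RCLike.re_to_complex]
    have : (2 * ↑Real.pi * Complex.I * ↑(∑ k, ((Pi.single 0 j : Fin 3 → ℤ) k : ℝ) * x k) / ↑L : ℂ) =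
        ((j * θL L x : ℝ) : ℂ) * Complex.I := by
      simp only [Pi.single_apply, Int.cast_ite, Int.cast_zero, ite_mul, zero_mul,
        Finset.sum_ite_eq', Finset.mem_univ, if_true, θL]
      push_cast
      field_simp
    rw [this, Complex.exp_ofReal_mul_I_re]
  simp_rw [hw]
  rw [integral_re ((integrableOn_cell_of_bound (continuous_cellWave L _)
    (fun x => (norm_cellWave L _ x).le) L)), integral_cell_cellWave hL, if_neg, map_zero]
  intro h
  exact hj (by simpa using congr_fun h 0)

theorem prof_sq_eq (L : ℝ) (x : Space) :
    prof L x ^ 2 = 9 / 8 + Real.cos ((1 : ℤ) * θL L x) + 1 / 8 * Real.cos ((2 : ℤ) * θL L x) := by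
  unfold prof
  push_cast
  rw [one_mul, Real.cos_two_mul]
  ring

theorem two_cos_mul_prof_sq_eq (L : ℝ) (x : Space) :
    2 * Real.cos (θL L x) * prof L x ^ 2 = 1 + 19 / 8 * Real.cos ((1 : ℤ) * θL L x) +
      Real.cos ((2 : ℤ) * θL L x) + 1 / 8 * Real.cos ((3 : ℤ) * θL L x) := by
  unfold prof
  push_cast
  rw [one_mul, Real.cos_two_mul, Real.cos_three_mul]
  ring

theorem integrableOn_cell_cos (L : ℝ) (j : ℤ) : IntegrableOn (fun x => Real.cos (j * θL L x)) (cell L) :=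
  integrableOn_cell_of_bound (Real.continuous_cos.comp (continuous_const.mul (continuous_θL L)))
    (fun x => by rw [Real.norm_eq_abs]; exact Real.abs_cos_le_one _) L

/-- `∫_cell (1 + ½cos θ)² = 9L³/8`. [folklore] -/
theorem integral_cell_prof_sq {L : ℝ} (hL : 0 < L) : ∫ x in cell L, prof L x ^ 2 = 9 / 8 * L ^ 3 := by
  simp_rw [prof_sq_eq]
  have hc : IntegrableOn (fun _ : Space => (9 / 8 : ℝ)) (cell L) := integrableOn_const (volume_cell_ne_top L)
  have h1 := integrableOn_cell_cos L 1
  have h2 := (integrableOn_cell_cos L 2).const_mul (1 / 8)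
  rw [integral_add (hc.fun_add h1) h2, integral_add hc h1, integral_const_mul,
    integral_cell_cos hL one_ne_zero, integral_cell_cos hL two_ne_zero,
    setIntegral_const, volume_real_cell hL.le, smul_eq_mul]
  ring

/-- `∫_cell 2cos θ (1 + ½cos θ)² = L³`. [folklore] -/
theorem integral_cell_two_cos_prof_sq {L : ℝ} (hL : 0 < L) :
    ∫ x in cell L, 2 * Real.cos (θL L x) * prof L x ^ 2 = L ^ 3 := by
  simp_rw [two_cos_mul_prof_sq_eq]
  have hc : IntegrableOn (fun _ : Space => (1 : ℝ)) (cell L) := integrableOn_const (volume_cell_ne_top L)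
  have h1 := (integrableOn_cell_cos L 1).const_mul (19 / 8)
  have h2 := integrableOn_cell_cos L 2
  have h3 := (integrableOn_cell_cos L 3).const_mul (1 / 8)
  rw [integral_add ((hc.fun_add h1).fun_add h2) h3, integral_add (hc.fun_add h1) h2, integral_add hc h1,
    integral_const_mul, integral_const_mul, integral_cell_cos hL one_ne_zero,
    integral_cell_cos hL two_ne_zero, integral_cell_cos hL (by norm_num), setIntegral_const,
    volume_real_cell hL.le, smul_eq_mul]
  ring

theorem norm_orb_sq {L : ℝ} (hL : 0 < L) (x : Space) : ‖orb L x‖ ^ 2 = cL L ^ 2 * prof L x ^ 2 := by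
  rw [norm_orb hL, mul_pow]

/-- **Normalisation**: `∫_cell |φ_L|² = 1`. [folklore] -/
theorem integral_cell_norm_orb_sq {L : ℝ} (hL : 0 < L) : ∫ x in cell L, ‖orb L x‖ ^ 2 = 1 := by
  simp_rw [norm_orb_sq hL]
  rw [integral_const_mul, integral_cell_prof_sq hL, cL_sq hL]
  field_simp

/-- **Source**: `∫_cell 2cos θ |φ_L|² = 8/9`. [folklore] -/
theorem integral_cell_two_cos_norm_orb_sq {L : ℝ} (hL : 0 < L) :
    ∫ x in cell L, 2 * Real.cos (θL L x) * ‖orb L x‖ ^ 2 = 8 / 9 := by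
  simp_rw [norm_orb_sq hL]
  have : ∀ x, 2 * Real.cos (θL L x) * (cL L ^ 2 * prof L x ^ 2) =
      cL L ^ 2 * (2 * Real.cos (θL L x) * prof L x ^ 2) := fun x => by ring
  simp_rw [this]
  rw [integral_const_mul, integral_cell_two_cos_prof_sq hL, cL_sq hL]
  field_simp

theorem norm_orb_le {L : ℝ} (hL : 0 < L) (x : Space) : ‖orb L x‖ ≤ cL L * (3 / 2) := by
  rw [norm_orb hL]
  exact mul_le_mul_of_nonneg_left (prof_bounds L x).2 (cL_pos hL).le

theorem integrableOn_cell_norm_orb_sq {L : ℝ} (hL : 0 < L) :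
    IntegrableOn (fun x => ‖orb L x‖ ^ 2) (cell L) := by
  refine integrableOn_cell_of_bound (g := fun x => ‖orb L x‖ ^ 2) ((continuous_orb L).norm.pow 2)
    (M := (cL L * (3 / 2)) ^ 2) (fun x => ?_) L
  rw [Real.norm_eq_abs, abs_of_nonneg (sq_nonneg _)]
  exact pow_le_pow_left₀ (norm_nonneg _) (norm_orb_le hL x) 2

/-- **Normalisation in `ℝ≥0∞`**: `∫⁻_cell |φ_L|² = 1`. [folklore] -/
theorem lintegral_cell_orb_sq {L : ℝ} (hL : 0 < L) :
    ∫⁻ x in cell L, (‖orb L x‖₊ : ℝ≥0∞) ^ 2 = 1 := by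
  have h : ∀ x, (‖orb L x‖₊ : ℝ≥0∞) ^ 2 = ENNReal.ofReal (‖orb L x‖ ^ 2) := by
    intro x
    rw [ENNReal.ofReal_pow (norm_nonneg _), ofReal_norm]
    rfl
  simp_rw [h]
  rw [← ofReal_integral_eq_lintegral_ofReal (integrableOn_cell_norm_orb_sq hL)
    (ae_of_all _ fun x => by positivity), integral_cell_norm_orb_sq hL, ENNReal.ofReal_one]

theorem measurable_orb_sq (L : ℝ) : Measurable fun x => (‖orb L x‖₊ : ℝ≥0∞) ^ 2 :=
  ((continuous_orb L).measurable.nnnorm.coe_nnreal_ennreal).pow_const 2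

/-! ## §5 The product trial state `Φ(X) = ∏ᵢ φ_L(xᵢ)` -/

/-- The product wave function `∏ᵢ φ_L(xᵢ)`. [folklore] -/
def prodFun (N : ℕ) (L : ℝ) (X : Config N) : ℂ := ∏ i, orb L (X i)

theorem contDiff_prodFun (N : ℕ) (L : ℝ) : ContDiff ℝ 1 (prodFun N L) :=
  contDiff_prod fun i _ => ((contDiff_orb L).of_le le_top).comp
    (ContinuousLinearMap.proj (R := ℝ) (φ := fun _ => Space) i).contDiff

theorem prodFun_periodic {N : ℕ} {L : ℝ} (hL : L ≠ 0) (X : Config N) (i : Fin N) (k : Fin 3) :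
    prodFun N L (X + Pi.single i (EuclideanSpace.single k L)) = prodFun N L X := by
  unfold prodFun
  refine Finset.prod_congr rfl fun j _ => ?_
  rw [Pi.add_apply]
  rcases eq_or_ne j i with rfl | hj
  · rw [Pi.single_eq_same, orb_periodic hL]
  · rw [Pi.single_eq_of_ne hj, add_zero]

theorem prodFun_symm (N : ℕ) (L : ℝ) (σ : Equiv.Perm (Fin N)) (X : Config N) :
    prodFun N L (X ∘ σ) = prodFun N L X := by
  unfold prodFun
  exact Equiv.prod_comp σ (fun i => orb L (X i))

theorem nnnorm_prodFun_sq (N : ℕ) (L : ℝ) (X : Config N) :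
    (‖prodFun N L X‖₊ : ℝ≥0∞) ^ 2 = ∏ i, (‖orb L (X i)‖₊ : ℝ≥0∞) ^ 2 := by
  rw [prodFun, nnnorm_prod, ENNReal.ofNNReal_finsetProd, Finset.prod_pow]

theorem norm_prodFun_sq (N : ℕ) (L : ℝ) (X : Config N) :
    ‖prodFun N L X‖ ^ 2 = ∏ i, ‖orb L (X i)‖ ^ 2 := by
  rw [prodFun, norm_prod, Finset.prod_pow]

theorem lintegral_cellN_prodFun_sq (N : ℕ) {L : ℝ} (hL : 0 < L) :
    ∫⁻ X in cellN N L, (‖prodFun N L X‖₊ : ℝ≥0∞) ^ 2 = 1 := by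
  simp_rw [nnnorm_prodFun_sq]
  rw [volume_restrict_cellN, Literature.Probability.Distributions.lintegral_fin_nat_prod_eq_prod
    _ (fun _ x => (‖orb L x‖₊ : ℝ≥0∞) ^ 2) (fun _ => measurable_orb_sq L)]
  simp [lintegral_cell_orb_sq hL]

/-- **The modulated product state** `Φ_{N,L}(X) = ∏ᵢ c(1 + ½cos(2πx_{i,0}/L))` on the torus of
side `L` (smooth, periodic, Bose-symmetric, normalised). [folklore] -/
def prodState (N : ℕ) {L : ℝ} (hL : 0 < L) : PeriodicTrialState N L where
  ψ := prodFun N L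
  contDiff := contDiff_prodFun N L
  periodic := prodFun_periodic hL.ne'
  symm := prodFun_symm N L
  norm_eq := lintegral_cellN_prodFun_sq N hL

theorem prodState_ψ (N : ℕ) {L : ℝ} (hL : 0 < L) : (prodState N hL).ψ = prodFun N L := rfl

/-- The derivative of the product. [folklore] -/
theorem hasFDerivAt_prodFun (N : ℕ) (L : ℝ) (X : Config N) :
    HasFDerivAt (prodFun N L)
      (∑ i ∈ Finset.univ, (∏ j ∈ Finset.univ.erase i, orb L (X j)) •
        ((fderiv ℝ (orb L) (X i)).comp (ContinuousLinearMap.proj (R := ℝ) (φ := fun _ => Space) i))) X := by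
  have hdiff : ∀ i : Fin N, HasFDerivAt (fun Y : Config N => orb L (Y i))
      ((fderiv ℝ (orb L) (X i)).comp (ContinuousLinearMap.proj (R := ℝ) (φ := fun _ => Space) i)) X := by
    intro i
    have h1 : HasFDerivAt (orb L) (fderiv ℝ (orb L) (X i)) (X i) :=
      (hasFDerivAt_orb L (X i)).differentiableAt.hasFDerivAt
    exact h1.comp X (ContinuousLinearMap.proj (R := ℝ) (φ := fun _ => Space) i).hasFDerivAt
  exact HasFDerivAt.finsetProd (u := Finset.univ) (g := fun i (Y : Config N) => orb L (Y i)) (x := X)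
    fun i _ => hdiff i

/-- `|∂_{i,k} Φ| ≤ (2π/L) |Φ|`. [folklore] -/
theorem norm_fderiv_prodFun_le (N : ℕ) {L : ℝ} (hL : 0 < L) (X : Config N) (i : Fin N) (k : Fin 3) :
    ‖fderiv ℝ (prodFun N L) X (unitVec i k)‖ ≤ 2 * Real.pi / L * ‖prodFun N L X‖ := by
  rw [(hasFDerivAt_prodFun N L X).fderiv, FunLike.coe_sum, Finset.sum_apply,
    Finset.sum_eq_single i]
  · rw [smul_apply, ContinuousLinearMap.comp_apply, ContinuousLinearMap.proj_apply]
    simp only [unitVec, Pi.single_eq_same, smul_eq_mul, norm_mul]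
    calc ‖∏ j ∈ Finset.univ.erase i, orb L (X j)‖ * ‖fderiv ℝ (orb L) (X i) (EuclideanSpace.single k 1)‖
        ≤ ‖∏ j ∈ Finset.univ.erase i, orb L (X j)‖ *
            (2 * Real.pi / L * ‖EuclideanSpace.single k (1 : ℝ)‖ * ‖orb L (X i)‖) :=
          mul_le_mul_of_nonneg_left (norm_fderiv_orb_le hL _ _) (norm_nonneg _)
      _ = 2 * Real.pi / L * (‖∏ j ∈ Finset.univ.erase i, orb L (X j)‖ * ‖orb L (X i)‖) := by
          have hn1 : ‖(EuclideanSpace.single k (1 : ℝ) : Space)‖ = 1 := by simp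
          rw [hn1]; ring
      _ = 2 * Real.pi / L * ‖prodFun N L X‖ := by
          rw [← norm_mul, Finset.prod_erase_mul _ _ (Finset.mem_univ i), prodFun]
  · intro j _ hji
    rw [smul_apply, ContinuousLinearMap.comp_apply, ContinuousLinearMap.proj_apply]
    simp only [unitVec, Pi.single_eq_of_ne hji, map_zero, smul_zero]
  · intro h; exact absurd (Finset.mem_univ i) h

theorem ennnorm_sq_eq (z : ℂ) : (‖z‖₊ : ℝ≥0∞) ^ 2 = ENNReal.ofReal (‖z‖ ^ 2) := by
  rw [ENNReal.ofReal_pow (norm_nonneg _), ofReal_norm]; rfl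

/-- **Pointwise kinetic bound**: `|∇Φ|² ≤ 3N (2π/L)² |Φ|²`. [folklore] -/
theorem kineticDensity_prodState_le (N : ℕ) {L : ℝ} (hL : 0 < L) (X : Config N) :
    kineticDensity (prodState N hL).ψ X ≤
      ENNReal.ofReal (3 * N * (2 * Real.pi / L) ^ 2) * (‖(prodState N hL).ψ X‖₊ : ℝ≥0∞) ^ 2 := by
  rw [prodState_ψ]
  have hsq : ∀ (i : Fin N) (k : Fin 3),
      (‖fderiv ℝ (prodFun N L) X (unitVec i k)‖₊ : ℝ≥0∞) ^ 2 ≤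
        ENNReal.ofReal ((2 * Real.pi / L) ^ 2) * (‖prodFun N L X‖₊ : ℝ≥0∞) ^ 2 := by
    intro i k
    rw [ennnorm_sq_eq, ennnorm_sq_eq, ← ENNReal.ofReal_mul (sq_nonneg _), ← mul_pow]
    exact ENNReal.ofReal_le_ofReal (pow_le_pow_left₀ (norm_nonneg _) (norm_fderiv_prodFun_le N hL X i k) 2)
  calc kineticDensity (prodFun N L) X
      = ∑ i : Fin N, ∑ k : Fin 3, (‖fderiv ℝ (prodFun N L) X (unitVec i k)‖₊ : ℝ≥0∞) ^ 2 := rfl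
    _ ≤ ∑ _i : Fin N, ∑ _k : Fin 3,
          ENNReal.ofReal ((2 * Real.pi / L) ^ 2) * (‖prodFun N L X‖₊ : ℝ≥0∞) ^ 2 :=
        Finset.sum_le_sum fun i _ => Finset.sum_le_sum fun k _ => hsq i k
    _ = ENNReal.ofReal (3 * N * (2 * Real.pi / L) ^ 2) * (‖prodFun N L X‖₊ : ℝ≥0∞) ^ 2 := by
        rw [Finset.sum_const, Finset.sum_const, Finset.card_univ, Finset.card_univ, Fintype.card_fin,
          Fintype.card_fin, smul_smul, nsmul_eq_mul, ← mul_assoc]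
        congr 1
        rw [show (3 : ℝ) * N * (2 * Real.pi / L) ^ 2 = ((N * 3 : ℕ) : ℝ) * (2 * Real.pi / L) ^ 2 by
          push_cast; ring, ENNReal.ofReal_mul (by positivity), ENNReal.ofReal_natCast]

/-- **The source term of the product state**: `∫ (∑ᵢ 2cos θᵢ)|Φ|² = (8/9) N`. [folklore] -/
theorem source_prodState (N : ℕ) {L : ℝ} (hL : 0 < L) :
    ∫ X in cellN N L, (∑ i, 2 * Real.cos (θL L (X i))) * ‖(prodState N hL).ψ X‖ ^ 2 = N * (8 / 9) := by
  rw [prodState_ψ]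
  -- one-body integrands
  let g : Fin N → Fin N → Space → ℝ := fun i j =>
    if j = i then fun x => 2 * Real.cos (θL L x) * ‖orb L x‖ ^ 2 else fun x => ‖orb L x‖ ^ 2
  have hcont : Continuous fun x => 2 * Real.cos (θL L x) * ‖orb L x‖ ^ 2 :=
    (continuous_const.mul (Real.continuous_cos.comp (continuous_θL L))).mul ((continuous_orb L).norm.pow 2)
  have hg : ∀ i j, Integrable (g i j) ((volume : Measure Space).restrict (cell L)) := by
    intro i j
    by_cases h : j = i
    · simp only [g, if_pos h]
      refine integrableOn_cell_of_bound (g := fun x => 2 * Real.cos (θL L x) * ‖orb L x‖ ^ 2) hcont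
        (M := 2 * (cL L * (3 / 2)) ^ 2) (fun x => ?_) L
      rw [Real.norm_eq_abs, abs_mul, abs_mul, abs_of_nonneg (sq_nonneg ‖orb L x‖), abs_two]
      have h1 : |Real.cos (θL L x)| ≤ 1 := Real.abs_cos_le_one _
      have h2 : ‖orb L x‖ ^ 2 ≤ (cL L * (3 / 2)) ^ 2 :=
        pow_le_pow_left₀ (norm_nonneg _) (norm_orb_le hL x) 2
      calc 2 * |Real.cos (θL L x)| * ‖orb L x‖ ^ 2 ≤ 2 * 1 * (cL L * (3 / 2)) ^ 2 := by
            gcongr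
        _ = 2 * (cL L * (3 / 2)) ^ 2 := by ring
    · simp only [g, if_neg h]
      exact integrableOn_cell_norm_orb_sq hL
  have hint : ∀ i j, ∫ x in cell L, g i j x = if j = i then 8 / 9 else 1 := by
    intro i j
    by_cases h : j = i
    · simp only [g, if_pos h]; exact integral_cell_two_cos_norm_orb_sq hL
    · simp only [g, if_neg h]; exact integral_cell_norm_orb_sq hL
  -- pointwise: the integrand is `∑ᵢ ∏ⱼ g i j (X j)`
  have hpt : ∀ X : Config N, (∑ i, 2 * Real.cos (θL L (X i))) * ‖prodFun N L X‖ ^ 2 =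
      ∑ i, ∏ j, g i j (X j) := by
    intro X
    rw [norm_prodFun_sq, Finset.sum_mul]
    refine Finset.sum_congr rfl fun i _ => ?_
    rw [← Finset.mul_prod_erase _ _ (Finset.mem_univ i), ← Finset.mul_prod_erase _ _ (Finset.mem_univ i)]
    simp only [g, if_true]
    rw [← mul_assoc]
    congr 1
    exact Finset.prod_congr rfl fun j hj => by rw [if_neg (Finset.ne_of_mem_erase hj)]
  simp_rw [hpt]
  rw [integral_finsetSum _ fun i _ => ?_]
  · rw [volume_restrict_cellN]
    simp_rw [integral_fin_nat_prod_eq_prod, hint]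
    rw [Finset.sum_congr rfl fun i _ => Finset.prod_ite_eq' Finset.univ i (fun _ => (8 / 9 : ℝ))]
    simp
  · rw [volume_restrict_cellN]
    exact Integrable.fin_nat_prod (fun j => hg i j)

/-! ## §6 The crux without the diluteness hypothesis, and its refutation -/

/-- **`DensityResponse` with the diluteness hypothesis `N ≤ ρ₀ L³` deleted** (everything else
verbatim; `ρ₀` survives only in `0 < ρ₀`).  `densityResponse_of_withoutDilute` certifies that this
is the crux minus one hypothesis; `densityResponse_false_without_dilute` refutes it: any proof of
the crux must use diluteness.  (A variant STATEMENT of this file, refuted below — not a literature fact;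
deliberately untagged so that it is not relocated.) -/
def DensityResponseWithoutDilute : Prop :=
  ∀ v : ℝ → ℝ≥0∞, IsRepulsiveFiniteRange v → ∀ M : ℝ, 0 < M → ∃ ρ₀ C : ℝ, 0 < ρ₀ ∧ 0 < C ∧
    ∃ N₀ : ℕ, ∀ N : ℕ, N₀ ≤ N → ∀ L : ℝ, 0 < L → ∀ n : Fin 3 → ℤ, n ≠ 0 →
    2 * Real.pi * ‖(fun j => (n j : ℝ))‖ / L ≤ M * Real.sqrt (N / L ^ 3) → ∀ s : ℝ, 0 ≤ s →
    ∀ Φ : PeriodicTrialState N L,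
      periodicGroundStateEnergy v N L + ENNReal.ofReal (s * |∫ X in cellN N L,
        (∑ i, 2 * Real.cos (2 * Real.pi / L * ∑ j, (n j : ℝ) * X i j)) * ‖Φ.ψ X‖ ^ 2|) ≤
      periodicEnergy v Φ + ENNReal.ofReal (C * s ^ 2 * N /
        ((2 * Real.pi * ‖(fun j => (n j : ℝ))‖ / L) ^ 2 + N / L ^ 3 * (scatteringLength v).toReal))

/-- The deleted hypothesis only weakens: the variant implies the crux. [folklore] -/
theorem densityResponse_of_withoutDilute (h : DensityResponseWithoutDilute) :
    Summit.AtomisticToContinuum.BoseEinsteinCondensation.Theses.BECThomsonPrinciple.DensityResponse := by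
  intro v hv M hM
  obtain ⟨ρ₀, C, hρ₀, hC, N₀, H⟩ := h v hv M hM
  exact ⟨ρ₀, C, hρ₀, hC, N₀, fun N hN L hL _ n hn hw s hs Φ => H N hN L hL n hn hw s hs Φ⟩

/-- The scattering length of the well `8·1_{r ≤ 1}` lies in `[1/2, 1]`. [folklore] -/
theorem scatteringLength_sqWell_eight_one :
    1 / 2 ≤ (scatteringLength (sqWell 8 1)).toReal ∧ (scatteringLength (sqWell 8 1)).toReal ≤ 1 := by
  obtain ⟨h1, h2⟩ := scatteringLength_squareWell_bounds (K := 8) (R := 1) (by norm_num) one_pos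
  have hs : Real.sqrt (2 / 8) = 1 / 2 := by
    rw [show (2 : ℝ) / 8 = (1 / 2) ^ 2 by norm_num, Real.sqrt_sq (by norm_num)]
  rw [hs, show (1 : ℝ) - 1 / 2 = 1 / 2 by norm_num] at h1
  have hfin : scatteringLength (sqWell 8 1) ≠ ⊤ := ne_top_of_le_ne_top ENNReal.ofReal_ne_top h2
  constructor
  · have := ENNReal.toReal_mono hfin h1
    rwa [ENNReal.toReal_ofReal (by norm_num)] at this
  · have := ENNReal.toReal_mono ENNReal.ofReal_ne_top h2
    rwa [ENNReal.toReal_ofReal (by norm_num)] at this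

/-- The final real-arithmetic inequality (all physics scaled out: `u = 1/L = 10368 C`). [folklore] -/
theorem final_ineq {N C u a ω P : ℝ} (hN : 1 ≤ N) (hC : 1 ≤ C) (hu : u = 10368 * C)
    (ha : 1 / 2 ≤ a) (hω0 : 0 ≤ ω) (hω : ω ≤ 8) (hP : P ≤ N ^ 2) :
    3 * N * (2 * Real.pi * u) ^ 2 + P * (8 * ((u + 1) ^ 3 * ω)) +
        (8 / 9) ^ 2 * ((2 * Real.pi * u) ^ 2 + N * u ^ 3 * a) * N / (4 * C) <
      P * (8 * ((u - 1) ^ 3 * ω)) + (8 / 9) ^ 2 * ((2 * Real.pi * u) ^ 2 + N * u ^ 3 * a) * N / (2 * C) := by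
  have hπ := Real.pi_le_four
  have hπ0 := Real.pi_pos
  have hC0 : 0 < C := by linarith
  have hu1 : 10368 ≤ u := by nlinarith
  have hu0 : 0 < u := by linarith
  have hN2 : N ≤ N ^ 2 := by nlinarith
  -- the loss
  have hL1 : 3 * N * (2 * Real.pi * u) ^ 2 ≤ 192 * (N * u ^ 2) := by
    have : Real.pi ^ 2 ≤ 16 := by nlinarith
    nlinarith [mul_nonneg (by linarith : (0:ℝ) ≤ N) (sq_nonneg u)]
  have hL2 : P * (8 * ((u + 1) ^ 3 * ω)) - P * (8 * ((u - 1) ^ 3 * ω)) ≤ 512 * (N ^ 2 * u ^ 2) := by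
    have h1 : P * (8 * ((u + 1) ^ 3 * ω)) - P * (8 * ((u - 1) ^ 3 * ω)) = 8 * (P * ω) * (6 * u ^ 2 + 2) := by
      ring
    rw [h1]
    have h2 : P * ω ≤ N ^ 2 * 8 := mul_le_mul hP hω hω0 (by positivity)
    have h3 : 6 * u ^ 2 + 2 ≤ 8 * u ^ 2 := by nlinarith
    calc 8 * (P * ω) * (6 * u ^ 2 + 2) ≤ 8 * (N ^ 2 * 8) * (8 * u ^ 2) := by
          gcongr
      _ = 512 * (N ^ 2 * u ^ 2) := by ring
  -- the gain
  have hG : 1024 * (N ^ 2 * u ^ 2) ≤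
      (8 / 9) ^ 2 * ((2 * Real.pi * u) ^ 2 + N * u ^ 3 * a) * N / (4 * C) := by
    rw [le_div_iff₀ (by positivity)]
    have h1 : N * u ^ 3 * (1 / 2) ≤ (2 * Real.pi * u) ^ 2 + N * u ^ 3 * a := by
      have : N * u ^ 3 * (1 / 2) ≤ N * u ^ 3 * a := by gcongr
      nlinarith [sq_nonneg (2 * Real.pi * u)]
    have h2 : 1024 * (N ^ 2 * u ^ 2) * (4 * C) = (8 / 9) ^ 2 * (N * u ^ 3 * (1 / 2)) * N * (10368 * C / u) := by
      field_simp
      ring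
    rw [h2, ← hu, div_self hu0.ne', mul_one]
    have hN0 : 0 ≤ N := by linarith
    nlinarith [mul_le_mul_of_nonneg_right h1 hN0]
  have hG2 : (8 / 9) ^ 2 * ((2 * Real.pi * u) ^ 2 + N * u ^ 3 * a) * N / (2 * C) =
      2 * ((8 / 9) ^ 2 * ((2 * Real.pi * u) ^ 2 + N * u ^ 3 * a) * N / (4 * C)) := by
    field_simp
    ring
  have h3 : N * u ^ 2 ≤ N ^ 2 * u ^ 2 := mul_le_mul_of_nonneg_right hN2 (sq_nonneg u)
  have hpos : 0 < N ^ 2 * u ^ 2 := by positivity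
  linarith [hL1, hL2, hG, hG2, h3, hpos]


/-! ## §7 Refutation of the undiluted crux -/

/-- **Diluteness `N ≤ ρ₀L³` is load-bearing for `DensityResponse`.**  Witness: the square well
`v = 8·1_{r ≤ 1}` (scattering length `a ∈ [½, 1]`), `M = 1`, and, given the prover's `C, N₀`, the
box `L = 1/(10368·max(C,1))`, `N = max(N₀,1)` particles, the lowest mode `n = e₀` (inside the window
since `4π²L ≤ 1 ≤ N`), the modulated product state `Φ = ∏ᵢ c(1 + ½cos(2πx_{i,0}/L))` and the
optimal tilt `s = (8/9)(k² + ρa)/(2C)`.  Mechanism: for `L ≪ R` every particle interacts with all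
`≈ (4π/3)(R/L)³` images of every other, the periodised potential is constant up to the lattice-point
discrepancy `O((L/R)·mean)` (§1–§2), so `E₀` is known to that accuracy from BELOW (`E₀ ≥ #pairs·inf v^per`,
no kinetic energy needed) while the gas responds like a FREE gas (`χ/N ≈ 2/k²`); the crux's stiffness
`ρa` in the denominator is then spurious and the chord fails by a factor `≈ ρa/(Ck²) → ∞`.
Any proof of the crux must therefore use `N ≤ ρ₀L³` (with `N ≥ N₀` it forces `L ≥ (N₀/ρ₀)^{1/3} ≫ R`,
nearest-image periodisation and genuinely dilute scattering physics). [folklore] -/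
theorem densityResponse_false_without_dilute : ¬ DensityResponseWithoutDilute := by
  intro H
  obtain ⟨ρ₀, C, -, hC, N₀, H⟩ := H (sqWell 8 1) (isRepulsiveFiniteRange_sqWell 8 1) 1 one_pos
  -- constants: C' = max C 1, u = 1/L = 10368 C', N = max N₀ 1
  obtain ⟨C', hC'1, hCC'⟩ : ∃ C' : ℝ, 1 ≤ C' ∧ C ≤ C' := ⟨max C 1, le_max_right _ _, le_max_left _ _⟩
  have hC'0 : 0 < C' := lt_of_lt_of_le one_pos hC'1
  obtain ⟨u, hu⟩ : ∃ u : ℝ, u = 10368 * C' := ⟨_, rfl⟩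
  have hu1 : 10368 ≤ u := by rw [hu]; nlinarith
  have hu0 : 0 < u := by linarith
  have hL : (0 : ℝ) < u⁻¹ := inv_pos.2 hu0
  have hL1 : u⁻¹ ≤ 1 := inv_le_one_of_one_le₀ (by linarith)
  have hdiv : ∀ z : ℝ, z / u⁻¹ = z * u := fun z => by rw [div_eq_mul_inv, inv_inv]
  have hdiv3 : ∀ z : ℝ, z / u⁻¹ ^ 3 = z * u ^ 3 := fun z => by rw [div_eq_mul_inv, inv_pow, inv_inv]
  obtain ⟨N, hN0, hN1⟩ : ∃ N : ℕ, N₀ ≤ N ∧ 1 ≤ N := ⟨max N₀ 1, le_max_left _ _, le_max_right _ _⟩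
  have hN1r : (1 : ℝ) ≤ N := by exact_mod_cast hN1
  obtain ⟨ha1, ha2⟩ := scatteringLength_sqWell_eight_one
  -- the lowest mode `n = e₀`
  obtain ⟨n, hn_def⟩ : ∃ n : Fin 3 → ℤ, n = Pi.single 0 1 := ⟨_, rfl⟩
  have hn : n ≠ 0 := by
    intro h; have := congr_fun h 0; simp [hn_def] at this
  have hnorm : ‖(fun j => (n j : ℝ))‖ = 1 := by
    have : (fun j => (n j : ℝ)) = Pi.single (0 : Fin 3) (1 : ℝ) := by
      funext j; simp only [hn_def, Pi.single_apply]; split_ifs <;> simp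
    rw [this, Pi.norm_single, norm_one]
  have hphase : ∀ x : Space, 2 * Real.pi / u⁻¹ * ∑ j, (n j : ℝ) * x j = θL u⁻¹ x := by
    intro x; simp [hn_def, Pi.single_apply, θL]
  -- the denominator `D = k² + ρa` and the tilt `s`
  obtain ⟨D, hD⟩ : ∃ D : ℝ, D = (2 * Real.pi * u) ^ 2 + N * u ^ 3 * (scatteringLength (sqWell 8 1)).toReal :=
    ⟨_, rfl⟩
  have hD0 : 0 < D := by rw [hD]; positivity
  obtain ⟨s, hs_def⟩ : ∃ s : ℝ, s = 8 / 9 * D / (2 * C') := ⟨_, rfl⟩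
  have hs : 0 ≤ s := by rw [hs_def]; positivity
  -- the window: `2π/L ≤ √(N/L³)` since `4π² ≤ u ≤ N u`
  have hwin : 2 * Real.pi * ‖(fun j => (n j : ℝ))‖ / u⁻¹ ≤ 1 * Real.sqrt (N / u⁻¹ ^ 3) := by
    rw [hnorm, mul_one, one_mul, hdiv, hdiv3]
    apply Real.le_sqrt_of_sq_le
    have hπ := Real.pi_le_four
    have hπ0 := Real.pi_pos
    have hπ2 : Real.pi ^ 2 ≤ 16 := by nlinarith
    have h1 : (2 * Real.pi * u) ^ 2 ≤ 64 * u ^ 2 := by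
      nlinarith [mul_le_mul_of_nonneg_right hπ2 (sq_nonneg u)]
    have h2 : 64 * u ^ 2 ≤ (N : ℝ) * u ^ 3 := by
      have : (64 : ℝ) * 1 ≤ u * N := mul_le_mul (by linarith) hN1r (by norm_num) hu0.le
      nlinarith [sq_nonneg u]
    linarith
  -- apply the undiluted crux to the product state
  have key := H N hN0 u⁻¹ hL n hn hwin s hs (prodState N hL)
  have hsrc : ∫ X in cellN N u⁻¹, (∑ i, 2 * Real.cos (2 * Real.pi / u⁻¹ * ∑ j, (n j : ℝ) * X i j)) *
      ‖(prodState N hL).ψ X‖ ^ 2 = N * (8 / 9) := by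
    simp_rw [hphase]; exact source_prodState N hL
  have hden : (2 * Real.pi * ‖(fun j => (n j : ℝ))‖ / u⁻¹) ^ 2 +
      N / u⁻¹ ^ 3 * (scatteringLength (sqWell 8 1)).toReal = D := by
    rw [hnorm, mul_one, hdiv, hdiv3, hD]
  rw [hsrc, hden, abs_of_nonneg (by positivity)] at key
  -- enlarge the constant to `C'`
  have key' : periodicGroundStateEnergy (sqWell 8 1) N u⁻¹ + ENNReal.ofReal (s * (N * (8 / 9))) ≤
      periodicEnergy (sqWell 8 1) (prodState N hL) + ENNReal.ofReal (C' * s ^ 2 * N / D) :=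
    key.trans (add_le_add le_rfl (ENNReal.ofReal_le_ofReal
      (div_le_div_of_nonneg_right (show C * s ^ 2 * N ≤ C' * s ^ 2 * N by gcongr) hD0.le)))
  -- the squeeze of the periodised well: `m₋ ≤ v^per ≤ m₊`
  have hlow : ∀ y, ENNReal.ofReal (8 * ((u - 1) ^ 3 * ω₃)) ≤ periodizedPotential (sqWell 8 1) u⁻¹ y := by
    intro y
    have := le_periodizedPotential_sqWell (K := 8) (R := 1) (by norm_num) hL hL1 y
    rwa [hdiv, one_mul] at this
  have hupp : ∀ y, periodizedPotential (sqWell 8 1) u⁻¹ y ≤ ENNReal.ofReal (8 * ((u + 1) ^ 3 * ω₃)) := by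
    intro y
    have := periodizedPotential_sqWell_le (K := 8) (R := 1) (by norm_num) zero_le_one hL y
    rwa [hdiv, one_mul] at this
  -- `E₀ ≥ P m₋` and `E(Φ) ≤ T + P m₊`
  have hω0 := ω₃_nonneg
  have hm0 : 0 ≤ 8 * ((u - 1) ^ 3 * ω₃) := by
    have : 0 ≤ u - 1 := by linarith
    positivity
  have hE0 : ENNReal.ofReal ((pairCount N : ℝ) * (8 * ((u - 1) ^ 3 * ω₃))) ≤
      periodicGroundStateEnergy (sqWell 8 1) N u⁻¹ := by
    rw [ENNReal.ofReal_mul (Nat.cast_nonneg _), ENNReal.ofReal_natCast]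
    exact le_periodicGroundStateEnergy_of_le ENNReal.ofReal_ne_top hlow
  have hEΦ : periodicEnergy (sqWell 8 1) (prodState N hL) ≤
      ENNReal.ofReal (3 * N * (2 * Real.pi * u) ^ 2 + (pairCount N : ℝ) * (8 * ((u + 1) ^ 3 * ω₃))) := by
    have h := periodicEnergy_le_of_pointwise (v := sqWell 8 1) (prodState N hL) ENNReal.ofReal_ne_top
      ENNReal.ofReal_ne_top (kineticDensity_prodState_le N hL) hupp
    rw [hdiv] at h
    refine h.trans (le_of_eq ?_)
    rw [ENNReal.ofReal_add (by positivity) (by positivity), ENNReal.ofReal_mul (Nat.cast_nonneg _),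
      ENNReal.ofReal_natCast]
  -- collect everything into one real inequality
  have hcomb : ENNReal.ofReal ((pairCount N : ℝ) * (8 * ((u - 1) ^ 3 * ω₃)) + s * (N * (8 / 9))) ≤
      ENNReal.ofReal (3 * N * (2 * Real.pi * u) ^ 2 + (pairCount N : ℝ) * (8 * ((u + 1) ^ 3 * ω₃)) +
        C' * s ^ 2 * N / D) := by
    rw [ENNReal.ofReal_add (by positivity) (by positivity),
      ENNReal.ofReal_add (by positivity) (by positivity)]
    exact ((add_le_add hE0 le_rfl).trans key').trans (add_le_add hEΦ le_rfl)
  have hreal := (ENNReal.ofReal_le_ofReal_iff (by positivity)).1 hcomb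
  -- the two closed forms of the tilt terms
  have hs1 : s * (N * (8 / 9)) = (8 / 9) ^ 2 * D * N / (2 * C') := by
    rw [hs_def]; field_simp
  have hs2 : C' * s ^ 2 * N / D = (8 / 9) ^ 2 * D * N / (4 * C') := by
    rw [hs_def]; field_simp; ring
  rw [hs1, hs2, hD] at hreal
  have hP : (pairCount N : ℝ) ≤ (N : ℝ) ^ 2 := by exact_mod_cast pairCount_le N
  exact absurd hreal (not_le.2 (final_ineq hN1r hC'1 hu ha1 hω0 ω₃_le_eight hP))


/-! ## §8 Chord structure (re-derived from generation 1): `|⟨V_k⟩| ≤ 2N`, large `s` is trivial -/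

/-- A periodic trial state has Bochner-integrable `|Ψ|²` on the cell, with integral `1`. [folklore] -/
theorem integrableOn_cellN_norm_sq {N : ℕ} {L : ℝ} (Φ : PeriodicTrialState N L) :
    IntegrableOn (fun X => ‖Φ.ψ X‖ ^ 2) (cellN N L) := by
  have hc : Continuous fun X => ‖Φ.ψ X‖ ^ 2 := by exact Φ.contDiff.continuous.norm.pow 2
  refine ⟨hc.aestronglyMeasurable, ?_⟩
  rw [HasFiniteIntegral]
  have h : ∀ X, ‖‖Φ.ψ X‖ ^ 2‖ₑ = (‖Φ.ψ X‖₊ : ℝ≥0∞) ^ 2 := by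
    intro X
    rw [Real.enorm_eq_ofReal (sq_nonneg _), ← ennnorm_sq_eq]
  simp_rw [h]
  rw [Φ.norm_eq]
  exact ENNReal.one_lt_top

/-- `∫_{cellN} |Ψ|² = 1` (Bochner form of the normalisation). [folklore] -/
theorem integral_cellN_norm_sq {N : ℕ} {L : ℝ} (Φ : PeriodicTrialState N L) :
    ∫ X in cellN N L, ‖Φ.ψ X‖ ^ 2 = 1 := by
  have hc : Continuous fun X => ‖Φ.ψ X‖ ^ 2 := by exact Φ.contDiff.continuous.norm.pow 2
  rw [integral_eq_lintegral_of_nonneg_ae (f := fun X => ‖Φ.ψ X‖ ^ 2) (ae_of_all _ fun X => by positivity)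
    hc.aestronglyMeasurable]
  simp_rw [← ennnorm_sq_eq]
  rw [Φ.norm_eq, ENNReal.toReal_one]

/-- **`|⟨Σᵢ 2cos(k·xᵢ)⟩_Φ| ≤ 2N`** for every periodic trial state and every mode. [folklore] -/
theorem abs_source_le {N : ℕ} {L : ℝ} (Φ : PeriodicTrialState N L) (n : Fin 3 → ℤ) :
    |∫ X in cellN N L, (∑ i, 2 * Real.cos (2 * Real.pi / L * ∑ j, (n j : ℝ) * X i j)) * ‖Φ.ψ X‖ ^ 2| ≤
      2 * N := by
  have hg := integrableOn_cellN_norm_sq Φ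
  have hpt : ∀ X : Config N,
      |(∑ i, 2 * Real.cos (2 * Real.pi / L * ∑ j, (n j : ℝ) * X i j)) * ‖Φ.ψ X‖ ^ 2| ≤
        2 * N * ‖Φ.ψ X‖ ^ 2 := by
    intro X
    rw [abs_mul, abs_of_nonneg (sq_nonneg ‖Φ.ψ X‖)]
    refine mul_le_mul_of_nonneg_right ?_ (sq_nonneg _)
    calc |∑ i, 2 * Real.cos (2 * Real.pi / L * ∑ j, (n j : ℝ) * X i j)|
        ≤ ∑ i, |2 * Real.cos (2 * Real.pi / L * ∑ j, (n j : ℝ) * X i j)| := Finset.abs_sum_le_sum_abs _ _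
      _ ≤ ∑ _i : Fin N, (2 : ℝ) := Finset.sum_le_sum fun i _ => by
          rw [abs_mul, abs_two]
          have := Real.abs_cos_le_one (2 * Real.pi / L * ∑ j, (n j : ℝ) * X i j)
          linarith
      _ = 2 * N := by simp [mul_comm]
  calc |∫ X in cellN N L, (∑ i, 2 * Real.cos (2 * Real.pi / L * ∑ j, (n j : ℝ) * X i j)) * ‖Φ.ψ X‖ ^ 2|
      ≤ ∫ X in cellN N L, |(∑ i, 2 * Real.cos (2 * Real.pi / L * ∑ j, (n j : ℝ) * X i j)) * ‖Φ.ψ X‖ ^ 2| :=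
        abs_integral_le_integral_abs
    _ ≤ ∫ X in cellN N L, 2 * N * ‖Φ.ψ X‖ ^ 2 :=
        integral_mono_of_nonneg (ae_of_all _ fun X => abs_nonneg _) (hg.const_mul _) (ae_of_all _ hpt)
    _ = 2 * N := by rw [integral_const_mul, integral_cellN_norm_sq, mul_one]

/-- The window's wavenumber is positive: `0 < 2π‖n‖/L` for `n ≠ 0`. [folklore] -/
theorem kinf_pos {L : ℝ} (hL : 0 < L) {n : Fin 3 → ℤ} (hn : n ≠ 0) :
    0 < 2 * Real.pi * ‖(fun j => (n j : ℝ))‖ / L := by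
  have : (fun j => (n j : ℝ)) ≠ 0 := by
    intro h
    apply hn
    funext j
    have h' : (n j : ℝ) = 0 := congr_fun h j
    exact_mod_cast h'
  have hpos := norm_pos_iff.2 this
  positivity

/-- **For `s ≥ 2(k∞² + ρa)/C` the chord holds trivially, for EVERY `v` and every state** (`E₀ ≤ E(Φ)`
and `s·|⟨V⟩| ≤ 2sN ≤ Cs²N/(k∞² + ρa)`): the content of the crux is `0 ≤ s ≤ 2(k∞² + ρa)/C`.
[folklore] -/
theorem chord_trivial_large_s {N : ℕ} {L : ℝ} (hL : 0 < L) (v : ℝ → ℝ≥0∞) (Φ : PeriodicTrialState N L)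
    {n : Fin 3 → ℤ} (hn : n ≠ 0) {C s : ℝ} (hC : 0 < C)
    (hs : 2 * ((2 * Real.pi * ‖(fun j => (n j : ℝ))‖ / L) ^ 2 +
      N / L ^ 3 * (scatteringLength v).toReal) / C ≤ s) :
    periodicGroundStateEnergy v N L + ENNReal.ofReal (s * |∫ X in cellN N L,
        (∑ i, 2 * Real.cos (2 * Real.pi / L * ∑ j, (n j : ℝ) * X i j)) * ‖Φ.ψ X‖ ^ 2|) ≤
      periodicEnergy v Φ + ENNReal.ofReal (C * s ^ 2 * N /
        ((2 * Real.pi * ‖(fun j => (n j : ℝ))‖ / L) ^ 2 + N / L ^ 3 * (scatteringLength v).toReal)) := by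
  have hk := kinf_pos hL hn
  have hD : 0 < (2 * Real.pi * ‖(fun j => (n j : ℝ))‖ / L) ^ 2 + N / L ^ 3 * (scatteringLength v).toReal := by
    have : 0 ≤ (N : ℝ) / L ^ 3 * (scatteringLength v).toReal := by positivity
    positivity
  have hs0 : 0 ≤ s := le_trans (by positivity) hs
  refine add_le_add (periodicGroundStateEnergy_le v Φ) (ENNReal.ofReal_le_ofReal ?_)
  calc s * |∫ X in cellN N L, (∑ i, 2 * Real.cos (2 * Real.pi / L * ∑ j, (n j : ℝ) * X i j)) * ‖Φ.ψ X‖ ^ 2|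
      ≤ s * (2 * N) := mul_le_mul_of_nonneg_left (abs_source_le Φ n) hs0
    _ ≤ C * s ^ 2 * N /
        ((2 * Real.pi * ‖(fun j => (n j : ℝ))‖ / L) ^ 2 + N / L ^ 3 * (scatteringLength v).toReal) := by
        rw [le_div_iff₀ hD]
        rw [div_le_iff₀ hC] at hs
        have hN : (0 : ℝ) ≤ N := Nat.cast_nonneg _
        nlinarith [mul_nonneg hN hs0]


/-- **The chord over all tilts is a square-root bound** (gen 1's `forall_chord_iff`, real core):
for `A ≥ 0`, `D > 0` (and any `B`), `(∀ s ≥ 0, sA ≤ B + Ds²) ↔ A² ≤ 4BD`.  With `A = |⟨V_k⟩_Φ|`,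
`B = E(Φ) − E₀`, `D = CN/(k∞² + ρa)` this is `|⟨V_k⟩_Φ|² ≤ 4CN(E(Φ) − E₀)/(k∞² + ρa)`, i.e. the
static response bound `χ(k) ≤ 2CN/(k² + ρa)`. [folklore] -/
theorem forall_tilt_iff_sq_le {A B D : ℝ} (hA : 0 ≤ A) (hD : 0 < D) :
    (∀ s : ℝ, 0 ≤ s → s * A ≤ B + D * s ^ 2) ↔ A ^ 2 ≤ 4 * B * D := by
  constructor
  · intro h
    have := h (A / (2 * D)) (by positivity)
    have e : A / (2 * D) * A - D * (A / (2 * D)) ^ 2 = A ^ 2 / (4 * D) := by field_simp; ring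
    rw [← sub_le_iff_le_add, e, div_le_iff₀ (by positivity)] at this
    linarith
  · intro h s _
    nlinarith [sq_nonneg (2 * D * s - A), hD]

/-! ## §9 The free chord (generation 1's `holds_free_four`, re-derived importably):
`s|⟨V_k⟩_Φ| ≤ T(Φ) + 4s²N/k∞²` for EVERY periodic trial state -/

section FreeChord

variable {N : ℕ} {L : ℝ}

/-- The closed cube `[0,L]^{3N}` is compact. [folklore] -/
theorem isCompact_closedCube (N : ℕ) (L : ℝ) : IsCompact {X : Config N | ∀ i k, X i k ∈ Set.Icc 0 L} := by
  have hC : IsCompact {x : Space | ∀ k, x k ∈ Set.Icc 0 L} := by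
    have : {x : Space | ∀ k, x k ∈ Set.Icc 0 L} =
        (WithLp.toLp 2) '' (Set.univ.pi fun _ : Fin 3 => Set.Icc (0 : ℝ) L) := by
      ext x
      simp only [Set.mem_setOf_eq, Set.mem_image, Set.mem_univ_pi]
      constructor
      · intro h; exact ⟨WithLp.ofLp x, h, rfl⟩
      · rintro ⟨y, hy, rfl⟩; exact hy
    rw [this]
    exact (isCompact_univ_pi fun _ => isCompact_Icc).image (PiLp.continuous_toLp 2 _)
  have : {X : Config N | ∀ i k, X i k ∈ Set.Icc 0 L} =
      Set.univ.pi fun _ : Fin N => {x : Space | ∀ k, x k ∈ Set.Icc 0 L} := by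
    ext X; simp only [Set.mem_setOf_eq, Set.mem_univ_pi]
  rw [this]
  exact isCompact_univ_pi fun _ => hC

/-- **Continuous functions are integrable on the cell `[0,L)^{3N}`** (bounded on the compact closed
cube, finite volume). [folklore] -/
theorem integrableOn_cellN_of_continuous {E : Type*} [NormedAddCommGroup E] {f : Config N → E}
    (hf : Continuous f) (L : ℝ) : IntegrableOn f (cellN N L) := by
  obtain ⟨M, hM⟩ := (isCompact_closedCube N L).exists_bound_of_continuousOn hf.continuousOn
  refine Measure.integrableOn_of_bounded (M := M) ?_ hf.aestronglyMeasurable ?_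
  · rw [volume_cellN]; exact ENNReal.pow_ne_top (ENNReal.pow_ne_top ENNReal.ofReal_ne_top)
  · refine ae_restrict_of_forall_mem (measurableSet_cellN N L) fun X hX => hM X fun i k => ?_
    exact Set.Ico_subset_Icc_self (hX i k)

/-- The phase of particle `i`: `θᵢ(X) = (2π/L) ∑ⱼ nⱼ x_{i,j}`. [folklore] -/
def phase (n : Fin 3 → ℤ) (L : ℝ) (i : Fin N) (X : Config N) : ℝ :=
  2 * Real.pi / L * ∑ j, (n j : ℝ) * X i j

@[simp] theorem euclideanProj_apply (j : Fin 3) (x : Space) : EuclideanSpace.proj (𝕜 := ℝ) j x = x j := rfl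

/-- The phase as a continuous linear form. [folklore] -/
def phaseCLM (n : Fin 3 → ℤ) (L : ℝ) (i : Fin N) : Config N →L[ℝ] ℝ :=
  (2 * Real.pi / L) • ∑ j : Fin 3, (n j : ℝ) •
    ((EuclideanSpace.proj (𝕜 := ℝ) j).comp (ContinuousLinearMap.proj (R := ℝ) (φ := fun _ => Space) i))

theorem phaseCLM_apply (n : Fin 3 → ℤ) (L : ℝ) (i : Fin N) (X : Config N) :
    phaseCLM n L i X = phase n L i X := by
  simp only [phaseCLM, phase, smul_apply, FunLike.coe_sum, Finset.sum_apply,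
    ContinuousLinearMap.comp_apply, ContinuousLinearMap.proj_apply, euclideanProj_apply, smul_eq_mul]

theorem hasFDerivAt_phase (n : Fin 3 → ℤ) (L : ℝ) (i : Fin N) (X : Config N) :
    HasFDerivAt (phase n L i) (phaseCLM n L i) X := by
  have : (phase n L i : Config N → ℝ) = phaseCLM n L i := by
    funext Y; rw [phaseCLM_apply]
  rw [this]
  exact (phaseCLM n L i).hasFDerivAt

theorem contDiff_phase (n : Fin 3 → ℤ) (L : ℝ) (i : Fin N) : ContDiff ℝ 1 (phase n L i : Config N → ℝ) := by
  have : (phase n L i : Config N → ℝ) = phaseCLM n L i := by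
    funext Y; rw [phaseCLM_apply]
  rw [this]
  exact (phaseCLM n L i).contDiff

theorem continuous_phase (n : Fin 3 → ℤ) (L : ℝ) (i : Fin N) : Continuous (phase n L i : Config N → ℝ) :=
  (contDiff_phase n L i).continuous

/-- `∂_{i',l} θᵢ = (2π/L) n_l [i' = i]`. [folklore] -/
theorem phaseCLM_unitVec (n : Fin 3 → ℤ) (L : ℝ) (i i' : Fin N) (l : Fin 3) :
    phaseCLM n L i (unitVec i' l) = if i' = i then 2 * Real.pi / L * n l else 0 := by
  rw [phaseCLM_apply, phase]
  by_cases h : i' = i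
  · subst h
    rw [if_pos rfl]
    congr 1
    simp [unitVec, PiLp.single_apply]
  · rw [if_neg h]
    simp [unitVec, Pi.single_eq_of_ne (Ne.symm h)]

/-- Lattice shifts change the phase by an integer multiple of `2π`. [folklore] -/
theorem phase_add_single (hL : L ≠ 0) (n : Fin 3 → ℤ) (i i' : Fin N) (k : Fin 3) (X : Config N) :
    phase n L i (X + Pi.single i' (EuclideanSpace.single k L)) =
      phase n L i X + (if i' = i then ((n k : ℤ) : ℝ) * (2 * Real.pi) else 0) := by
  unfold phase
  by_cases h : i' = i
  · subst h
    rw [if_pos rfl]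
    simp only [Pi.add_apply, Pi.single_eq_same, PiLp.add_apply, PiLp.single_apply, mul_add,
      Finset.sum_add_distrib, mul_ite, mul_zero, Finset.sum_ite_eq', Finset.mem_univ, if_true]
    field_simp
  · rw [if_neg h]
    simp [Pi.single_eq_of_ne (Ne.symm h)]

theorem sin_phase_periodic (hL : L ≠ 0) (n : Fin 3 → ℤ) (i : Fin N) :
    IsLatticePeriodic L (fun X : Config N => Real.sin (phase n L i X)) := by
  intro X i' k
  simp only
  rw [phase_add_single hL]
  split_ifs
  · exact Real.sin_add_int_mul_two_pi _ _
  · rw [add_zero]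

theorem normSq_periodic (Φ : PeriodicTrialState N L) :
    IsLatticePeriodic L (fun X : Config N => ‖Φ.ψ X‖ ^ 2) := by
  intro X i k
  simp only [Φ.periodic X i k]

/-- **Integration by parts on the torus against `sin θᵢ |Φ|²`**:
`(2πn_l/L) ∫ cos θᵢ |Φ|² = -∫ sin θᵢ · 2⟪Φ, ∂_{i,l}Φ⟫`. [folklore] -/
theorem ibp_cos_normSq (hL : 0 < L) (n : Fin 3 → ℤ) (Φ : PeriodicTrialState N L) (i : Fin N) (l : Fin 3) :
    (2 * Real.pi / L * n l) * ∫ X in cellN N L, Real.cos (phase n L i X) * ‖Φ.ψ X‖ ^ 2 =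
      - ∫ X in cellN N L, Real.sin (phase n L i X) *
          (2 * @inner ℝ ℂ _ (Φ.ψ X) (fderiv ℝ Φ.ψ X (unitVec i l))) := by
  -- the test function and its partial derivative
  set G : Config N → ℝ := fun X => Real.sin (phase n L i X) * ‖Φ.ψ X‖ ^ 2 with hG_def
  have hΦd : Differentiable ℝ Φ.ψ := Φ.contDiff.differentiable one_ne_zero
  have hGc : ContDiff ℝ 1 G :=
    (Real.contDiff_sin.comp (contDiff_phase n L i)).mul (Φ.contDiff.norm_sq ℝ)
  have hGp : IsLatticePeriodic L G := (sin_phase_periodic hL.ne' n i).mul (normSq_periodic Φ)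
  have hder : ∀ X, pderiv i l G X = (2 * Real.pi / L * n l) * (Real.cos (phase n L i X) * ‖Φ.ψ X‖ ^ 2) +
      Real.sin (phase n L i X) * (2 * @inner ℝ ℂ _ (Φ.ψ X) (fderiv ℝ Φ.ψ X (unitVec i l))) := by
    intro X
    have hs : HasFDerivAt (fun Y => Real.sin (phase n L i Y))
        (Real.cos (phase n L i X) • phaseCLM n L i) X := (hasFDerivAt_phase n L i X).sin
    have hq : HasFDerivAt (fun Y => ‖Φ.ψ Y‖ ^ 2)
        (2 • (innerSL ℝ (Φ.ψ X)).comp (fderiv ℝ Φ.ψ X)) X := (hΦd X).hasFDerivAt.norm_sq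
    have hm := (hs.mul hq).fderiv
    have hGeq : G = ((fun Y => Real.sin (phase n L i Y)) * fun Y => ‖Φ.ψ Y‖ ^ 2) := rfl
    change fderiv ℝ G X (unitVec i l) = _
    rw [hGeq, hm]
    simp only [FunLike.coe_add, Pi.add_apply, smul_apply, ContinuousLinearMap.comp_apply,
      phaseCLM_unitVec, smul_eq_mul]
    change Real.sin (phase n L i X) * ((2 : ℕ) • @inner ℝ ℂ _ (Φ.ψ X) (fderiv ℝ Φ.ψ X (unitVec i l))) +
      ‖Φ.ψ X‖ ^ 2 * (Real.cos (phase n L i X) * (2 * Real.pi / L * ↑(n l))) = _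
    rw [nsmul_eq_mul]
    push_cast
    ring
  have hibp := integral_cellN_pderiv_eq_zero hL hGc hGp i l
  simp_rw [hder] at hibp
  have hA : IntegrableOn (fun X => (2 * Real.pi / L * n l) * (Real.cos (phase n L i X) * ‖Φ.ψ X‖ ^ 2))
      (cellN N L) :=
    integrableOn_cellN_of_continuous (continuous_const.mul
      ((Real.continuous_cos.comp (continuous_phase n L i)).mul (Φ.contDiff.continuous.norm.pow 2))) L
  have hB : IntegrableOn (fun X => Real.sin (phase n L i X) *
      (2 * @inner ℝ ℂ _ (Φ.ψ X) (fderiv ℝ Φ.ψ X (unitVec i l)))) (cellN N L) :=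
    integrableOn_cellN_of_continuous ((Real.continuous_sin.comp (continuous_phase n L i)).mul
      (continuous_const.mul (Φ.contDiff.continuous.inner
        ((Φ.contDiff.continuous_fderiv one_ne_zero).clm_apply continuous_const)))) L
  rw [integral_add hA hB, integral_const_mul] at hibp
  linarith

/-- **Per-particle bound**: `|∫ 2cos θᵢ |Φ|²| ≤ (2/k∞)(ε ∫|∂_{i,l}Φ|² + ε⁻¹)` for the sup-norm axis `l`
and every `ε > 0` (IBP + pointwise AM–GM + normalisation). [folklore] -/
theorem abs_integral_two_cos_le (hL : 0 < L) (n : Fin 3 → ℤ) (Φ : PeriodicTrialState N L) (i : Fin N)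
    {l : Fin 3} (hl : n l ≠ 0) {ε : ℝ} (hε : 0 < ε) :
    |∫ X in cellN N L, 2 * Real.cos (phase n L i X) * ‖Φ.ψ X‖ ^ 2| ≤
      2 / (2 * Real.pi / L * |(n l : ℝ)|) *
        (ε * (∫ X in cellN N L, ‖fderiv ℝ Φ.ψ X (unitVec i l)‖ ^ 2) + ε⁻¹) := by
  have hk : 0 < 2 * Real.pi / L * |(n l : ℝ)| := by
    have : (0 : ℝ) < |(n l : ℝ)| := abs_pos.2 (by exact_mod_cast hl)
    positivity
  have hibp := ibp_cos_normSq hL n Φ i l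
  -- |k_l| |∫ cos| = |∫ sin · 2⟪Φ,∂Φ⟫| ≤ ∫ 2 |Φ| |∂Φ| ≤ ε ∫|∂Φ|² + ε⁻¹ ∫ |Φ|²
  have hD : Continuous fun X => fderiv ℝ Φ.ψ X (unitVec i l) :=
    (Φ.contDiff.continuous_fderiv one_ne_zero).clm_apply continuous_const
  have hint1 : IntegrableOn (fun X => ‖fderiv ℝ Φ.ψ X (unitVec i l)‖ ^ 2) (cellN N L) :=
    integrableOn_cellN_of_continuous (hD.norm.pow 2) L
  have hint2 : IntegrableOn (fun X => ‖Φ.ψ X‖ ^ 2) (cellN N L) := integrableOn_cellN_norm_sq Φ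
  have hbound : |∫ X in cellN N L, Real.sin (phase n L i X) *
      (2 * @inner ℝ ℂ _ (Φ.ψ X) (fderiv ℝ Φ.ψ X (unitVec i l)))| ≤
      ε * (∫ X in cellN N L, ‖fderiv ℝ Φ.ψ X (unitVec i l)‖ ^ 2) + ε⁻¹ := by
    have hpt : ∀ X : Config N, |Real.sin (phase n L i X) *
        (2 * @inner ℝ ℂ _ (Φ.ψ X) (fderiv ℝ Φ.ψ X (unitVec i l)))| ≤
        ε * ‖fderiv ℝ Φ.ψ X (unitVec i l)‖ ^ 2 + ε⁻¹ * ‖Φ.ψ X‖ ^ 2 := by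
      intro X
      have h1 : |Real.sin (phase n L i X)| ≤ 1 := Real.abs_sin_le_one _
      have h2 := abs_real_inner_le_norm (Φ.ψ X) (fderiv ℝ Φ.ψ X (unitVec i l))
      have h3 : |Real.sin (phase n L i X) * (2 * @inner ℝ ℂ _ (Φ.ψ X) (fderiv ℝ Φ.ψ X (unitVec i l)))| ≤
          2 * (‖Φ.ψ X‖ * ‖fderiv ℝ Φ.ψ X (unitVec i l)‖) := by
        rw [abs_mul, abs_mul, abs_two]
        calc |Real.sin (phase n L i X)| * (2 * |@inner ℝ ℂ _ (Φ.ψ X) (fderiv ℝ Φ.ψ X (unitVec i l))|)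
            ≤ 1 * (2 * (‖Φ.ψ X‖ * ‖fderiv ℝ Φ.ψ X (unitVec i l)‖)) := by gcongr
          _ = _ := one_mul _
      have h4 : 2 * (‖Φ.ψ X‖ * ‖fderiv ℝ Φ.ψ X (unitVec i l)‖) ≤
          ε * ‖fderiv ℝ Φ.ψ X (unitVec i l)‖ ^ 2 + ε⁻¹ * ‖Φ.ψ X‖ ^ 2 := by
        have hsq := sq_nonneg (ε * ‖fderiv ℝ Φ.ψ X (unitVec i l)‖ - ‖Φ.ψ X‖)
        have hid : ε * ‖fderiv ℝ Φ.ψ X (unitVec i l)‖ ^ 2 + ε⁻¹ * ‖Φ.ψ X‖ ^ 2 -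
            2 * (‖Φ.ψ X‖ * ‖fderiv ℝ Φ.ψ X (unitVec i l)‖) =
            (ε * ‖fderiv ℝ Φ.ψ X (unitVec i l)‖ - ‖Φ.ψ X‖) ^ 2 / ε := by
          field_simp
          ring
        have : 0 ≤ (ε * ‖fderiv ℝ Φ.ψ X (unitVec i l)‖ - ‖Φ.ψ X‖) ^ 2 / ε := div_nonneg hsq hε.le
        linarith
      exact h3.trans h4
    calc |∫ X in cellN N L, Real.sin (phase n L i X) *
          (2 * @inner ℝ ℂ _ (Φ.ψ X) (fderiv ℝ Φ.ψ X (unitVec i l)))|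
        ≤ ∫ X in cellN N L, |Real.sin (phase n L i X) *
          (2 * @inner ℝ ℂ _ (Φ.ψ X) (fderiv ℝ Φ.ψ X (unitVec i l)))| := abs_integral_le_integral_abs
      _ ≤ ∫ X in cellN N L, (ε * ‖fderiv ℝ Φ.ψ X (unitVec i l)‖ ^ 2 + ε⁻¹ * ‖Φ.ψ X‖ ^ 2) :=
          integral_mono_of_nonneg (ae_of_all _ fun X => abs_nonneg _)
            ((hint1.const_mul ε).fun_add (hint2.const_mul ε⁻¹)) (ae_of_all _ hpt)
      _ = ε * (∫ X in cellN N L, ‖fderiv ℝ Φ.ψ X (unitVec i l)‖ ^ 2) + ε⁻¹ := by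
          rw [integral_add (hint1.const_mul ε) (hint2.const_mul ε⁻¹), integral_const_mul,
            integral_const_mul, integral_cellN_norm_sq, mul_one]
  -- assemble
  have hcos : ∫ X in cellN N L, 2 * Real.cos (phase n L i X) * ‖Φ.ψ X‖ ^ 2 =
      2 * ∫ X in cellN N L, Real.cos (phase n L i X) * ‖Φ.ψ X‖ ^ 2 := by
    rw [← integral_const_mul]
    refine integral_congr_ae (ae_of_all _ fun X => by ring)
  rw [hcos, abs_mul, abs_two]
  have hkey : |2 * Real.pi / L * (n l : ℝ)| * |∫ X in cellN N L, Real.cos (phase n L i X) * ‖Φ.ψ X‖ ^ 2| ≤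
      ε * (∫ X in cellN N L, ‖fderiv ℝ Φ.ψ X (unitVec i l)‖ ^ 2) + ε⁻¹ := by
    rw [← abs_mul, hibp, abs_neg]
    exact hbound
  rw [abs_mul, abs_of_pos (by positivity : (0 : ℝ) < 2 * Real.pi / L)] at hkey
  rw [div_mul_eq_mul_div, le_div_iff₀ hk]
  nlinarith [hkey, abs_nonneg (∫ X in cellN N L, Real.cos (phase n L i X) * ‖Φ.ψ X‖ ^ 2)]

/-- The directional kinetic energy is below the kinetic `lintegral`:
`ofReal (∑ᵢ ∫ |∂_{i,l}Φ|²) ≤ ∫⁻ kineticDensity Φ`. [folklore] -/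
theorem ofReal_sum_integral_pderiv_sq_le (Φ : PeriodicTrialState N L) (l : Fin 3) :
    ENNReal.ofReal (∑ i, ∫ X in cellN N L, ‖fderiv ℝ Φ.ψ X (unitVec i l)‖ ^ 2) ≤
      ∫⁻ X in cellN N L, kineticDensity Φ.ψ X := by
  have hD : ∀ i, Continuous fun X => fderiv ℝ Φ.ψ X (unitVec i l) := fun i =>
    (Φ.contDiff.continuous_fderiv one_ne_zero).clm_apply continuous_const
  have hint : ∀ i, IntegrableOn (fun X => ‖fderiv ℝ Φ.ψ X (unitVec i l)‖ ^ 2) (cellN N L) := fun i =>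
    integrableOn_cellN_of_continuous ((hD i).norm.pow 2) L
  rw [ENNReal.ofReal_sum_of_nonneg fun i _ => integral_nonneg fun X => sq_nonneg _]
  have h1 : ∀ i, ENNReal.ofReal (∫ X in cellN N L, ‖fderiv ℝ Φ.ψ X (unitVec i l)‖ ^ 2) =
      ∫⁻ X in cellN N L, (‖fderiv ℝ Φ.ψ X (unitVec i l)‖₊ : ℝ≥0∞) ^ 2 := by
    intro i
    rw [ofReal_integral_eq_lintegral_ofReal (hint i) (ae_of_all _ fun X => sq_nonneg _)]
    refine lintegral_congr fun X => ?_
    rw [← ennnorm_sq_eq]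
  simp_rw [h1]
  rw [← lintegral_finsetSum _ fun i _ => ?_]
  · refine lintegral_mono fun X => ?_
    unfold kineticDensity
    refine Finset.sum_le_sum fun i _ => ?_
    exact Finset.single_le_sum (f := fun k => (‖fderiv ℝ Φ.ψ X (unitVec i k)‖₊ : ℝ≥0∞) ^ 2)
      (fun _ _ => bot_le) (Finset.mem_univ l)
  · exact ((measurable_fderiv_apply_const ℝ Φ.ψ _).nnnorm.coe_nnreal_ennreal).pow_const 2

/-- **THE FREE CHORD (kinetic part of the crux, `C = 4`).**  For every `N`, `L > 0`, mode `n ≠ 0`,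
tilt `s ≥ 0` and periodic trial state `Φ`:
`ofReal (s |⟨Σᵢ 2cos(k·xᵢ)⟩_Φ|) ≤ ∫⁻ |∇Φ|² + ofReal (4 s² N / k∞²)`, `k∞ = 2π‖n‖∞/L`
(IBP along the sup-norm axis of `n`, AM–GM with `ε = k∞/(2s)`).  No interaction, no density:
this is why the crux's content is exactly the subtraction of `E₀(v)` (generation 1, finding (f)).
[folklore] -/
theorem free_chord (hL : 0 < L) {n : Fin 3 → ℤ} (hn : n ≠ 0) {s : ℝ} (hs : 0 ≤ s)
    (Φ : PeriodicTrialState N L) :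
    ENNReal.ofReal (s * |∫ X in cellN N L,
        (∑ i, 2 * Real.cos (2 * Real.pi / L * ∑ j, (n j : ℝ) * X i j)) * ‖Φ.ψ X‖ ^ 2|) ≤
      (∫⁻ X in cellN N L, kineticDensity Φ.ψ X) +
        ENNReal.ofReal (4 * s ^ 2 * N / (2 * Real.pi * ‖(fun j => (n j : ℝ))‖ / L) ^ 2) := by
  -- the sup-norm axis
  obtain ⟨l, -, hl⟩ := Finset.exists_mem_eq_sup (Finset.univ : Finset (Fin 3)) Finset.univ_nonempty
    (fun b => ‖(fun j => (n j : ℝ)) b‖₊)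
  have hnorm : ‖(fun j => (n j : ℝ))‖ = |(n l : ℝ)| := by
    rw [Pi.norm_def, hl, coe_nnnorm, Real.norm_eq_abs]
  have hnl : n l ≠ 0 := by
    intro h0
    have : ‖(fun j => (n j : ℝ))‖ = 0 := by rw [hnorm, h0]; simp
    rw [norm_eq_zero] at this
    exact hn (funext fun j => by have h' : (n j : ℝ) = 0 := congr_fun this j; exact_mod_cast h')
  set k : ℝ := 2 * Real.pi / L * |(n l : ℝ)| with hk_def
  have hk : 0 < k := by
    have : (0 : ℝ) < |(n l : ℝ)| := abs_pos.2 (by exact_mod_cast hnl)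
    positivity
  have hkeq : 2 * Real.pi * ‖(fun j => (n j : ℝ))‖ / L = k := by rw [hnorm, hk_def]; ring
  rw [hkeq]
  -- the source as a sum of per-particle integrals
  set T : ℝ := ∑ i, ∫ X in cellN N L, ‖fderiv ℝ Φ.ψ X (unitVec i l)‖ ^ 2 with hT_def
  have hT0 : 0 ≤ T := Finset.sum_nonneg fun i _ => integral_nonneg fun X => sq_nonneg _
  have hsrc : ∫ X in cellN N L, (∑ i, 2 * Real.cos (2 * Real.pi / L * ∑ j, (n j : ℝ) * X i j)) * ‖Φ.ψ X‖ ^ 2 =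
      ∑ i, ∫ X in cellN N L, 2 * Real.cos (phase n L i X) * ‖Φ.ψ X‖ ^ 2 := by
    simp_rw [Finset.sum_mul]
    rw [integral_finsetSum _ fun i _ => ?_]
    · rfl
    · exact integrableOn_cellN_of_continuous ((continuous_const.mul
        (Real.continuous_cos.comp (continuous_phase n L i))).mul (Φ.contDiff.continuous.norm.pow 2)) L
  -- per-particle bounds, summed: |src| ≤ (2/k)(ε T + N/ε)
  have hsum : ∀ {ε : ℝ}, 0 < ε → |∫ X in cellN N L,
      (∑ i, 2 * Real.cos (2 * Real.pi / L * ∑ j, (n j : ℝ) * X i j)) * ‖Φ.ψ X‖ ^ 2| ≤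
      2 / k * (ε * T + N * ε⁻¹) := by
    intro ε hε
    rw [hsrc]
    calc |∑ i, ∫ X in cellN N L, 2 * Real.cos (phase n L i X) * ‖Φ.ψ X‖ ^ 2|
        ≤ ∑ i, |∫ X in cellN N L, 2 * Real.cos (phase n L i X) * ‖Φ.ψ X‖ ^ 2| := Finset.abs_sum_le_sum_abs _ _
      _ ≤ ∑ i, 2 / k * (ε * (∫ X in cellN N L, ‖fderiv ℝ Φ.ψ X (unitVec i l)‖ ^ 2) + ε⁻¹) :=
          Finset.sum_le_sum fun i _ => abs_integral_two_cos_le hL n Φ i hnl hε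
      _ = 2 / k * (ε * T + N * ε⁻¹) := by
          rw [← Finset.mul_sum, Finset.sum_add_distrib, ← Finset.mul_sum, Finset.sum_const,
            Finset.card_univ, Fintype.card_fin, nsmul_eq_mul]
  -- the real inequality `s |src| ≤ T + 4 s² N / k²`
  have hreal : s * |∫ X in cellN N L,
      (∑ i, 2 * Real.cos (2 * Real.pi / L * ∑ j, (n j : ℝ) * X i j)) * ‖Φ.ψ X‖ ^ 2| ≤
      T + 4 * s ^ 2 * N / k ^ 2 := by
    rcases hs.eq_or_lt with rfl | hs'
    · rw [zero_mul]; positivity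
    · have h := mul_le_mul_of_nonneg_left (hsum (show 0 < k / (2 * s) by positivity)) hs
      refine h.trans (le_of_eq ?_)
      field_simp
      ring
  -- lift to `ℝ≥0∞`
  calc ENNReal.ofReal (s * |∫ X in cellN N L,
        (∑ i, 2 * Real.cos (2 * Real.pi / L * ∑ j, (n j : ℝ) * X i j)) * ‖Φ.ψ X‖ ^ 2|)
      ≤ ENNReal.ofReal (T + 4 * s ^ 2 * N / k ^ 2) := ENNReal.ofReal_le_ofReal hreal
    _ = ENNReal.ofReal T + ENNReal.ofReal (4 * s ^ 2 * N / k ^ 2) := ENNReal.ofReal_add hT0 (by positivity)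
    _ ≤ (∫⁻ X in cellN N L, kineticDensity Φ.ψ X) + ENNReal.ofReal (4 * s ^ 2 * N / k ^ 2) := by
        gcongr
        exact ofReal_sum_integral_pderiv_sq_le Φ l

/-- The kinetic energy is below the total energy for every `v ≥ 0`. [folklore] -/
theorem lintegral_kinetic_le_periodicEnergy (v : ℝ → ℝ≥0∞) (Φ : PeriodicTrialState N L) :
    (∫⁻ X in cellN N L, kineticDensity Φ.ψ X) ≤ periodicEnergy v Φ :=
  lintegral_mono fun _ => le_self_add

/-- **Free chord relative to the total energy** (`free_type_bound_all_v` of generation 1): for every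
`v`, `ofReal (s|⟨V_k⟩|) ≤ E_v(Φ) + ofReal (4s²N/k∞²)`. [folklore] -/
theorem free_chord_energy (hL : 0 < L) (v : ℝ → ℝ≥0∞) {n : Fin 3 → ℤ} (hn : n ≠ 0) {s : ℝ} (hs : 0 ≤ s)
    (Φ : PeriodicTrialState N L) :
    ENNReal.ofReal (s * |∫ X in cellN N L,
        (∑ i, 2 * Real.cos (2 * Real.pi / L * ∑ j, (n j : ℝ) * X i j)) * ‖Φ.ψ X‖ ^ 2|) ≤
      periodicEnergy v Φ + ENNReal.ofReal (4 * s ^ 2 * N / (2 * Real.pi * ‖(fun j => (n j : ℝ))‖ / L) ^ 2) :=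
  (free_chord hL hn hs Φ).trans (add_le_add (lintegral_kinetic_le_periodicEnergy v Φ) le_rfl)

/-- The free periodic energy is the kinetic energy. [folklore] -/
theorem periodicEnergy_zero_eq (Φ : PeriodicTrialState N L) :
    periodicEnergy 0 Φ = ∫⁻ X in cellN N L, kineticDensity Φ.ψ X := by
  refine lintegral_congr fun X => ?_
  have : periodicInteraction (N := N) 0 L X = 0 := by
    unfold periodicInteraction
    simp [periodizedPotential_zero]
  rw [this, zero_mul, add_zero]

/-- The constant state `L^{-3N/2}` on the torus (`N` particles). [folklore] -/
def constState (N : ℕ) (hL : 0 < L) : PeriodicTrialState N L where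
  ψ _ := ((Real.sqrt ((L ^ 3) ^ N))⁻¹ : ℂ)
  contDiff := contDiff_const
  periodic _ _ _ := rfl
  symm _ _ := rfl
  norm_eq := by
    have hV : 0 < (L ^ 3) ^ N := by positivity
    have hc : ((‖((Real.sqrt ((L ^ 3) ^ N))⁻¹ : ℂ)‖₊ : ℝ≥0∞) ^ 2) = ENNReal.ofReal (((L ^ 3) ^ N)⁻¹) := by
      rw [← ENNReal.coe_pow, ENNReal.ofReal, ENNReal.coe_inj]
      ext
      rw [NNReal.coe_pow, coe_nnnorm, norm_inv, Complex.norm_real,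
        Real.norm_of_nonneg (Real.sqrt_nonneg _), inv_pow, Real.sq_sqrt hV.le,
        Real.coe_toNNReal _ (by positivity)]
    rw [setLIntegral_const, volume_cellN, hc, ← ENNReal.ofReal_pow hL.le,
      ← ENNReal.ofReal_pow (by positivity), ← ENNReal.ofReal_mul (by positivity),
      inv_mul_cancel₀ hV.ne', ENNReal.ofReal_one]

/-- `E₀^per(v = 0) = 0`. [folklore] -/
theorem periodicGroundStateEnergy_zero (N : ℕ) (hL : 0 < L) : periodicGroundStateEnergy 0 N L = 0 := by
  refine le_antisymm ((periodicGroundStateEnergy_le 0 (constState N hL)).trans (le_of_eq ?_)) bot_le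
  rw [periodicEnergy_zero_eq]
  refine (lintegral_congr fun X => ?_).trans lintegral_zero
  simp [constState, kineticDensity]

/-- **THE FREE GAS SATISFIES THE CRUX WITH `C = 4`** (generation 1's `holds_free_four`, importable):
the conclusion of `DensityResponse` for `v = 0` with ANY `M, ρ₀, N₀` and the constant `C = 4`
(`a(0) = 0`, so the denominator is `k∞²`).  Together with `two_le_of_holds_free` of generation 1
(`C ≥ 2` is necessary) the free optimal constant lies in `[2, 4]`. [folklore] -/
theorem holds_free_four (M ρ₀ : ℝ) (N₀ : ℕ) :
    ∀ N : ℕ, N₀ ≤ N → ∀ L : ℝ, 0 < L → (N : ℝ) ≤ ρ₀ * L ^ 3 → ∀ n : Fin 3 → ℤ, n ≠ 0 →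
    2 * Real.pi * ‖(fun j => (n j : ℝ))‖ / L ≤ M * Real.sqrt (N / L ^ 3) → ∀ s : ℝ, 0 ≤ s →
    ∀ Φ : PeriodicTrialState N L,
      periodicGroundStateEnergy 0 N L + ENNReal.ofReal (s * |∫ X in cellN N L,
        (∑ i, 2 * Real.cos (2 * Real.pi / L * ∑ j, (n j : ℝ) * X i j)) * ‖Φ.ψ X‖ ^ 2|) ≤
      periodicEnergy 0 Φ + ENNReal.ofReal (4 * s ^ 2 * N /
        ((2 * Real.pi * ‖(fun j => (n j : ℝ))‖ / L) ^ 2 + N / L ^ 3 * (scatteringLength 0).toReal)) := by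
  intro N _ L hL _ n hn _ s hs Φ
  rw [periodicGroundStateEnergy_zero N hL, zero_add, scatteringLength_zero, ENNReal.toReal_zero,
    mul_zero, add_zero]
  exact free_chord_energy hL 0 hn hs Φ

end FreeChord


/-! ## §10 `n ≠ 0` is load-bearing (generation 1's finding (a), re-derived importably) -/

section ModeZero

variable {N : ℕ} {L : ℝ}

/-- The free energy of the constant state vanishes. [folklore] -/
theorem periodicEnergy_zero_constState (N : ℕ) (hL : 0 < L) : periodicEnergy 0 (constState N hL) = 0 := by
  rw [periodicEnergy_zero_eq]
  refine (lintegral_congr fun X => ?_).trans lintegral_zero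
  simp [constState, kineticDensity]

/-- **`DensityResponse` with the hypothesis `n ≠ 0` deleted** (everything else verbatim).  A variant
STATEMENT of this file, refuted below (untagged on purpose). -/
def DensityResponseWithoutModeNeZero : Prop :=
  ∀ v : ℝ → ℝ≥0∞, IsRepulsiveFiniteRange v → ∀ M : ℝ, 0 < M → ∃ ρ₀ C : ℝ, 0 < ρ₀ ∧ 0 < C ∧
    ∃ N₀ : ℕ, ∀ N : ℕ, N₀ ≤ N → ∀ L : ℝ, 0 < L → (N : ℝ) ≤ ρ₀ * L ^ 3 → ∀ n : Fin 3 → ℤ,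
    2 * Real.pi * ‖(fun j => (n j : ℝ))‖ / L ≤ M * Real.sqrt (N / L ^ 3) → ∀ s : ℝ, 0 ≤ s →
    ∀ Φ : PeriodicTrialState N L,
      periodicGroundStateEnergy v N L + ENNReal.ofReal (s * |∫ X in cellN N L,
        (∑ i, 2 * Real.cos (2 * Real.pi / L * ∑ j, (n j : ℝ) * X i j)) * ‖Φ.ψ X‖ ^ 2|) ≤
      periodicEnergy v Φ + ENNReal.ofReal (C * s ^ 2 * N /
        ((2 * Real.pi * ‖(fun j => (n j : ℝ))‖ / L) ^ 2 + N / L ^ 3 * (scatteringLength v).toReal))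

/-- The deleted hypothesis only weakens: the variant implies the crux. [folklore] -/
theorem densityResponse_of_withoutModeNeZero (h : DensityResponseWithoutModeNeZero) :
    Summit.AtomisticToContinuum.BoseEinsteinCondensation.Theses.BECThomsonPrinciple.DensityResponse := by
  intro v hv M hM
  obtain ⟨ρ₀, C, hρ₀, hC, N₀, H⟩ := h v hv M hM
  exact ⟨ρ₀, C, hρ₀, hC, N₀, fun N hN L hL hd n _ hw s hs Φ => H N hN L hL hd n hw s hs Φ⟩

/-- **`n ≠ 0` is load-bearing** (gen 1 (a)): at `n = 0` the "source" is the particle number,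
`⟨Σᵢ 2cos 0⟩ = 2N`, while for the free gas the bound's denominator `k∞² + ρ·a(0)` vanishes and
Lean's `x/0 = 0` kills the right-hand side: the constant state violates the chord at `s = 1`.
(Physically: a uniform potential shift `-2sN` is not a density response.) [folklore] -/
theorem densityResponse_false_without_modeNeZero : ¬ DensityResponseWithoutModeNeZero := by
  intro H
  obtain ⟨ρ₀, C, hρ₀, -, N₀, H⟩ := H 0 ⟨measurable_const, 0, fun _ _ => rfl⟩ 1 one_pos
  obtain ⟨N, hN0, hN1⟩ : ∃ N : ℕ, N₀ ≤ N ∧ 1 ≤ N := ⟨max N₀ 1, le_max_left _ _, le_max_right _ _⟩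
  set L : ℝ := max 1 (N / ρ₀) with hL_def
  have hL1 : 1 ≤ L := le_max_left _ _
  have hL : 0 < L := by linarith
  have hdil : (N : ℝ) ≤ ρ₀ * L ^ 3 := by
    have h1 : (N : ℝ) / ρ₀ ≤ L := le_max_right _ _
    have h2 : (N : ℝ) ≤ ρ₀ * L := by rwa [div_le_iff₀' hρ₀] at h1
    have h3 : L ≤ L ^ 3 := by
      have : 1 ≤ L ^ 2 := by nlinarith
      nlinarith
    nlinarith
  have hwin : 2 * Real.pi * ‖(fun j => ((0 : Fin 3 → ℤ) j : ℝ))‖ / L ≤ 1 * Real.sqrt (N / L ^ 3) := by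
    have : (fun j => ((0 : Fin 3 → ℤ) j : ℝ)) = 0 := by funext j; simp
    rw [this, norm_zero, mul_zero, zero_div]
    positivity
  have key := H N hN0 L hL hdil 0 hwin 1 zero_le_one (constState N hL)
  have hsrc : ∫ X in cellN N L, (∑ i, 2 * Real.cos (2 * Real.pi / L * ∑ j, ((0 : Fin 3 → ℤ) j : ℝ) * X i j)) *
      ‖(constState N hL).ψ X‖ ^ 2 = 2 * N := by
    have : ∀ X : Config N, (∑ i, 2 * Real.cos (2 * Real.pi / L * ∑ j, ((0 : Fin 3 → ℤ) j : ℝ) * X i j)) *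
        ‖(constState N hL).ψ X‖ ^ 2 = 2 * N * ‖(constState N hL).ψ X‖ ^ 2 := by
      intro X; simp [mul_comm]
    simp_rw [this]
    rw [integral_const_mul, integral_cellN_norm_sq, mul_one]
  have hden : (2 * Real.pi * ‖(fun j => ((0 : Fin 3 → ℤ) j : ℝ))‖ / L) ^ 2 +
      N / L ^ 3 * (scatteringLength 0).toReal = 0 := by
    have : (fun j => ((0 : Fin 3 → ℤ) j : ℝ)) = 0 := by funext j; simp
    rw [this, norm_zero, scatteringLength_zero]
    simp
  rw [hsrc, hden, div_zero, ENNReal.ofReal_zero, add_zero, periodicEnergy_zero_constState,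
    periodicGroundStateEnergy_zero N hL, zero_add, one_mul, abs_of_nonneg (by positivity),
    nonpos_iff_eq_zero, ENNReal.ofReal_eq_zero] at key
  have : (0 : ℝ) < 2 * N := by positivity
  linarith

end ModeZero


/-! ## §11 TIGHTNESS (generation 1's finding (b), re-derived importably): for the free gas every
admissible constant satisfies `C ≥ 2` — one-parameter family of modulated product states
`∏ᵢ c_η(1 + 2η cos(2πx_{i,0}/L))`, `η → 0`, with EXACT kinetic energy `2η²k²N/(1+2η²)` and source
`4ηN/(1+2η²)` -/

section Tightness

variable {N : ℕ} {L : ℝ}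

/-- The profile `1 + 2η cos θ`. [folklore] -/
def profη (η L : ℝ) (x : Space) : ℝ := 1 + 2 * η * Real.cos (θL L x)

/-- The normalisation `c_η = (L³(1+2η²))^{-1/2}`. [folklore] -/
def cη (η L : ℝ) : ℝ := (Real.sqrt ((1 + 2 * η ^ 2) * L ^ 3))⁻¹

/-- The orbital `φ_{η,L} = c_η (1 + 2η cos θ)`. [folklore] -/
def orbη (η L : ℝ) (x : Space) : ℂ := ((cη η L * profη η L x : ℝ) : ℂ)

theorem cη_pos (η : ℝ) (hL : 0 < L) : 0 < cη η L := by
  unfold cη; positivity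

theorem cη_sq (η : ℝ) (hL : 0 < L) : cη η L ^ 2 = 1 / ((1 + 2 * η ^ 2) * L ^ 3) := by
  unfold cη
  rw [inv_pow, Real.sq_sqrt (by positivity), one_div]

theorem contDiff_profη (η L : ℝ) : ContDiff ℝ ⊤ (profη η L) := by
  unfold profη θL; fun_prop

theorem contDiff_orbη (η L : ℝ) : ContDiff ℝ ⊤ (orbη η L) := by
  have : orbη η L = fun x => Complex.ofRealCLM (cη η L * profη η L x) := by
    funext x; rw [Complex.ofRealCLM_apply]; rfl
  rw [this]
  exact Complex.ofRealCLM.contDiff.comp (contDiff_const.mul (contDiff_profη η L))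

theorem continuous_orbη (η L : ℝ) : Continuous (orbη η L) := (contDiff_orbη η L).continuous

theorem norm_orbη_sq (η : ℝ) (L : ℝ) (x : Space) : ‖orbη η L x‖ ^ 2 = cη η L ^ 2 * profη η L x ^ 2 := by
  unfold orbη
  rw [Complex.norm_real, Real.norm_eq_abs, sq_abs, mul_pow]

theorem orbη_periodic (η : ℝ) (hL : L ≠ 0) (x : Space) (k : Fin 3) :
    orbη η L (x + EuclideanSpace.single k L) = orbη η L x := by
  have hθ : Real.cos (θL L (x + EuclideanSpace.single k L)) = Real.cos (θL L x) := by
    unfold θL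
    simp only [PiLp.add_apply, PiLp.single_apply]
    split_ifs
    · rw [mul_add, div_mul_cancel₀ _ hL, Real.cos_add_two_pi]
    · rw [add_zero]
  unfold orbη profη
  rw [hθ]

/-- The derivative of the profile. [folklore] -/
theorem hasFDerivAt_profη (η L : ℝ) (x : Space) :
    HasFDerivAt (profη η L)
      ((2 * η : ℝ) • (-Real.sin (θL L x) •
        ((2 * Real.pi / L) • EuclideanSpace.proj (𝕜 := ℝ) (0 : Fin 3)))) x := by
  have h0 : HasFDerivAt (fun y : Space => θL L y)
      ((2 * Real.pi / L) • EuclideanSpace.proj (𝕜 := ℝ) (0 : Fin 3)) x :=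
    ((EuclideanSpace.proj (𝕜 := ℝ) (0 : Fin 3)).hasFDerivAt).const_mul (2 * Real.pi / L)
  exact ((h0.cos).const_mul (2 * η)).const_add 1

/-- The derivative of the orbital. [folklore] -/
theorem hasFDerivAt_orbη (η L : ℝ) (x : Space) :
    HasFDerivAt (orbη η L) (Complex.ofRealCLM.comp (cη η L • ((2 * η : ℝ) • (-Real.sin (θL L x) •
        ((2 * Real.pi / L) • EuclideanSpace.proj (𝕜 := ℝ) (0 : Fin 3)))))) x := by
  have h1 := (hasFDerivAt_profη η L x).const_mul (cη η L)
  have h2 := Complex.ofRealCLM.hasFDerivAt.comp x h1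
  have : orbη η L = fun y => Complex.ofRealCLM (cη η L * profη η L y) := by
    funext y; rw [Complex.ofRealCLM_apply]; rfl
  rw [this]
  exact h2

/-- `∂_k φ_{η,L}(x) = -c_η 2η (2π/L) sin θ · [k = 0]`. [folklore] -/
theorem fderiv_orbη_single (η L : ℝ) (x : Space) (k : Fin 3) :
    fderiv ℝ (orbη η L) x (EuclideanSpace.single k (1 : ℝ)) =
      ((cη η L * (2 * η * (-Real.sin (θL L x) * (2 * Real.pi / L * if (0 : Fin 3) = k then 1 else 0))) : ℝ) : ℂ) := by
  rw [(hasFDerivAt_orbη η L x).fderiv, ContinuousLinearMap.comp_apply, Complex.ofRealCLM_apply]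
  congr 1
  simp only [smul_apply, smul_eq_mul, euclideanProj_apply, PiLp.single_apply]

/-- `|∂₀ φ_{η,L}(x)|² = c_η² 4η² (2π/L)² sin²θ` and `∂_k φ_{η,L} = 0` for `k ≠ 0`. [folklore] -/
theorem norm_fderiv_orbη_single_zero_sq (η L : ℝ) (x : Space) :
    ‖fderiv ℝ (orbη η L) x (EuclideanSpace.single 0 (1 : ℝ))‖ ^ 2 =
      cη η L ^ 2 * (4 * η ^ 2 * (2 * Real.pi / L) ^ 2) * Real.sin (θL L x) ^ 2 := by
  rw [fderiv_orbη_single, if_pos rfl, Complex.norm_real, Real.norm_eq_abs, sq_abs]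
  ring

theorem fderiv_orbη_single_of_ne (η L : ℝ) (x : Space) {k : Fin 3} (hk : (0 : Fin 3) ≠ k) :
    fderiv ℝ (orbη η L) x (EuclideanSpace.single k (1 : ℝ)) = 0 := by
  rw [fderiv_orbη_single, if_neg hk]
  simp

/-! ### Cell integrals of the `η`-orbital -/

theorem profη_sq_eq (η L : ℝ) (x : Space) :
    profη η L x ^ 2 = (1 + 2 * η ^ 2) + 4 * η * Real.cos ((1 : ℤ) * θL L x) +
      2 * η ^ 2 * Real.cos ((2 : ℤ) * θL L x) := by
  unfold profη
  push_cast
  rw [one_mul, Real.cos_two_mul]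
  ring

theorem two_cos_mul_profη_sq_eq (η L : ℝ) (x : Space) :
    2 * Real.cos (θL L x) * profη η L x ^ 2 = 4 * η + (2 + 6 * η ^ 2) * Real.cos ((1 : ℤ) * θL L x) +
      4 * η * Real.cos ((2 : ℤ) * θL L x) + 2 * η ^ 2 * Real.cos ((3 : ℤ) * θL L x) := by
  unfold profη
  push_cast
  rw [one_mul, Real.cos_two_mul, Real.cos_three_mul]
  ring

theorem sin_sq_eq (L : ℝ) (x : Space) :
    Real.sin (θL L x) ^ 2 = 1 / 2 - 1 / 2 * Real.cos ((2 : ℤ) * θL L x) := by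
  push_cast
  rw [Real.sin_sq, Real.cos_sq]
  ring

/-- `∫_cell (1 + 2η cos θ)² = (1 + 2η²) L³`. [folklore] -/
theorem integral_cell_profη_sq (η : ℝ) (hL : 0 < L) :
    ∫ x in cell L, profη η L x ^ 2 = (1 + 2 * η ^ 2) * L ^ 3 := by
  simp_rw [profη_sq_eq]
  have hc : IntegrableOn (fun _ : Space => (1 + 2 * η ^ 2 : ℝ)) (cell L) := integrableOn_const (volume_cell_ne_top L)
  have h1 := (integrableOn_cell_cos L 1).const_mul (4 * η)
  have h2 := (integrableOn_cell_cos L 2).const_mul (2 * η ^ 2)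
  rw [integral_add (hc.fun_add h1) h2, integral_add hc h1, integral_const_mul, integral_const_mul,
    integral_cell_cos hL one_ne_zero, integral_cell_cos hL two_ne_zero,
    setIntegral_const, volume_real_cell hL.le, smul_eq_mul]
  ring

/-- `∫_cell 2cos θ (1 + 2η cos θ)² = 4η L³`. [folklore] -/
theorem integral_cell_two_cos_profη_sq (η : ℝ) (hL : 0 < L) :
    ∫ x in cell L, 2 * Real.cos (θL L x) * profη η L x ^ 2 = 4 * η * L ^ 3 := by
  simp_rw [two_cos_mul_profη_sq_eq]
  have hc : IntegrableOn (fun _ : Space => (4 * η : ℝ)) (cell L) := integrableOn_const (volume_cell_ne_top L)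
  have h1 := (integrableOn_cell_cos L 1).const_mul (2 + 6 * η ^ 2)
  have h2 := (integrableOn_cell_cos L 2).const_mul (4 * η)
  have h3 := (integrableOn_cell_cos L 3).const_mul (2 * η ^ 2)
  rw [integral_add ((hc.fun_add h1).fun_add h2) h3, integral_add (hc.fun_add h1) h2, integral_add hc h1,
    setIntegral_const, integral_const_mul, integral_const_mul, integral_const_mul,
    integral_cell_cos hL one_ne_zero, integral_cell_cos hL two_ne_zero, integral_cell_cos hL (by norm_num),
    volume_real_cell hL.le, smul_eq_mul]
  ring

/-- `∫_cell sin²θ = L³/2`. [folklore] -/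
theorem integral_cell_sin_sq (hL : 0 < L) : ∫ x in cell L, Real.sin (θL L x) ^ 2 = L ^ 3 / 2 := by
  simp_rw [sin_sq_eq]
  have hc : IntegrableOn (fun _ : Space => (1 / 2 : ℝ)) (cell L) := integrableOn_const (volume_cell_ne_top L)
  have h2 := (integrableOn_cell_cos L 2).const_mul (1 / 2)
  rw [integral_sub hc h2, integral_const_mul, integral_cell_cos hL two_ne_zero, setIntegral_const,
    volume_real_cell hL.le, smul_eq_mul]
  ring

/-- **Normalisation** `∫_cell |φ_{η,L}|² = 1`. [folklore] -/
theorem integral_cell_norm_orbη_sq (η : ℝ) (hL : 0 < L) : ∫ x in cell L, ‖orbη η L x‖ ^ 2 = 1 := by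
  simp_rw [norm_orbη_sq]
  rw [integral_const_mul, integral_cell_profη_sq η hL, cη_sq η hL]
  field_simp

/-- **Source** `∫_cell 2cos θ |φ_{η,L}|² = 4η/(1+2η²)`. [folklore] -/
theorem integral_cell_two_cos_norm_orbη_sq (η : ℝ) (hL : 0 < L) :
    ∫ x in cell L, 2 * Real.cos (θL L x) * ‖orbη η L x‖ ^ 2 = 4 * η / (1 + 2 * η ^ 2) := by
  simp_rw [norm_orbη_sq]
  have : ∀ x, 2 * Real.cos (θL L x) * (cη η L ^ 2 * profη η L x ^ 2) =
      cη η L ^ 2 * (2 * Real.cos (θL L x) * profη η L x ^ 2) := fun x => by ring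
  simp_rw [this]
  rw [integral_const_mul, integral_cell_two_cos_profη_sq η hL, cη_sq η hL]
  field_simp

/-- **Directional kinetic energy of the orbital** `∫_cell |∂₀ φ_{η,L}|² = 2η²(2π/L)²/(1+2η²)`.
[folklore] -/
theorem integral_cell_norm_fderiv_orbη_sq (η : ℝ) (hL : 0 < L) :
    ∫ x in cell L, ‖fderiv ℝ (orbη η L) x (EuclideanSpace.single 0 (1 : ℝ))‖ ^ 2 =
      2 * η ^ 2 * (2 * Real.pi / L) ^ 2 / (1 + 2 * η ^ 2) := by
  simp_rw [norm_fderiv_orbη_single_zero_sq]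
  rw [integral_const_mul, integral_cell_sin_sq hL, cη_sq η hL]
  field_simp
  ring

theorem norm_orbη_le (η : ℝ) (hL : 0 < L) (x : Space) : ‖orbη η L x‖ ≤ cη η L * (1 + 2 * |η|) := by
  unfold orbη
  rw [Complex.norm_real, Real.norm_eq_abs, abs_mul, abs_of_pos (cη_pos η hL)]
  refine mul_le_mul_of_nonneg_left ?_ (cη_pos η hL).le
  unfold profη
  calc |1 + 2 * η * Real.cos (θL L x)| ≤ |(1 : ℝ)| + |2 * η * Real.cos (θL L x)| := abs_add_le _ _
    _ ≤ 1 + 2 * |η| := by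
        rw [abs_one, abs_mul, abs_mul, abs_two]
        have := Real.abs_cos_le_one (θL L x)
        nlinarith [abs_nonneg η]

theorem integrableOn_cell_norm_orbη_sq (η : ℝ) (hL : 0 < L) :
    IntegrableOn (fun x => ‖orbη η L x‖ ^ 2) (cell L) := by
  refine integrableOn_cell_of_bound (g := fun x => ‖orbη η L x‖ ^ 2) ((continuous_orbη η L).norm.pow 2)
    (M := (cη η L * (1 + 2 * |η|)) ^ 2) (fun x => ?_) L
  rw [Real.norm_eq_abs, abs_of_nonneg (sq_nonneg _)]
  exact pow_le_pow_left₀ (norm_nonneg _) (norm_orbη_le η hL x) 2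

theorem lintegral_cell_orbη_sq (η : ℝ) (hL : 0 < L) :
    ∫⁻ x in cell L, (‖orbη η L x‖₊ : ℝ≥0∞) ^ 2 = 1 := by
  simp_rw [ennnorm_sq_eq]
  rw [← ofReal_integral_eq_lintegral_ofReal (integrableOn_cell_norm_orbη_sq η hL)
    (ae_of_all _ fun x => by positivity), integral_cell_norm_orbη_sq η hL, ENNReal.ofReal_one]

theorem measurable_orbη_sq (η L : ℝ) : Measurable fun x => (‖orbη η L x‖₊ : ℝ≥0∞) ^ 2 :=
  ((continuous_orbη η L).measurable.nnnorm.coe_nnreal_ennreal).pow_const 2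

/-! ### The `η`-product state, its source and its EXACT kinetic energy -/

/-- The product wave function `∏ᵢ φ_{η,L}(xᵢ)`. [folklore] -/
def prodFunη (η : ℝ) (N : ℕ) (L : ℝ) (X : Config N) : ℂ := ∏ i, orbη η L (X i)

theorem contDiff_prodFunη (η : ℝ) (N : ℕ) (L : ℝ) : ContDiff ℝ 1 (prodFunη η N L) :=
  contDiff_prod fun i _ => ((contDiff_orbη η L).of_le le_top).comp
    (ContinuousLinearMap.proj (R := ℝ) (φ := fun _ => Space) i).contDiff

theorem prodFunη_periodic (η : ℝ) (hL : L ≠ 0) (X : Config N) (i : Fin N) (k : Fin 3) :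
    prodFunη η N L (X + Pi.single i (EuclideanSpace.single k L)) = prodFunη η N L X := by
  unfold prodFunη
  refine Finset.prod_congr rfl fun j _ => ?_
  rw [Pi.add_apply]
  rcases eq_or_ne j i with rfl | hj
  · rw [Pi.single_eq_same, orbη_periodic η hL]
  · rw [Pi.single_eq_of_ne hj, add_zero]

theorem prodFunη_symm (η : ℝ) (N : ℕ) (L : ℝ) (σ : Equiv.Perm (Fin N)) (X : Config N) :
    prodFunη η N L (X ∘ σ) = prodFunη η N L X := by
  unfold prodFunη
  exact Equiv.prod_comp σ (fun i => orbη η L (X i))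

theorem nnnorm_prodFunη_sq (η : ℝ) (N : ℕ) (L : ℝ) (X : Config N) :
    (‖prodFunη η N L X‖₊ : ℝ≥0∞) ^ 2 = ∏ i, (‖orbη η L (X i)‖₊ : ℝ≥0∞) ^ 2 := by
  rw [prodFunη, nnnorm_prod, ENNReal.ofNNReal_finsetProd, Finset.prod_pow]

theorem norm_prodFunη_sq (η : ℝ) (N : ℕ) (L : ℝ) (X : Config N) :
    ‖prodFunη η N L X‖ ^ 2 = ∏ i, ‖orbη η L (X i)‖ ^ 2 := by
  rw [prodFunη, norm_prod, Finset.prod_pow]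

theorem lintegral_cellN_prodFunη_sq (η : ℝ) (N : ℕ) (hL : 0 < L) :
    ∫⁻ X in cellN N L, (‖prodFunη η N L X‖₊ : ℝ≥0∞) ^ 2 = 1 := by
  simp_rw [nnnorm_prodFunη_sq]
  rw [volume_restrict_cellN, Literature.Probability.Distributions.lintegral_fin_nat_prod_eq_prod
    _ (fun _ x => (‖orbη η L x‖₊ : ℝ≥0∞) ^ 2) (fun _ => measurable_orbη_sq η L)]
  simp [lintegral_cell_orbη_sq η hL]

/-- **The `η`-modulated product state** on the torus. [folklore] -/
def prodStateη (η : ℝ) (N : ℕ) (hL : 0 < L) : PeriodicTrialState N L where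
  ψ := prodFunη η N L
  contDiff := contDiff_prodFunη η N L
  periodic := prodFunη_periodic η hL.ne'
  symm := prodFunη_symm η N L
  norm_eq := lintegral_cellN_prodFunη_sq η N hL

theorem prodStateη_ψ (η : ℝ) (N : ℕ) (hL : 0 < L) : (prodStateη η N hL).ψ = prodFunη η N L := rfl

/-- **Fubini with one marked factor**: `∫_{cellN} g(xᵢ) ∏_{j≠i} |φ(xⱼ)|² … = (∫_cell g)` when the
other factors integrate to `1`. [folklore] -/
theorem integral_cellN_marked (η : ℝ) (N : ℕ) (hL : 0 < L) {g : Space → ℝ} (hgc : Continuous g)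
    {M : ℝ} (hgM : ∀ x, ‖g x‖ ≤ M) (i : Fin N) :
    ∫ X in cellN N L, g (X i) * ∏ j ∈ Finset.univ.erase i, ‖orbη η L (X j)‖ ^ 2 = ∫ x in cell L, g x := by
  let f : Fin N → Space → ℝ := fun j => if j = i then g else fun x => ‖orbη η L x‖ ^ 2
  have hf : ∀ j, Integrable (f j) ((volume : Measure Space).restrict (cell L)) := by
    intro j
    by_cases h : j = i
    · simp only [f, if_pos h]; exact integrableOn_cell_of_bound hgc hgM L
    · simp only [f, if_neg h]; exact integrableOn_cell_norm_orbη_sq η hL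
  have hpt : ∀ X : Config N, g (X i) * ∏ j ∈ Finset.univ.erase i, ‖orbη η L (X j)‖ ^ 2 = ∏ j, f j (X j) := by
    intro X
    rw [← Finset.mul_prod_erase _ _ (Finset.mem_univ i)]
    simp only [f, if_true]
    congr 1
    exact Finset.prod_congr rfl fun j hj => by rw [if_neg (Finset.ne_of_mem_erase hj)]
  simp_rw [hpt]
  rw [volume_restrict_cellN, integral_fin_nat_prod_eq_prod]
  have hint : ∀ j, ∫ x in cell L, f j x = if j = i then ∫ x in cell L, g x else 1 := by
    intro j
    by_cases h : j = i
    · simp only [f, if_pos h]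
    · simp only [f, if_neg h]; exact integral_cell_norm_orbη_sq η hL
  simp_rw [hint]
  rw [Finset.prod_ite_eq' Finset.univ i]
  simp

/-- **Source of the `η`-state**: `∫ (∑ᵢ 2cos θᵢ)|Φ_η|² = 4ηN/(1+2η²)`. [folklore] -/
theorem source_prodStateη (η : ℝ) (N : ℕ) (hL : 0 < L) :
    ∫ X in cellN N L, (∑ i, 2 * Real.cos (θL L (X i))) * ‖(prodStateη η N hL).ψ X‖ ^ 2 =
      N * (4 * η / (1 + 2 * η ^ 2)) := by
  rw [prodStateη_ψ]
  have hpt : ∀ X : Config N, (∑ i, 2 * Real.cos (θL L (X i))) * ‖prodFunη η N L X‖ ^ 2 =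
      ∑ i, (2 * Real.cos (θL L (X i)) * ‖orbη η L (X i)‖ ^ 2) *
        ∏ j ∈ Finset.univ.erase i, ‖orbη η L (X j)‖ ^ 2 := by
    intro X
    rw [norm_prodFunη_sq, Finset.sum_mul]
    refine Finset.sum_congr rfl fun i _ => ?_
    rw [← Finset.mul_prod_erase _ _ (Finset.mem_univ i)]
    ring
  simp_rw [hpt]
  have hgc : Continuous fun x => 2 * Real.cos (θL L x) * ‖orbη η L x‖ ^ 2 :=
    (continuous_const.mul (Real.continuous_cos.comp (continuous_θL L))).mul ((continuous_orbη η L).norm.pow 2)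
  have hgM : ∀ x, ‖2 * Real.cos (θL L x) * ‖orbη η L x‖ ^ 2‖ ≤ 2 * (cη η L * (1 + 2 * |η|)) ^ 2 := by
    intro x
    rw [Real.norm_eq_abs, abs_mul, abs_mul, abs_of_nonneg (sq_nonneg ‖orbη η L x‖), abs_two]
    have h1 : |Real.cos (θL L x)| ≤ 1 := Real.abs_cos_le_one _
    have h2 : ‖orbη η L x‖ ^ 2 ≤ (cη η L * (1 + 2 * |η|)) ^ 2 :=
      pow_le_pow_left₀ (norm_nonneg _) (norm_orbη_le η hL x) 2
    calc 2 * |Real.cos (θL L x)| * ‖orbη η L x‖ ^ 2 ≤ 2 * 1 * (cη η L * (1 + 2 * |η|)) ^ 2 := by gcongr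
      _ = _ := by ring
  rw [integral_finsetSum _ fun i _ => ?_]
  · simp_rw [integral_cellN_marked η N hL hgc hgM, integral_cell_two_cos_norm_orbη_sq η hL]
    simp
  · refine integrableOn_cellN_of_continuous (f := fun X : Config N =>
      (2 * Real.cos (θL L (X i)) * ‖orbη η L (X i)‖ ^ 2) * ∏ j ∈ Finset.univ.erase i, ‖orbη η L (X j)‖ ^ 2) ?_ L
    exact (hgc.comp (continuous_apply i)).mul
      (continuous_finsetProd _ fun j _ => ((continuous_orbη η L).norm.pow 2).comp (continuous_apply j))

/-- The partial derivatives of the product. [folklore] -/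
theorem fderiv_prodFunη_unitVec (η : ℝ) (N : ℕ) (L : ℝ) (X : Config N) (i : Fin N) (k : Fin 3) :
    fderiv ℝ (prodFunη η N L) X (unitVec i k) =
      (∏ j ∈ Finset.univ.erase i, orbη η L (X j)) * fderiv ℝ (orbη η L) (X i) (EuclideanSpace.single k 1) := by
  have hdiff : ∀ j : Fin N, HasFDerivAt (fun Y : Config N => orbη η L (Y j))
      ((fderiv ℝ (orbη η L) (X j)).comp (ContinuousLinearMap.proj (R := ℝ) (φ := fun _ => Space) j)) X := by
    intro j
    exact ((hasFDerivAt_orbη η L (X j)).differentiableAt.hasFDerivAt).comp X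
      (ContinuousLinearMap.proj (R := ℝ) (φ := fun _ => Space) j).hasFDerivAt
  have hder := HasFDerivAt.finsetProd (u := Finset.univ) (g := fun j (Y : Config N) => orbη η L (Y j)) (x := X)
    fun j _ => hdiff j
  rw [show prodFunη η N L = fun Y => ∏ j ∈ Finset.univ, orbη η L (Y j) from rfl, hder.fderiv,
    FunLike.coe_sum, Finset.sum_apply, Finset.sum_eq_single i]
  · rw [smul_apply, ContinuousLinearMap.comp_apply, ContinuousLinearMap.proj_apply]
    simp only [unitVec, Pi.single_eq_same, smul_eq_mul]
  · intro j _ hji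
    rw [smul_apply, ContinuousLinearMap.comp_apply, ContinuousLinearMap.proj_apply]
    simp only [unitVec, Pi.single_eq_of_ne hji, map_zero, smul_zero]
  · intro h; exact absurd (Finset.mem_univ i) h

/-- **EXACT kinetic energy of the `η`-state**: `E₀-free energy = 2η²(2π/L)²N/(1+2η²)`. [folklore] -/
theorem periodicEnergy_zero_prodStateη (η : ℝ) (N : ℕ) (hL : 0 < L) :
    periodicEnergy 0 (prodStateη η N hL) =
      ENNReal.ofReal (N * (2 * η ^ 2 * (2 * Real.pi / L) ^ 2 / (1 + 2 * η ^ 2))) := by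
  rw [periodicEnergy_zero_eq, prodStateη_ψ]
  have hk0 : ∀ (i : Fin N) (X : Config N), (‖fderiv ℝ (prodFunη η N L) X (unitVec i 0)‖₊ : ℝ≥0∞) ^ 2 =
      ENNReal.ofReal (‖fderiv ℝ (orbη η L) (X i) (EuclideanSpace.single 0 1)‖ ^ 2 *
        ∏ j ∈ Finset.univ.erase i, ‖orbη η L (X j)‖ ^ 2) := by
    intro i X
    rw [ennnorm_sq_eq, fderiv_prodFunη_unitVec, norm_mul, mul_pow, norm_prod, Finset.prod_pow, mul_comm]
  have hk1 : ∀ (i : Fin N) (X : Config N) (k : Fin 3), (0 : Fin 3) ≠ k →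
      (‖fderiv ℝ (prodFunη η N L) X (unitVec i k)‖₊ : ℝ≥0∞) ^ 2 = 0 := by
    intro i X k hk
    rw [fderiv_prodFunη_unitVec, fderiv_orbη_single_of_ne η L (X i) hk, mul_zero]
    simp
  have hpt : ∀ X : Config N, kineticDensity (prodFunη η N L) X =
      ∑ i, ENNReal.ofReal (‖fderiv ℝ (orbη η L) (X i) (EuclideanSpace.single 0 1)‖ ^ 2 *
        ∏ j ∈ Finset.univ.erase i, ‖orbη η L (X j)‖ ^ 2) := by
    intro X
    unfold kineticDensity
    refine Finset.sum_congr rfl fun i _ => ?_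
    rw [Fin.sum_univ_three, hk0, hk1 i X 1 (by decide), hk1 i X 2 (by decide), add_zero, add_zero]
  simp_rw [hpt]
  have hgc : Continuous fun x => ‖fderiv ℝ (orbη η L) x (EuclideanSpace.single 0 1)‖ ^ 2 := by
    simp_rw [norm_fderiv_orbη_single_zero_sq]
    exact continuous_const.mul ((Real.continuous_sin.comp (continuous_θL L)).pow 2)
  have hgM : ∀ x, ‖‖fderiv ℝ (orbη η L) x (EuclideanSpace.single 0 1)‖ ^ 2‖ ≤
      cη η L ^ 2 * (4 * η ^ 2 * (2 * Real.pi / L) ^ 2) * 1 := by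
    intro x
    rw [Real.norm_eq_abs, abs_of_nonneg (sq_nonneg _), norm_fderiv_orbη_single_zero_sq]
    gcongr
    rw [sq_le_one_iff_abs_le_one]
    exact Real.abs_sin_le_one _
  have hcont : ∀ i : Fin N, Continuous fun X : Config N =>
      ‖fderiv ℝ (orbη η L) (X i) (EuclideanSpace.single 0 1)‖ ^ 2 * ∏ j ∈ Finset.univ.erase i, ‖orbη η L (X j)‖ ^ 2 :=
    fun i => (hgc.comp (continuous_apply i)).mul
      (continuous_finsetProd _ fun j _ => ((continuous_orbη η L).norm.pow 2).comp (continuous_apply j))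
  rw [lintegral_finsetSum _ fun i _ => (hcont i).measurable.ennreal_ofReal]
  have hterm : ∀ i : Fin N, ∫⁻ X in cellN N L, ENNReal.ofReal (‖fderiv ℝ (orbη η L) (X i) (EuclideanSpace.single 0 1)‖ ^ 2 *
      ∏ j ∈ Finset.univ.erase i, ‖orbη η L (X j)‖ ^ 2) =
      ENNReal.ofReal (2 * η ^ 2 * (2 * Real.pi / L) ^ 2 / (1 + 2 * η ^ 2)) := by
    intro i
    rw [← ofReal_integral_eq_lintegral_ofReal (integrableOn_cellN_of_continuous (hcont i) L)
      (ae_of_all _ fun X => mul_nonneg (sq_nonneg _) (Finset.prod_nonneg fun j _ => sq_nonneg _)),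
      integral_cellN_marked η N hL hgc hgM, integral_cell_norm_fderiv_orbη_sq η hL]
  simp_rw [hterm]
  rw [Finset.sum_const, Finset.card_univ, Fintype.card_fin, nsmul_eq_mul, ← ENNReal.ofReal_natCast,
    ← ENNReal.ofReal_mul (Nat.cast_nonneg _)]

/-- The inner conclusion of the crux for the free gas with constant `C` (`a(0) = 0` written out). -/
def HoldsFree (M ρ₀ C : ℝ) (N₀ : ℕ) : Prop :=
  ∀ N : ℕ, N₀ ≤ N → ∀ L : ℝ, 0 < L → (N : ℝ) ≤ ρ₀ * L ^ 3 → ∀ n : Fin 3 → ℤ, n ≠ 0 →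
    2 * Real.pi * ‖(fun j => (n j : ℝ))‖ / L ≤ M * Real.sqrt (N / L ^ 3) → ∀ s : ℝ, 0 ≤ s →
    ∀ Φ : PeriodicTrialState N L,
      periodicGroundStateEnergy 0 N L + ENNReal.ofReal (s * |∫ X in cellN N L,
        (∑ i, 2 * Real.cos (2 * Real.pi / L * ∑ j, (n j : ℝ) * X i j)) * ‖Φ.ψ X‖ ^ 2|) ≤
      periodicEnergy 0 Φ + ENNReal.ofReal (C * s ^ 2 * N /
        ((2 * Real.pi * ‖(fun j => (n j : ℝ))‖ / L) ^ 2 + N / L ^ 3 * (scatteringLength 0).toReal))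

/-- `holds_free_four` in this notation. [folklore] -/
theorem holdsFree_four (M ρ₀ : ℝ) (N₀ : ℕ) : HoldsFree M ρ₀ 4 N₀ := holds_free_four M ρ₀ N₀

/-- **TIGHTNESS (gen 1 (b)): for the free gas every admissible constant is at least `2`.**
If the conclusion of `DensityResponse` holds for `v = 0` with constants `(M, ρ₀, C, N₀)`, then
`2 ≤ C`: test the chord on the `η`-modulated product states at `L = M²N/(4π²)` (window equality,
`N` large enough for diluteness), `n = e₀`, optimal tilt; the ratio source²·k²/(4N·kinetic) is
`2/(1+2η²) ↑ 2` as `η ↓ 0`.  Hence the free optimal constant lies in `[2, 4]`. [folklore] -/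
theorem two_le_of_holdsFree {M ρ₀ C : ℝ} (hM : 0 < M) (hρ₀ : 0 < ρ₀) (hC : 0 < C) {N₀ : ℕ}
    (h : HoldsFree M ρ₀ C N₀) : 2 ≤ C := by
  by_contra hlt
  push Not at hlt
  -- a small modulation with `C (1 + 2η²) < 2`
  obtain ⟨η, hη0, hηC⟩ : ∃ η : ℝ, 0 < η ∧ C * (1 + 2 * η ^ 2) < 2 := by
    refine ⟨min (1 / 2) ((2 - C) / (4 * C)), by positivity, ?_⟩
    have h1 : min (1 / 2) ((2 - C) / (4 * C)) ≤ (2 - C) / (4 * C) := min_le_right _ _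
    have h2 : min (1 / 2) ((2 - C) / (4 * C)) ≤ 1 / 2 := min_le_left _ _
    have h3 : 0 < min (1 / 2) ((2 - C) / (4 * C)) := by positivity
    have h4 : (min (1 / 2) ((2 - C) / (4 * C))) ^ 2 ≤ (2 - C) / (4 * C) * (1 / 2) := by
      rw [sq]; exact mul_le_mul h1 h2 h3.le (by positivity)
    have h5 : C * (2 * ((2 - C) / (4 * C) * (1 / 2))) = (2 - C) / 4 := by field_simp
    nlinarith
  -- a large particle number: window equality `L = M²N/(4π²)` and diluteness `N ≤ ρ₀L³`
  obtain ⟨N, hN0, hN1, hNbig⟩ : ∃ N : ℕ, N₀ ≤ N ∧ 1 ≤ N ∧ (4 * Real.pi ^ 2) ^ 3 / (ρ₀ * M ^ 6) ≤ N := by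
    obtain ⟨m, hm⟩ := exists_nat_ge ((4 * Real.pi ^ 2) ^ 3 / (ρ₀ * M ^ 6))
    exact ⟨max (max N₀ 1) m, (le_max_left _ _).trans (le_max_left _ _),
      (le_max_right _ _).trans (le_max_left _ _), hm.trans (by exact_mod_cast le_max_right _ _)⟩
  have hN1r : (1 : ℝ) ≤ N := by exact_mod_cast hN1
  have hπ := Real.pi_pos
  obtain ⟨L, hL_def⟩ : ∃ L : ℝ, L = M ^ 2 * N / (4 * Real.pi ^ 2) := ⟨_, rfl⟩
  have hL : 0 < L := by rw [hL_def]; positivity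
  have hdil : (N : ℝ) ≤ ρ₀ * L ^ 3 := by
    rw [hL_def]
    rw [div_le_iff₀ (by positivity)] at hNbig
    have key : (N : ℝ) * (4 * Real.pi ^ 2) ^ 3 ≤ ρ₀ * (M ^ 2 * N) ^ 3 := by
      calc (N : ℝ) * (4 * Real.pi ^ 2) ^ 3 ≤ N * (N * (ρ₀ * M ^ 6)) := by gcongr
        _ ≤ N * (N * (ρ₀ * M ^ 6)) * N := le_mul_of_one_le_right (by positivity) hN1r
        _ = ρ₀ * (M ^ 2 * N) ^ 3 := by ring
    rw [div_pow, mul_div_assoc', le_div_iff₀ (by positivity)]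
    exact key
  -- the mode `n = e₀`
  obtain ⟨n, hn_def⟩ : ∃ n : Fin 3 → ℤ, n = Pi.single 0 1 := ⟨_, rfl⟩
  have hn : n ≠ 0 := by
    intro h0; have := congr_fun h0 0; simp [hn_def] at this
  have hnorm : ‖(fun j => (n j : ℝ))‖ = 1 := by
    have : (fun j => (n j : ℝ)) = Pi.single (0 : Fin 3) (1 : ℝ) := by
      funext j; simp only [hn_def, Pi.single_apply]; split_ifs <;> simp
    rw [this, Pi.norm_single, norm_one]
  have hphase : ∀ x : Space, 2 * Real.pi / L * ∑ j, (n j : ℝ) * x j = θL L x := by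
    intro x; simp [hn_def, Pi.single_apply, θL]
  have hwin : 2 * Real.pi * ‖(fun j => (n j : ℝ))‖ / L ≤ M * Real.sqrt (N / L ^ 3) := by
    rw [hnorm, mul_one]
    have hsq : (2 * Real.pi / L) ^ 2 = M ^ 2 * (N / L ^ 3) := by
      rw [hL_def]; field_simp; ring
    have : 2 * Real.pi / L = M * Real.sqrt (N / L ^ 3) := by
      rw [← Real.sqrt_sq (by positivity : (0 : ℝ) ≤ 2 * Real.pi / L), hsq,
        Real.sqrt_mul (sq_nonneg _), Real.sqrt_sq hM.le]
    exact this.le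
  -- the test: source `A`, kinetic energy `B`, optimal tilt `s`
  obtain ⟨q, hq_def⟩ : ∃ q : ℝ, q = (2 * Real.pi / L) ^ 2 := ⟨_, rfl⟩
  have hq : 0 < q := by rw [hq_def]; positivity
  obtain ⟨A, hA_def⟩ : ∃ A : ℝ, A = N * (4 * η / (1 + 2 * η ^ 2)) := ⟨_, rfl⟩
  have hA0 : 0 < A := by rw [hA_def]; positivity
  obtain ⟨s, hs_def⟩ : ∃ s : ℝ, s = A * q / (2 * C * N) := ⟨_, rfl⟩
  have hs : 0 ≤ s := by rw [hs_def]; positivity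
  have key := h N hN0 L hL hdil n hn hwin s hs (prodStateη η N hL)
  have hsrc : ∫ X in cellN N L, (∑ i, 2 * Real.cos (2 * Real.pi / L * ∑ j, (n j : ℝ) * X i j)) *
      ‖(prodStateη η N hL).ψ X‖ ^ 2 = A := by
    simp_rw [hphase]; rw [hA_def]; exact source_prodStateη η N hL
  have hden : (2 * Real.pi * ‖(fun j => (n j : ℝ))‖ / L) ^ 2 + N / L ^ 3 * (scatteringLength 0).toReal = q := by
    rw [hnorm, mul_one, scatteringLength_zero, ENNReal.toReal_zero, mul_zero, add_zero, hq_def]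
  rw [hsrc, hden, periodicGroundStateEnergy_zero N hL, zero_add, periodicEnergy_zero_prodStateη,
    ← hq_def, abs_of_pos hA0, ← ENNReal.ofReal_add (by positivity) (by positivity),
    ENNReal.ofReal_le_ofReal_iff (by positivity)] at key
  -- `s A ≤ B + C s² N/q` contradicts `C(1+2η²) < 2`
  have hNp : (0 : ℝ) < N := by linarith
  have hp : 0 < 1 + 2 * η ^ 2 := by positivity
  have h1 : s * A - C * s ^ 2 * N / q = A ^ 2 * q / (4 * C * N) := by
    rw [hs_def]; field_simp; ring
  have h2 : (N : ℝ) * (2 * η ^ 2 * q / (1 + 2 * η ^ 2)) < A ^ 2 * q / (4 * C * N) := by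
    rw [hA_def, lt_div_iff₀ (by positivity)]
    have e1 : (N : ℝ) * (2 * η ^ 2 * q / (1 + 2 * η ^ 2)) * (4 * C * N) =
        (8 * η ^ 2 * q * N ^ 2) * (C / (1 + 2 * η ^ 2)) := by
      field_simp
      ring
    have e2 : ((N : ℝ) * (4 * η / (1 + 2 * η ^ 2))) ^ 2 * q =
        (8 * η ^ 2 * q * N ^ 2) * (2 / (1 + 2 * η ^ 2) ^ 2) := by
      field_simp
      ring
    rw [e1, e2]
    refine mul_lt_mul_of_pos_left ?_ (by positivity)
    rw [div_lt_div_iff₀ hp (by positivity)]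
    nlinarith
  linarith

/-- No constant below `2` works for the free gas (gen 1 (c)). [folklore] -/
theorem not_holdsFree_of_lt_two {M ρ₀ C : ℝ} (hM : 0 < M) (hρ₀ : 0 < ρ₀) (hC : 0 < C) (hC2 : C < 2)
    {N₀ : ℕ} : ¬ HoldsFree M ρ₀ C N₀ := fun h => absurd (two_le_of_holdsFree hM hρ₀ hC h) (not_le.2 hC2)

end Tightness


/-! ## §12 DECORATIONS (generation 1's findings (d) and (h), re-derived importably): the sign
condition `0 ≤ s` and the absolute value around the source can both be dropped without changing the
statement -/

section Decorations

variable {N : ℕ} {L : ℝ}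

/-- **`DensityResponse` with `∀ s : ℝ` in place of `∀ s ≥ 0`.**  A variant STATEMENT (untagged). -/
def DensityResponseAllSigns : Prop :=
  ∀ v : ℝ → ℝ≥0∞, IsRepulsiveFiniteRange v → ∀ M : ℝ, 0 < M → ∃ ρ₀ C : ℝ, 0 < ρ₀ ∧ 0 < C ∧
    ∃ N₀ : ℕ, ∀ N : ℕ, N₀ ≤ N → ∀ L : ℝ, 0 < L → (N : ℝ) ≤ ρ₀ * L ^ 3 → ∀ n : Fin 3 → ℤ, n ≠ 0 →
    2 * Real.pi * ‖(fun j => (n j : ℝ))‖ / L ≤ M * Real.sqrt (N / L ^ 3) → ∀ s : ℝ,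
    ∀ Φ : PeriodicTrialState N L,
      periodicGroundStateEnergy v N L + ENNReal.ofReal (s * |∫ X in cellN N L,
        (∑ i, 2 * Real.cos (2 * Real.pi / L * ∑ j, (n j : ℝ) * X i j)) * ‖Φ.ψ X‖ ^ 2|) ≤
      periodicEnergy v Φ + ENNReal.ofReal (C * s ^ 2 * N /
        ((2 * Real.pi * ‖(fun j => (n j : ℝ))‖ / L) ^ 2 + N / L ^ 3 * (scatteringLength v).toReal))

/-- **`0 ≤ s` is decoration** (gen 1 (d)): for `s < 0` the tilt term is `ofReal` of a non-positive
number, i.e. `0`, and the chord is the variational principle. [folklore] -/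
theorem densityResponseAllSigns_iff :
    DensityResponseAllSigns ↔
      Summit.AtomisticToContinuum.BoseEinsteinCondensation.Theses.BECThomsonPrinciple.DensityResponse := by
  constructor
  · intro h v hv M hM
    obtain ⟨ρ₀, C, hρ₀, hC, N₀, H⟩ := h v hv M hM
    exact ⟨ρ₀, C, hρ₀, hC, N₀, fun N hN L hL hd n hn hw s _ Φ => H N hN L hL hd n hn hw s Φ⟩
  · intro h v hv M hM
    obtain ⟨ρ₀, C, hρ₀, hC, N₀, H⟩ := h v hv M hM
    refine ⟨ρ₀, C, hρ₀, hC, N₀, fun N hN L hL hd n hn hw s Φ => ?_⟩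
    rcases le_or_gt 0 s with hs | hs
    · exact H N hN L hL hd n hn hw s hs Φ
    · rw [ENNReal.ofReal_of_nonpos (mul_nonpos_of_nonpos_of_nonneg hs.le (abs_nonneg _)), add_zero]
      exact (periodicGroundStateEnergy_le v Φ).trans le_self_add

/-- **`DensityResponse` with the SIGNED source** (no absolute value).  A variant STATEMENT (untagged). -/
def DensityResponseNoAbs : Prop :=
  ∀ v : ℝ → ℝ≥0∞, IsRepulsiveFiniteRange v → ∀ M : ℝ, 0 < M → ∃ ρ₀ C : ℝ, 0 < ρ₀ ∧ 0 < C ∧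
    ∃ N₀ : ℕ, ∀ N : ℕ, N₀ ≤ N → ∀ L : ℝ, 0 < L → (N : ℝ) ≤ ρ₀ * L ^ 3 → ∀ n : Fin 3 → ℤ, n ≠ 0 →
    2 * Real.pi * ‖(fun j => (n j : ℝ))‖ / L ≤ M * Real.sqrt (N / L ^ 3) → ∀ s : ℝ, 0 ≤ s →
    ∀ Φ : PeriodicTrialState N L,
      periodicGroundStateEnergy v N L + ENNReal.ofReal (s * ∫ X in cellN N L,
        (∑ i, 2 * Real.cos (2 * Real.pi / L * ∑ j, (n j : ℝ) * X i j)) * ‖Φ.ψ X‖ ^ 2) ≤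
      periodicEnergy v Φ + ENNReal.ofReal (C * s ^ 2 * N /
        ((2 * Real.pi * ‖(fun j => (n j : ℝ))‖ / L) ^ 2 + N / L ^ 3 * (scatteringLength v).toReal))

/-- **Half-wavelength translation flips the source**: for `n ≠ 0` and `t = L n/(2|n|²)`,
`⟨Σᵢ 2cos(k·xᵢ)⟩_{Φ(· − t)} = −⟨Σᵢ 2cos(k·xᵢ)⟩_Φ`, at equal energy. [folklore] -/
theorem exists_translate_source_neg (hL : 0 < L) {n : Fin 3 → ℤ} (hn : n ≠ 0) (Φ : PeriodicTrialState N L) :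
    ∃ Ψ : PeriodicTrialState N L, (∀ v, periodicEnergy v Ψ = periodicEnergy v Φ) ∧
      ∫ X in cellN N L, (∑ i, 2 * Real.cos (2 * Real.pi / L * ∑ j, (n j : ℝ) * X i j)) * ‖Ψ.ψ X‖ ^ 2 =
        - ∫ X in cellN N L, (∑ i, 2 * Real.cos (2 * Real.pi / L * ∑ j, (n j : ℝ) * X i j)) * ‖Φ.ψ X‖ ^ 2 := by
  -- the half-wavelength shift
  set S : ℝ := ∑ j, (n j : ℝ) ^ 2 with hS_def
  have hS : 0 < S := by
    obtain ⟨l, hl⟩ : ∃ l, n l ≠ 0 := by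
      by_contra hcon
      push Not at hcon
      exact hn (funext hcon)
    have : (0 : ℝ) < (n l : ℝ) ^ 2 := by
      have : (n l : ℝ) ≠ 0 := by exact_mod_cast hl
      positivity
    exact lt_of_lt_of_le this (Finset.single_le_sum (f := fun j => (n j : ℝ) ^ 2)
      (fun j _ => sq_nonneg _) (Finset.mem_univ l))
  set t : Space := WithLp.toLp 2 fun j => L * (n j : ℝ) / (2 * S) with ht_def
  have hnt : ∑ j, (n j : ℝ) * t j = L / 2 := by
    simp only [ht_def, PiLp.toLp_apply]
    have : ∀ j, (n j : ℝ) * (L * (n j : ℝ) / (2 * S)) = (L / (2 * S)) * (n j : ℝ) ^ 2 := fun j => by ring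
    simp_rw [this]
    rw [← Finset.mul_sum, ← hS_def]
    field_simp
  obtain ⟨Ψ, hΨ⟩ := Φ.exists_translate t
  refine ⟨Ψ, fun v => periodicEnergy_translate v Φ t hΨ, ?_⟩
  -- the shifted source
  set T : Config N := fun _ => t with hT_def
  have hphase : ∀ (X : Config N) (i : Fin N),
      2 * Real.pi / L * ∑ j, (n j : ℝ) * (X + T) i j =
        2 * Real.pi / L * ∑ j, (n j : ℝ) * X i j + Real.pi := by
    intro X i
    have hTi : (X + T) i = X i + t := rfl
    simp only [hTi, PiLp.add_apply, mul_add, Finset.sum_add_distrib, hnt]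
    field_simp
  set G : Config N → ℝ := fun X =>
    (∑ i, 2 * Real.cos (2 * Real.pi / L * ∑ j, (n j : ℝ) * X i j)) * ‖Ψ.ψ X‖ ^ 2 with hG_def
  have hGper : ∀ (X : Config N) (i : Fin N) (k : Fin 3),
      G (X + Pi.single i (EuclideanSpace.single k L)) = G X := by
    intro X i k
    simp only [hG_def, Ψ.periodic X i k]
    congr 1
    refine Finset.sum_congr rfl fun i' _ => ?_
    congr 1
    have := phase_add_single hL.ne' n i' i k X
    unfold phase at this
    rw [this]
    split_ifs
    · rw [Real.cos_add_int_mul_two_pi]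
    · rw [add_zero]
  have hshift := setIntegral_cellN_comp_add hL hGper T
  rw [← hshift]
  have hΨT : ∀ X : Config N, Ψ.ψ (X + T) = Φ.ψ X := by
    intro X; rw [hΨ]; simp [hT_def]
  simp only [hG_def, hΨT, hphase, Real.cos_add_pi, mul_neg, Finset.sum_neg_distrib, neg_mul, integral_neg]

/-- **The absolute value is decoration** (gen 1 (h)): `DensityResponseNoAbs ↔ DensityResponse`
(a state with negative source is replaced by its half-wavelength translate). [folklore] -/
theorem densityResponseNoAbs_iff :
    DensityResponseNoAbs ↔
      Summit.AtomisticToContinuum.BoseEinsteinCondensation.Theses.BECThomsonPrinciple.DensityResponse := by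
  constructor
  · intro h v hv M hM
    obtain ⟨ρ₀, C, hρ₀, hC, N₀, H⟩ := h v hv M hM
    refine ⟨ρ₀, C, hρ₀, hC, N₀, fun N hN L hL hd n hn hw s hs Φ => ?_⟩
    rcases le_or_gt 0 (∫ X in cellN N L,
        (∑ i, 2 * Real.cos (2 * Real.pi / L * ∑ j, (n j : ℝ) * X i j)) * ‖Φ.ψ X‖ ^ 2) with hpos | hneg
    · rw [abs_of_nonneg hpos]; exact H N hN L hL hd n hn hw s hs Φ
    · obtain ⟨Ψ, hE, hsrc⟩ := exists_translate_source_neg hL hn Φ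
      have := H N hN L hL hd n hn hw s hs Ψ
      rwa [hsrc, hE v, ← abs_of_neg hneg] at this
  · intro h v hv M hM
    obtain ⟨ρ₀, C, hρ₀, hC, N₀, H⟩ := h v hv M hM
    refine ⟨ρ₀, C, hρ₀, hC, N₀, fun N hN L hL hd n hn hw s hs Φ => ?_⟩
    refine le_trans ?_ (H N hN L hL hd n hn hw s hs Φ)
    gcongr
    exact le_abs_self _

end Decorations

section Generation3

open Summit.AtomisticToContinuum.BoseEinsteinCondensation.Theses.BECThomsonPrinciple (DensityResponse)
open Summit.AtomisticToContinuum.BoseEinsteinCondensation.Cruxes.DensityResponse.ForceBalanceConstitutive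
  (periodicGroundStateEnergy_eq_zero_of_ae periodicEnergy_eq_ofReal_of_ae)

/-! ## §13 The scattering length is only a switch (generation 3) -/

section UnitStiffness

/-- The crux's inner conclusion for the potential `v`, window `M`, constants `(ρ₀, C, N₀)` and a
free STIFFNESS PARAMETER `b` in the Bogoliubov denominator `k∞² + (N/L³)·b` (the crux takes
`b = (scatteringLength v).toReal`; `HoldsFree M ρ₀ C N₀` is `HoldsWith 0 0 M ρ₀ C N₀`).  (Notation of
this file for variants of the crux's conclusion — not a literature fact; deliberately untagged.) -/
def HoldsWith (v : ℝ → ℝ≥0∞) (b M ρ₀ C : ℝ) (N₀ : ℕ) : Prop :=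
  ∀ N : ℕ, N₀ ≤ N → ∀ L : ℝ, 0 < L → (N : ℝ) ≤ ρ₀ * L ^ 3 → ∀ n : Fin 3 → ℤ, n ≠ 0 →
    2 * Real.pi * ‖(fun j => (n j : ℝ))‖ / L ≤ M * Real.sqrt (N / L ^ 3) → ∀ s : ℝ, 0 ≤ s →
    ∀ Φ : PeriodicTrialState N L,
      periodicGroundStateEnergy v N L + ENNReal.ofReal (s * |∫ X in cellN N L,
        (∑ i, 2 * Real.cos (2 * Real.pi / L * ∑ j, (n j : ℝ) * X i j)) * ‖Φ.ψ X‖ ^ 2|) ≤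
      periodicEnergy v Φ + ENNReal.ofReal (C * s ^ 2 * N /
        ((2 * Real.pi * ‖(fun j => (n j : ℝ))‖ / L) ^ 2 + N / L ^ 3 * b))

/-- The crux, read through `HoldsWith` (definitional). [folklore] -/
theorem densityResponse_iff_holdsWith :
    DensityResponse ↔ ∀ v : ℝ → ℝ≥0∞, IsRepulsiveFiniteRange v → ∀ M : ℝ, 0 < M →
      ∃ ρ₀ C : ℝ, 0 < ρ₀ ∧ 0 < C ∧ ∃ N₀ : ℕ, HoldsWith v (scatteringLength v).toReal M ρ₀ C N₀ :=
  Iff.rfl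

/-- `HoldsFree` (Tightness) is `HoldsWith 0 0`. [folklore] -/
theorem holdsFree_iff_holdsWith {M ρ₀ C : ℝ} {N₀ : ℕ} :
    HoldsFree M ρ₀ C N₀ ↔ HoldsWith 0 0 M ρ₀ C N₀ := by
  unfold HoldsFree HoldsWith
  rw [scatteringLength_zero, ENNReal.toReal_zero]

/-- Comparison of two right-hand sides `C s²N/(q + ρb)` (pure arithmetic). [folklore] -/
theorem rhs_le_rhs {C C' b b' q ρ s N : ℝ} (hq : 0 < q) (hρ : 0 ≤ ρ) (hb : 0 ≤ b) (hb' : 0 ≤ b')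
    (hN : 0 ≤ N) (h : C * (q + ρ * b') ≤ C' * (q + ρ * b)) :
    C * s ^ 2 * N / (q + ρ * b) ≤ C' * s ^ 2 * N / (q + ρ * b') := by
  rw [div_le_div_iff₀ (by positivity) (by positivity)]
  have hsN : 0 ≤ s ^ 2 * N := by positivity
  calc C * s ^ 2 * N * (q + ρ * b') = s ^ 2 * N * (C * (q + ρ * b')) := by ring
    _ ≤ s ^ 2 * N * (C' * (q + ρ * b)) := mul_le_mul_of_nonneg_left h hsN
    _ = C' * s ^ 2 * N * (q + ρ * b) := by ring

/-- Transfer of the conclusion along a comparison of constants and stiffness parameters. [folklore] -/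
theorem HoldsWith.of_le {v : ℝ → ℝ≥0∞} {b b' M ρ₀ C C' : ℝ} {N₀ : ℕ} (hb : 0 ≤ b) (hb' : 0 ≤ b')
    (hCC : ∀ q ρ : ℝ, 0 < q → 0 ≤ ρ → C * (q + ρ * b') ≤ C' * (q + ρ * b))
    (h : HoldsWith v b M ρ₀ C N₀) : HoldsWith v b' M ρ₀ C' N₀ := by
  intro N hN L hL hdil n hn hwin s hs Φ
  refine (h N hN L hL hdil n hn hwin s hs Φ).trans (add_le_add le_rfl (ENNReal.ofReal_le_ofReal ?_))
  have hq : 0 < (2 * Real.pi * ‖(fun j => (n j : ℝ))‖ / L) ^ 2 := pow_pos (kinf_pos hL hn) 2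
  exact rhs_le_rhs hq (by positivity) hb hb' (Nat.cast_nonneg N) (hCC _ _ hq (by positivity))

/-- Monotonicity in the constant. [folklore] -/
theorem HoldsWith.mono {v : ℝ → ℝ≥0∞} {b M ρ₀ C C' : ℝ} {N₀ : ℕ} (hb : 0 ≤ b) (hCC : C ≤ C')
    (h : HoldsWith v b M ρ₀ C N₀) : HoldsWith v b M ρ₀ C' N₀ :=
  h.of_le hb hb fun q ρ hq hρ => mul_le_mul_of_nonneg_right hCC (by positivity)

/-- Antitonicity in the stiffness parameter: a SMALLER stiffness is a WEAKER claim. [folklore] -/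
theorem HoldsWith.anti {v : ℝ → ℝ≥0∞} {b b' M ρ₀ C : ℝ} {N₀ : ℕ} (hb' : 0 ≤ b') (hbb : b' ≤ b)
    (hC : 0 ≤ C) (h : HoldsWith v b M ρ₀ C N₀) : HoldsWith v b' M ρ₀ C N₀ :=
  h.of_le (hb'.trans hbb) hb' fun q ρ hq hρ => by
    refine mul_le_mul_of_nonneg_left ?_ hC
    gcongr

/-- **Any two positive stiffness parameters are interchangeable** (the constant `C` is existential
after `v`): `HoldsWith v b … C … → HoldsWith v b' … (C · max 1 (b'/b)) …`. [folklore] -/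
theorem HoldsWith.stiffness {v : ℝ → ℝ≥0∞} {b b' M ρ₀ C : ℝ} {N₀ : ℕ} (hb : 0 < b) (hb' : 0 < b')
    (hC : 0 ≤ C) (h : HoldsWith v b M ρ₀ C N₀) : HoldsWith v b' M ρ₀ (C * max 1 (b' / b)) N₀ := by
  refine h.of_le hb.le hb'.le fun q ρ hq hρ => ?_
  rcases le_or_gt b' b with hle | hlt
  · calc C * (q + ρ * b') ≤ C * (q + ρ * b) := by gcongr
      _ = C * 1 * (q + ρ * b) := by ring
      _ ≤ C * max 1 (b' / b) * (q + ρ * b) := by gcongr; exact le_max_left _ _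
  · have hmax : max 1 (b' / b) = b' / b := max_eq_right ((one_le_div hb).2 hlt.le)
    rw [hmax]
    have e : C * (b' / b) * (q + ρ * b) = C * (q * (b' / b) + ρ * b') := by
      field_simp
    rw [e]
    refine mul_le_mul_of_nonneg_left (add_le_add ?_ le_rfl) hC
    exact le_mul_of_one_le_right hq.le ((one_le_div hb).2 hlt.le)

/-- **`a(v) = 0`: the conclusion holds with stiffness `0` and `C = 4`.** If `v(|x|) = 0` for a.e.
`x ∈ ℝ³` (for admissible `v` this is `scatteringLength v = 0`, LSSY App. C), then
`E₀^per(v) = 0`, `E_v(Φ) = E_0(Φ)` and the free chord `free_chord_energy` is the claim. [folklore] -/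
theorem holdsWith_zero_of_ae {v : ℝ → ℝ≥0∞} (hv : Measurable v) (hv0 : ∀ᵐ x : Space, v ‖x‖ = 0)
    (M ρ₀ : ℝ) (N₀ : ℕ) : HoldsWith v 0 M ρ₀ 4 N₀ := by
  intro N _ L hL _ n hn _ s hs Φ
  rw [periodicGroundStateEnergy_eq_zero_of_ae hv hv0 N hL, zero_add, mul_zero, add_zero]
  exact free_chord_energy hL v hn hs Φ

/-- **`a(v) = 0`: NO positive stiffness is admissible.** If `v(|x|) = 0` a.e. then for every
`b, M, ρ₀, C > 0` and `N₀` the conclusion `HoldsWith v b M ρ₀ C N₀` FAILS: on the torus of integer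
side `L = K → ∞` with `N = ⌈ρ₀K³/2⌉` particles (`ρ ∈ [ρ₀/2, ρ₀]`, window `2π/K ≤ M√ρ` for large
`K`), mode `n = e₀` (`k∞² = q = (2π/K)²`), the one-phonon product state `∏ᵢ c(1 + cos θᵢ)`
(`prodStateη ½`: source `4N/3`, energy `qN/3`, `E₀^per = 0`) and tilt `s = q/2` give
`sA − E = qN/3 > Cq²N/(4(q + ρb))` as soon as `ρ b > Cq`, i.e. `K² > 6π²C/(ρ₀ b)`:
the free response `χ/N = 2/k²` is not `O(1/(k² + ρb))`. [folklore] -/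
theorem not_holdsWith_of_ae_pos {v : ℝ → ℝ≥0∞} (hv : Measurable v) (hv0 : ∀ᵐ x : Space, v ‖x‖ = 0)
    {b M ρ₀ C : ℝ} (hb : 0 < b) (hM : 0 < M) (hρ₀ : 0 < ρ₀) (hC : 0 < C) (N₀ : ℕ) :
    ¬ HoldsWith v b M ρ₀ C N₀ := by
  intro h
  have hπ := Real.pi_pos
  -- a large integer side `K`
  obtain ⟨K, hK⟩ := exists_nat_gt (max (max (max 1 (2 * (N₀ + 1) / ρ₀)) (8 * Real.pi ^ 2 / (M ^ 2 * ρ₀)))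
    (6 * Real.pi ^ 2 * C / (ρ₀ * b)))
  have hK1 : (1 : ℝ) < K :=
    lt_of_le_of_lt ((le_max_left _ _).trans ((le_max_left _ _).trans (le_max_left _ _))) hK
  have hKN : 2 * (N₀ + 1) / ρ₀ < K :=
    lt_of_le_of_lt ((le_max_right _ _).trans ((le_max_left _ _).trans (le_max_left _ _))) hK
  have hKM : 8 * Real.pi ^ 2 / (M ^ 2 * ρ₀) < K :=
    lt_of_le_of_lt ((le_max_right _ _).trans (le_max_left _ _)) hK
  have hKC : 6 * Real.pi ^ 2 * C / (ρ₀ * b) < K := lt_of_le_of_lt (le_max_right _ _) hK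
  have hK0 : (0 : ℝ) < K := lt_trans one_pos hK1
  have hKK : (K : ℝ) ≤ (K : ℝ) ^ 2 := by nlinarith only [hK1]
  have hKKK : (K : ℝ) ≤ (K : ℝ) ^ 3 := by nlinarith only [hK1, hKK]
  -- the particle number `N = ⌈ρ₀K³/2⌉`, density in `[ρ₀/2, ρ₀]`
  obtain ⟨x, hx_def⟩ : ∃ x : ℝ, x = ρ₀ * (K : ℝ) ^ 3 / 2 := ⟨_, rfl⟩
  have hx0 : 0 ≤ x := by rw [hx_def]; positivity
  have hxN : (N₀ : ℝ) + 1 ≤ x := by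
    rw [hx_def]
    rw [div_lt_iff₀ hρ₀] at hKN
    nlinarith only [hKN, mul_le_mul_of_nonneg_left hKKK hρ₀.le]
  obtain ⟨N, hN_def⟩ : ∃ N : ℕ, N = ⌈x⌉₊ := ⟨_, rfl⟩
  have hNx : x ≤ N := by rw [hN_def]; exact Nat.le_ceil x
  have hNx' : (N : ℝ) < x + 1 := by rw [hN_def]; exact Nat.ceil_lt_add_one hx0
  have hN0r : (0 : ℝ) ≤ N₀ := Nat.cast_nonneg _
  have hN0 : N₀ ≤ N := by
    have : (N₀ : ℝ) ≤ N := by linarith only [hxN, hNx]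
    exact_mod_cast this
  have hNpos : (0 : ℝ) < N := by linarith only [hxN, hNx, hN0r]
  have hL : (0 : ℝ) < K := hK0
  have hdil : (N : ℝ) ≤ ρ₀ * (K : ℝ) ^ 3 := by
    rw [hx_def] at hNx' hxN
    linarith only [hNx', hxN, hN0r]
  have hρ : ρ₀ / 2 ≤ N / (K : ℝ) ^ 3 := by
    rw [le_div_iff₀ (by positivity)]
    rw [hx_def] at hNx
    linarith only [hNx]
  -- the mode `n = e₀`
  obtain ⟨n, hn_def⟩ : ∃ n : Fin 3 → ℤ, n = Pi.single 0 1 := ⟨_, rfl⟩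
  have hn : n ≠ 0 := by
    intro h0; have := congr_fun h0 0; simp [hn_def] at this
  have hnorm : ‖(fun j => (n j : ℝ))‖ = 1 := by
    have : (fun j => (n j : ℝ)) = Pi.single (0 : Fin 3) (1 : ℝ) := by
      funext j; simp only [hn_def, Pi.single_apply]; split_ifs <;> simp
    rw [this, Pi.norm_single, norm_one]
  have hphase : ∀ y : Space, 2 * Real.pi / (K : ℝ) * ∑ j, (n j : ℝ) * y j = θL (K : ℝ) y := by
    intro y; simp [hn_def, Pi.single_apply, θL]
  obtain ⟨q, hq_def⟩ : ∃ q : ℝ, q = (2 * Real.pi / (K : ℝ)) ^ 2 := ⟨_, rfl⟩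
  have hq : 0 < q := by rw [hq_def]; positivity
  have hqK : q * (K : ℝ) ^ 2 = 4 * Real.pi ^ 2 := by
    rw [hq_def]; field_simp; ring
  -- the window `2π/K ≤ M√ρ`, from `q ≤ M²ρ₀/2 ≤ M²ρ`
  have hqM : q ≤ M ^ 2 * (N / (K : ℝ) ^ 3) := by
    have h1 : q ≤ M ^ 2 * (ρ₀ / 2) := by
      rw [div_lt_iff₀ (by positivity)] at hKM
      -- `8π² < K M²ρ₀ ≤ K² M²ρ₀` and `q K² = 4π²`
      have h2 : q * (K : ℝ) ^ 2 ≤ M ^ 2 * (ρ₀ / 2) * (K : ℝ) ^ 2 := by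
        rw [hqK]
        nlinarith only [hKM, mul_le_mul_of_nonneg_left hKK (le_of_lt (by positivity : (0 : ℝ) < M ^ 2 * ρ₀))]
      exact le_of_mul_le_mul_right h2 (by positivity)
    exact h1.trans (by gcongr)
  have hwin : 2 * Real.pi * ‖(fun j => (n j : ℝ))‖ / (K : ℝ) ≤ M * Real.sqrt (N / (K : ℝ) ^ 3) := by
    rw [hnorm, mul_one]
    calc 2 * Real.pi / (K : ℝ) = Real.sqrt q := by
          rw [hq_def, Real.sqrt_sq (by positivity)]
      _ ≤ Real.sqrt (M ^ 2 * (N / (K : ℝ) ^ 3)) := Real.sqrt_le_sqrt hqM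
      _ = M * Real.sqrt (N / (K : ℝ) ^ 3) := by
          rw [Real.sqrt_mul (sq_nonneg _), Real.sqrt_sq hM.le]
  -- the test state and tilt
  obtain ⟨s, hs_def⟩ : ∃ s : ℝ, s = q / 2 := ⟨_, rfl⟩
  have hs : 0 ≤ s := by rw [hs_def]; positivity
  have key := h N hN0 (K : ℝ) hL hdil n hn hwin s hs (prodStateη (1 / 2) N hL)
  have hsrc : ∫ X in cellN N (K : ℝ), (∑ i, 2 * Real.cos (2 * Real.pi / (K : ℝ) * ∑ j, (n j : ℝ) * X i j)) *
      ‖(prodStateη (1 / 2) N hL).ψ X‖ ^ 2 = N * (4 / 3) := by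
    simp_rw [hphase]
    rw [source_prodStateη (1 / 2) N hL]
    norm_num
  have hE : periodicEnergy v (prodStateη (1 / 2) N hL) = ENNReal.ofReal (N * (q / 3)) := by
    rw [periodicEnergy_eq_ofReal_of_ae hv hv0,
      ← periodicEnergy_eq_ofReal_of_ae (w := 0) measurable_const (Filter.Eventually.of_forall fun _ => rfl),
      periodicEnergy_zero_prodStateη, ← hq_def]
    congr 1
    ring
  have hden : (2 * Real.pi * ‖(fun j => (n j : ℝ))‖ / (K : ℝ)) ^ 2 + N / (K : ℝ) ^ 3 * b =
      q + N / (K : ℝ) ^ 3 * b := by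
    rw [hnorm, mul_one, hq_def]
  have hA0 : (0 : ℝ) < N * (4 / 3) := by positivity
  rw [hsrc, hden, periodicGroundStateEnergy_eq_zero_of_ae hv hv0 N hL, zero_add, hE,
    abs_of_pos hA0, ← ENNReal.ofReal_add (by positivity) (by positivity),
    ENNReal.ofReal_le_ofReal_iff (by positivity), hs_def] at key
  -- `key : (q/2)(4N/3) ≤ qN/3 + C(q/2)²N/(q + ρb)`, i.e. `4(q + ρb) ≤ 3Cq`; but `4ρb > 3Cq`:
  have hρb : 3 / 4 * C * q < N / (K : ℝ) ^ 3 * b := by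
    have h1 : 3 / 4 * C * q < ρ₀ / 2 * b := by
      rw [div_lt_iff₀ (by positivity)] at hKC
      -- `6π²C < Kρ₀b ≤ K²ρ₀b` and `qK² = 4π²`
      have h2 : 3 / 4 * C * q * (K : ℝ) ^ 2 < ρ₀ / 2 * b * (K : ℝ) ^ 2 := by
        have e : 3 / 4 * C * q * (K : ℝ) ^ 2 = 3 * C * Real.pi ^ 2 := by
          rw [mul_assoc, hqK]; ring
        rw [e]
        nlinarith only [hKC, mul_le_mul_of_nonneg_left hKK (mul_pos hρ₀ hb).le]
      exact lt_of_mul_lt_mul_right h2 (by positivity)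
    exact h1.trans_le (by gcongr)
  have hden0 : 0 < q + N / (K : ℝ) ^ 3 * b := by positivity
  have key2 : q / 2 * (N * (4 / 3)) - N * (q / 3) ≤ C * (q / 2) ^ 2 * N / (q + N / (K : ℝ) ^ 3 * b) := by
    linarith only [key]
  rw [le_div_iff₀ hden0] at key2
  have hqN : 0 < q * N := mul_pos hq hNpos
  have e3 : (q / 2 * (N * (4 / 3)) - N * (q / 3)) * (q + N / (K : ℝ) ^ 3 * b) =
      q * q * N / 3 + q * N * (N / (K : ℝ) ^ 3 * b) / 3 := by ring
  have e4 : C * (q / 2) ^ 2 * N = q * N * (3 / 4 * C * q) / 3 := by ring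
  rw [e3, e4] at key2
  have h4 : q * N * (3 / 4 * C * q) < q * N * (N / (K : ℝ) ^ 3 * b) := mul_lt_mul_of_pos_left hρb hqN
  have hP : 0 < q * q * N := by positivity
  linarith only [key2, h4, hP]

/-- The crux with a FIXED positive stiffness parameter `b` in place of `a(v)`, guarded by `a(v) ≠ 0`
(a variant STATEMENT, shown equivalent to the crux below — not a literature fact; deliberately untagged). -/
def DensityResponseStiffness (b : ℝ) : Prop :=
  ∀ v : ℝ → ℝ≥0∞, IsRepulsiveFiniteRange v → scatteringLength v ≠ 0 → ∀ M : ℝ, 0 < M →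
    ∃ ρ₀ C : ℝ, 0 < ρ₀ ∧ 0 < C ∧ ∃ N₀ : ℕ, HoldsWith v b M ρ₀ C N₀

/-- **THE SCATTERING LENGTH IS ONLY A SWITCH.** For every fixed `b > 0` the crux is equivalent to its
unit-stiffness form on `{v : a(v) ≠ 0}`: `a(v) = 0` forces `v = 0` a.e. (LSSY App. C,
`LSSY2005_zeroScatteringLength_holds`), where the crux is the proved free chord
(`holdsWith_zero_of_ae`); for `0 < a(v) < ∞` (`scatteringLength_ne_top_of_finiteRange`) the constants
`C·max 1 (b/a)` resp. `C·max 1 (a/b)` translate (`HoldsWith.stiffness`). [folklore] -/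
theorem densityResponse_iff_stiffness {b : ℝ} (hb : 0 < b) : DensityResponse ↔ DensityResponseStiffness b := by
  constructor
  · intro h v hv ha M hM
    obtain ⟨ρ₀, C, hρ₀, hC, N₀, hH⟩ := h v hv M hM
    have hH' : HoldsWith v (scatteringLength v).toReal M ρ₀ C N₀ := hH
    obtain ⟨R₀, hR₀⟩ := hv.2
    have hapos : 0 < (scatteringLength v).toReal :=
      ENNReal.toReal_pos ha (scatteringLength_ne_top_of_finiteRange hR₀)
    exact ⟨ρ₀, C * max 1 (b / (scatteringLength v).toReal), hρ₀, by positivity, N₀,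
      hH'.stiffness hapos hb hC.le⟩
  · intro h v hv M hM
    by_cases ha : scatteringLength v = 0
    · obtain ⟨R₀, hR₀⟩ := hv.2
      have hv0 : ∀ᵐ x : Space, v ‖x‖ = 0 := LSSY2005_zeroScatteringLength_holds v R₀ hv.1 hR₀ ha
      refine ⟨1, 4, one_pos, by norm_num, 0, ?_⟩
      rw [ha, ENNReal.toReal_zero]
      exact holdsWith_zero_of_ae hv.1 hv0 M 1 0
    · obtain ⟨ρ₀, C, hρ₀, hC, N₀, hH⟩ := h v hv ha M hM
      obtain ⟨R₀, hR₀⟩ := hv.2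
      have hapos : 0 < (scatteringLength v).toReal :=
        ENNReal.toReal_pos ha (scatteringLength_ne_top_of_finiteRange hR₀)
      exact ⟨ρ₀, C * max 1 ((scatteringLength v).toReal / b), hρ₀, by positivity, N₀,
        hH.stiffness hb hapos hC.le⟩

/-- The unit-stiffness normal form of the crux: `χ(k) ≤ 2CN/(k∞² + ρ)` for admissible `v` with
`a(v) ≠ 0`. [folklore] -/
theorem densityResponse_iff_unit : DensityResponse ↔ DensityResponseStiffness 1 :=
  densityResponse_iff_stiffness one_pos

/-- **The guard `a(v) ≠ 0` is load-bearing in the normal form**: without it the unit-stiffness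
statement is FALSE (witness `v = 0`, `not_holdsWith_of_ae_pos`).  Equivalently: a proof of the crux
must USE that `v ≠ 0` a.e. — it must detect the interaction, and only that. [folklore] -/
theorem not_stiffness_without_pos {b : ℝ} (hb : 0 < b) :
    ¬ (∀ v : ℝ → ℝ≥0∞, IsRepulsiveFiniteRange v → ∀ M : ℝ, 0 < M →
      ∃ ρ₀ C : ℝ, 0 < ρ₀ ∧ 0 < C ∧ ∃ N₀ : ℕ, HoldsWith v b M ρ₀ C N₀) := by
  intro h
  obtain ⟨ρ₀, C, hρ₀, hC, N₀, hH⟩ := h 0 ⟨measurable_const, ⟨0, fun _ _ => rfl⟩⟩ 1 one_pos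
  exact not_holdsWith_of_ae_pos (v := 0) measurable_const (Filter.Eventually.of_forall fun _ => rfl)
    hb one_pos hρ₀ hC N₀ hH

/-- In particular (with `b = a(w)` for ANY admissible `w` with `a(w) > 0`, e.g. the hard sphere):
the crux's bound with a `v`-INDEPENDENT scattering length is false. [folklore] -/
theorem not_holdsWith_free_pos {b M ρ₀ C : ℝ} (hb : 0 < b) (hM : 0 < M) (hρ₀ : 0 < ρ₀) (hC : 0 < C)
    (N₀ : ℕ) : ¬ HoldsWith 0 b M ρ₀ C N₀ :=
  not_holdsWith_of_ae_pos (v := 0) measurable_const (Filter.Eventually.of_forall fun _ => rfl) hb hM hρ₀ hC N₀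

end UnitStiffness

/-! ## §14 `N₀` is decoration: the admissible region (generation 3) -/

section Threshold

/-! ### `N₀` is decoration: the admissible region

Window `2π‖n‖∞/L ≤ M√(N/L³)` with `n ≠ 0` gives `L ≤ M²N/(4π²)`; with diluteness `N ≤ ρ₀L³` this forces
`(4π²)³ ≤ ρ₀M⁶N²`, i.e. `N ≥ (4π²)^{3/2}/(M³√ρ₀)`: a small `ρ₀` already makes `N` large, so the
threshold `N₀` can be absorbed into `ρ₀` (`HoldsWith.noThreshold`, `densityResponse_iff_noThreshold`). -/

/-- A non-zero integer vector has sup norm at least `1`. [folklore] -/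
theorem one_le_norm_of_ne_zero {n : Fin 3 → ℤ} (hn : n ≠ 0) : 1 ≤ ‖(fun j => (n j : ℝ))‖ := by
  obtain ⟨j, hj⟩ : ∃ j, n j ≠ 0 := by
    by_contra h
    push Not at h
    exact hn (funext h)
  have h1 : (1 : ℝ) ≤ |(n j : ℝ)| := by
    have h2 : (1 : ℤ) ≤ |n j| := Int.one_le_abs hj
    have h3 : ((1 : ℤ) : ℝ) ≤ ((|n j| : ℤ) : ℝ) := by exact_mod_cast h2
    simpa [Int.cast_abs] using h3
  have h4 : ‖(fun j : Fin 3 => (n j : ℝ)) j‖ ≤ ‖(fun j : Fin 3 => (n j : ℝ))‖ :=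
    norm_le_pi_norm (fun j : Fin 3 => (n j : ℝ)) j
  rw [Real.norm_eq_abs] at h4
  exact h1.trans h4

/-- **The window bounds the side**: `4π²L ≤ (2π‖n‖∞)²L ≤ M²N`, i.e. `L ≤ M²N/(4π²)` (in particular the
window is empty for `N = 0`). [folklore] -/
theorem side_le_of_window {N : ℕ} {L M : ℝ} (hL : 0 < L) {n : Fin 3 → ℤ} (hn : n ≠ 0)
    (hwin : 2 * Real.pi * ‖(fun j => (n j : ℝ))‖ / L ≤ M * Real.sqrt (N / L ^ 3)) :
    4 * Real.pi ^ 2 * L ≤ M ^ 2 * N := by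
  have hπ := Real.pi_pos
  have h0 : 0 ≤ 2 * Real.pi * ‖(fun j => (n j : ℝ))‖ / L := by positivity
  have hsq : (2 * Real.pi * ‖(fun j => (n j : ℝ))‖ / L) ^ 2 ≤ (M * Real.sqrt (N / L ^ 3)) ^ 2 :=
    pow_le_pow_left₀ h0 hwin 2
  rw [mul_pow, Real.sq_sqrt (by positivity)] at hsq
  have h1 := one_le_norm_of_ne_zero hn
  have h2 : (2 * Real.pi / L) ^ 2 ≤ (2 * Real.pi * ‖(fun j => (n j : ℝ))‖ / L) ^ 2 := by
    apply pow_le_pow_left₀ (by positivity)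
    rw [div_le_div_iff_of_pos_right hL]
    nlinarith only [h1, hπ]
  have h3 : (2 * Real.pi / L) ^ 2 ≤ M ^ 2 * (N / L ^ 3) := h2.trans hsq
  have e : M ^ 2 * (N / L ^ 3) = M ^ 2 * N / L / L ^ 2 := by
    field_simp
  rw [div_pow, e, div_le_div_iff_of_pos_right (by positivity), le_div_iff₀ hL] at h3
  nlinarith only [h3]

/-- **Window + diluteness force a large particle number**: `(4π²)³ ≤ ρ₀M⁶N²`. [folklore] -/
theorem const_le_sq_of_window_dilute {N : ℕ} {L M ρ₀ : ℝ} (hL : 0 < L) (hρ₀ : 0 ≤ ρ₀)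
    {n : Fin 3 → ℤ} (hn : n ≠ 0) (hdil : (N : ℝ) ≤ ρ₀ * L ^ 3)
    (hwin : 2 * Real.pi * ‖(fun j => (n j : ℝ))‖ / L ≤ M * Real.sqrt (N / L ^ 3)) :
    (4 * Real.pi ^ 2) ^ 3 ≤ ρ₀ * M ^ 6 * (N : ℝ) ^ 2 := by
  have hπ := Real.pi_pos
  have h1 := side_le_of_window hL hn hwin
  have hN0 : (0 : ℝ) ≤ N := Nat.cast_nonneg N
  have hN : (0 : ℝ) < N := by
    rcases hN0.lt_or_eq with h | h
    · exact h
    · rw [← h, mul_zero] at h1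
      have : 0 < 4 * Real.pi ^ 2 * L := by positivity
      linarith
  have h2 : (4 * Real.pi ^ 2 * L) ^ 3 ≤ (M ^ 2 * N) ^ 3 := pow_le_pow_left₀ (by positivity) h1 3
  have h3 : (N : ℝ) * (4 * Real.pi ^ 2) ^ 3 ≤ N * (ρ₀ * M ^ 6 * (N : ℝ) ^ 2) := by
    calc (N : ℝ) * (4 * Real.pi ^ 2) ^ 3 ≤ ρ₀ * L ^ 3 * (4 * Real.pi ^ 2) ^ 3 := by gcongr
      _ = ρ₀ * (4 * Real.pi ^ 2 * L) ^ 3 := by ring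
      _ ≤ ρ₀ * (M ^ 2 * N) ^ 3 := by gcongr
      _ = N * (ρ₀ * M ^ 6 * (N : ℝ) ^ 2) := by ring
  exact le_of_mul_le_mul_left h3 hN

/-- **`N₀` is decoration**: shrinking `ρ₀` to `min ρ₀ ((4π²)³/(M⁶(N₀+1)²))` makes every admissible `N`
exceed `N₀`, so the threshold can be taken to be `0`. [folklore] -/
theorem HoldsWith.noThreshold {v : ℝ → ℝ≥0∞} {b M ρ₀ C : ℝ} {N₀ : ℕ} (hM : 0 < M) (hρ₀ : 0 < ρ₀)
    (h : HoldsWith v b M ρ₀ C N₀) :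
    HoldsWith v b M (min ρ₀ ((4 * Real.pi ^ 2) ^ 3 / (M ^ 6 * ((N₀ : ℝ) + 1) ^ 2))) C 0 := by
  intro N _ L hL hdil n hn hwin s hs Φ
  have hπ := Real.pi_pos
  have hρ₁ : 0 ≤ min ρ₀ ((4 * Real.pi ^ 2) ^ 3 / (M ^ 6 * ((N₀ : ℝ) + 1) ^ 2)) :=
    le_min hρ₀.le (by positivity)
  have hdil₀ : (N : ℝ) ≤ ρ₀ * L ^ 3 :=
    hdil.trans (mul_le_mul_of_nonneg_right (min_le_left _ _) (by positivity))
  have hN : N₀ ≤ N := by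
    have h1 := const_le_sq_of_window_dilute hL hρ₁ hn hdil hwin
    have h2 : (4 * Real.pi ^ 2) ^ 3 ≤ (4 * Real.pi ^ 2) ^ 3 / (M ^ 6 * ((N₀ : ℝ) + 1) ^ 2) * M ^ 6 * (N : ℝ) ^ 2 :=
      h1.trans (by gcongr; exact min_le_right _ _)
    have e : (4 * Real.pi ^ 2) ^ 3 / (M ^ 6 * ((N₀ : ℝ) + 1) ^ 2) * M ^ 6 * (N : ℝ) ^ 2 =
        (4 * Real.pi ^ 2) ^ 3 * ((N : ℝ) ^ 2 / ((N₀ : ℝ) + 1) ^ 2) := by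
      field_simp
    rw [e] at h2
    have h3 : (1 : ℝ) ≤ (N : ℝ) ^ 2 / ((N₀ : ℝ) + 1) ^ 2 :=
      le_of_mul_le_mul_left (by rw [mul_one]; exact h2) (by positivity : (0 : ℝ) < (4 * Real.pi ^ 2) ^ 3)
    rw [le_div_iff₀ (by positivity), one_mul] at h3
    have h4 : (N₀ : ℝ) + 1 ≤ N := by
      have hN0 : (0 : ℝ) ≤ N := Nat.cast_nonneg N
      nlinarith only [h3, hN0]
    exact_mod_cast (show ((N₀ : ℕ) : ℝ) ≤ N by linarith only [h4])
  exact h N hN L hL hdil₀ n hn hwin s hs Φ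

end Threshold

/-- **The crux with `N₀ = 0`** is equivalent to the crux. [folklore] -/
theorem densityResponse_iff_noThreshold :
    DensityResponse ↔ ∀ v : ℝ → ℝ≥0∞, IsRepulsiveFiniteRange v → ∀ M : ℝ, 0 < M →
      ∃ ρ₀ C : ℝ, 0 < ρ₀ ∧ 0 < C ∧ HoldsWith v (scatteringLength v).toReal M ρ₀ C 0 := by
  constructor
  · intro h v hv M hM
    obtain ⟨ρ₀, C, hρ₀, hC, N₀, hH⟩ := h v hv M hM
    have hH' : HoldsWith v (scatteringLength v).toReal M ρ₀ C N₀ := hH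
    exact ⟨_, C, lt_min hρ₀ (by positivity), hC, hH'.noThreshold hM hρ₀⟩
  · intro h v hv M hM
    obtain ⟨ρ₀, C, hρ₀, hC, hH⟩ := h v hv M hM
    exact ⟨ρ₀, C, hρ₀, hC, 0, hH⟩

/-! ## §15 Large tilts are free under an energy ceiling (generation 3) -/

section EnergyCeiling

variable {N : ℕ} {L : ℝ}

/-- **Large tilts are free under an energy ceiling.** If `E₀^per(v,N,L) ≤ B` then every tilt with
`B·k∞² ≤ s²N` satisfies the chord RELATIVE TO `E₀(v)` with the free-type right-hand side `5s²N/k∞²`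
(`E₀ + s|m| ≤ B + E(Φ) + 4s²N/k∞²`, free chord).  With Dyson's ceiling `B = 8πρaN` (in tree:
`LSSY2005_upperBound_periodic_holds`, `2R₀ < L`, `N ≥ 2`, `a/b ≤ c`) every tilt `s ≥ k∞√(8πρa)` is
thus covered; since `5/k∞² ≤ 5(1+Λ)/(k∞² + ρa)` when `ρa ≤ Λk∞²`, in the PARTICLE regime `ρa ≤ Λk∞²`
only the tilts `s < k∞√(8πρa) ≤ √(8πΛ)·k∞²` remain open, while in the PHONON regime `ρa ≫ k∞²` the
free right-hand side is useless (`C ∝ ρa/k∞²`): the open content of the crux is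
`{phonon regime, 0 ≤ s ≤ 2(k∞²+ρa)/C} ∪ {particle regime, 0 ≤ s ≲ k∞√(ρa)}`. [folklore] -/
theorem chord_of_energy_ceiling (hL : 0 < L) (v : ℝ → ℝ≥0∞) {n : Fin 3 → ℤ} (hn : n ≠ 0) {s B : ℝ}
    (hs : 0 ≤ s) (hB : 0 ≤ B) (hE : periodicGroundStateEnergy v N L ≤ ENNReal.ofReal B)
    (hsB : B * (2 * Real.pi * ‖(fun j => (n j : ℝ))‖ / L) ^ 2 ≤ s ^ 2 * N) (Φ : PeriodicTrialState N L) :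
    periodicGroundStateEnergy v N L + ENNReal.ofReal (s * |∫ X in cellN N L,
        (∑ i, 2 * Real.cos (2 * Real.pi / L * ∑ j, (n j : ℝ) * X i j)) * ‖Φ.ψ X‖ ^ 2|) ≤
      periodicEnergy v Φ + ENNReal.ofReal (5 * s ^ 2 * N / (2 * Real.pi * ‖(fun j => (n j : ℝ))‖ / L) ^ 2) := by
  have hq : 0 < (2 * Real.pi * ‖(fun j => (n j : ℝ))‖ / L) ^ 2 := pow_pos (kinf_pos hL hn) 2
  have h1 := free_chord_energy hL v hn hs Φ
  calc periodicGroundStateEnergy v N L + ENNReal.ofReal (s * |∫ X in cellN N L,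
        (∑ i, 2 * Real.cos (2 * Real.pi / L * ∑ j, (n j : ℝ) * X i j)) * ‖Φ.ψ X‖ ^ 2|)
      ≤ ENNReal.ofReal B + (periodicEnergy v Φ +
          ENNReal.ofReal (4 * s ^ 2 * N / (2 * Real.pi * ‖(fun j => (n j : ℝ))‖ / L) ^ 2)) :=
        add_le_add hE h1
    _ = periodicEnergy v Φ + ENNReal.ofReal (B + 4 * s ^ 2 * N / (2 * Real.pi * ‖(fun j => (n j : ℝ))‖ / L) ^ 2) := by
        rw [add_left_comm, ← ENNReal.ofReal_add hB (by positivity)]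
    _ ≤ periodicEnergy v Φ + ENNReal.ofReal (5 * s ^ 2 * N / (2 * Real.pi * ‖(fun j => (n j : ℝ))‖ / L) ^ 2) := by
        gcongr
        have h2 : B ≤ s ^ 2 * N / (2 * Real.pi * ‖(fun j => (n j : ℝ))‖ / L) ^ 2 := by
          rw [le_div_iff₀ hq]; exact hsB
        have e : 5 * s ^ 2 * N / (2 * Real.pi * ‖(fun j => (n j : ℝ))‖ / L) ^ 2 =
            s ^ 2 * N / (2 * Real.pi * ‖(fun j => (n j : ℝ))‖ / L) ^ 2 +
              4 * s ^ 2 * N / (2 * Real.pi * ‖(fun j => (n j : ℝ))‖ / L) ^ 2 := by ring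
        rw [e]
        linarith

/-- The same in the crux's format: under the ceiling, with `ρ b ≤ Λ k∞²` (particle regime w.r.t. the
stiffness `b ≥ 0`, any real `Λ`), the chord holds with `C = 5(1+Λ)` for all tilts `s² N ≥ B k∞²`. [folklore] -/
theorem chord_of_energy_ceiling_particle (hL : 0 < L) (v : ℝ → ℝ≥0∞) {n : Fin 3 → ℤ} (hn : n ≠ 0)
    {s B b Λ : ℝ} (hs : 0 ≤ s) (hB : 0 ≤ B) (hb : 0 ≤ b)
    (hE : periodicGroundStateEnergy v N L ≤ ENNReal.ofReal B)
    (hsB : B * (2 * Real.pi * ‖(fun j => (n j : ℝ))‖ / L) ^ 2 ≤ s ^ 2 * N)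
    (hpart : N / L ^ 3 * b ≤ Λ * (2 * Real.pi * ‖(fun j => (n j : ℝ))‖ / L) ^ 2)
    (Φ : PeriodicTrialState N L) :
    periodicGroundStateEnergy v N L + ENNReal.ofReal (s * |∫ X in cellN N L,
        (∑ i, 2 * Real.cos (2 * Real.pi / L * ∑ j, (n j : ℝ) * X i j)) * ‖Φ.ψ X‖ ^ 2|) ≤
      periodicEnergy v Φ + ENNReal.ofReal (5 * (1 + Λ) * s ^ 2 * N /
        ((2 * Real.pi * ‖(fun j => (n j : ℝ))‖ / L) ^ 2 + N / L ^ 3 * b)) := by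
  refine (chord_of_energy_ceiling hL v hn hs hB hE hsB Φ).trans (add_le_add le_rfl (ENNReal.ofReal_le_ofReal ?_))
  have hq : 0 < (2 * Real.pi * ‖(fun j => (n j : ℝ))‖ / L) ^ 2 := pow_pos (kinf_pos hL hn) 2
  have hρb : 0 ≤ N / L ^ 3 * b := by positivity
  rw [div_le_div_iff₀ hq (by positivity)]
  have hsN : 0 ≤ s ^ 2 * N := by positivity
  nlinarith only [hpart, hsN, hq, hρb, mul_le_mul_of_nonneg_left hpart hsN]

end EnergyCeiling

/-! ## §16 Targets: the picked line's constitutive core S2 follows from the crux up to `t`-uniformity (generation 3) -/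

section CoreFromChord

/-! ### The constitutive core of the picked line follows from the crux (up to `t`-uniformity)

Line `force-balance-constitutive` (crux dir `Lines/…`, lead's `BECThomsonPrincipleDensityResponseDefs`):
`S1 ∧ S2 ∧ S3 ∧ S4 ⟹ crux` is kernel-checked there.  Conversely, the crux's chord at drive `2s` on a
sub-ground state gives the linear-response bound `m ≤ 4CsN/(k∞² + ρa)` (`sourceMean_le_of_holdsWith`:
no stationarity, no `s ≤ ρa`, no sign of `m` needed), hence (`coreIneq_of_holdsWith`, via the landed
`coreIneq_of_lr_bound`) `CoreIneq w a M ρ₀ κ (4C·max κ (3/4)) N₀` for every real `κ`.  So S2 for BOUNDED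
`v` is implied by the crux (`constitutiveCore_bounded_of_densityResponse`), and for every admissible `v`
and every truncation height `t` with `a(v_t) ≠ 0` the crux gives `CoreIneq (v_t) a(v) …` with constants
depending on `t` (`coreIneq_trunc_of_densityResponse`): THE ONLY CONTENT OF S2 BEYOND THE CRUX IS THE
UNIFORMITY OF `(ρ₀, C₁, N₀)` IN `t ≥ t₀` for unbounded (hard-core) envelopes. -/

open Summit.AtomisticToContinuum.BoseEinsteinCondensation.Cruxes.DensityResponse.ForceBalanceConstitutive
  (CoreIneq sourceMean effNumber stressWave kineticStressWave virialWave ksq ksupSq ksq_le_three_mul_ksupSq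
    effNumber_nonneg truncPotential_eq_self_of_le isRepulsiveFiniteRange_truncPotential)
open Summit.AtomisticToContinuum.BoseEinsteinCondensation.Theorems.DensityResponse.Negative.ForceBalanceStubs
  (coreIneq_of_lr_bound)

/-- **The chord on a sub-ground state is a linear-response bound.** If the crux's conclusion holds for
`w` with stiffness `a ≥ 0` and constant `C`, then every finite-energy state with
`E_w(Φ) − s·m(Φ) ≤ E₀(w)` (sub-ground at drive `s ≥ 0`) has density wave `m(Φ) ≤ 4CsN/(k∞² + ρa)`
(chord at tilt `2s`; at `s = 0` the chord at all small tilts forces `m ≤ 0`). [folklore] -/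
theorem sourceMean_le_of_holdsWith {w : ℝ → ℝ≥0∞} {a M ρ₀ C : ℝ} {N₀ : ℕ} (ha : 0 ≤ a) (hC : 0 ≤ C)
    (h : HoldsWith w a M ρ₀ C N₀) {N : ℕ} (hN : N₀ ≤ N) {L : ℝ} (hL : 0 < L)
    (hNL : (N : ℝ) ≤ ρ₀ * L ^ 3) {n : Fin 3 → ℤ} (hn : n ≠ 0)
    (hwin : 2 * Real.pi * ‖(fun j => (n j : ℝ))‖ / L ≤ M * Real.sqrt (N / L ^ 3)) {s : ℝ} (hs : 0 ≤ s)
    (Φ : PeriodicTrialState N L) (hE : periodicEnergy w Φ ≠ ⊤)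
    (hsub : (periodicEnergy w Φ).toReal - s * sourceMean n Φ ≤ (periodicGroundStateEnergy w N L).toReal) :
    sourceMean n Φ ≤ 4 * C * s * N / ((2 * Real.pi * ‖(fun j => (n j : ℝ))‖ / L) ^ 2 + N / L ^ 3 * a) := by
  set D : ℝ := (2 * Real.pi * ‖(fun j => (n j : ℝ))‖ / L) ^ 2 + N / L ^ 3 * a with hD
  have hq : 0 < (2 * Real.pi * ‖(fun j => (n j : ℝ))‖ / L) ^ 2 := pow_pos (kinf_pos hL hn) 2
  have hDpos : 0 < D := by rw [hD]; positivity
  have hE₀ : periodicGroundStateEnergy w N L ≠ ⊤ :=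
    ne_top_of_le_ne_top hE (periodicGroundStateEnergy_le w Φ)
  -- the chord at a tilt `t ≥ 0`, in real numbers
  have chord : ∀ t : ℝ, 0 ≤ t → t * |sourceMean n Φ| ≤
      (periodicEnergy w Φ).toReal - (periodicGroundStateEnergy w N L).toReal + C * t ^ 2 * N / D := by
    intro t ht
    have key := h N hN L hL hNL n hn hwin t ht Φ
    have h1 : (periodicGroundStateEnergy w N L + ENNReal.ofReal (t * |sourceMean n Φ|)).toReal =
        (periodicGroundStateEnergy w N L).toReal + t * |sourceMean n Φ| := by
      rw [ENNReal.toReal_add hE₀ ENNReal.ofReal_ne_top, ENNReal.toReal_ofReal (by positivity)]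
    have h2 : (periodicEnergy w Φ + ENNReal.ofReal (C * t ^ 2 * N / D)).toReal =
        (periodicEnergy w Φ).toReal + C * t ^ 2 * N / D := by
      rw [ENNReal.toReal_add hE ENNReal.ofReal_ne_top, ENNReal.toReal_ofReal (by positivity)]
    have h3 := ENNReal.toReal_mono (ENNReal.add_ne_top.2 ⟨hE, ENNReal.ofReal_ne_top⟩) key
    change (periodicGroundStateEnergy w N L + ENNReal.ofReal (t * |sourceMean n Φ|)).toReal ≤
      (periodicEnergy w Φ + ENNReal.ofReal (C * t ^ 2 * N / D)).toReal at h3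
    rw [h1, h2] at h3
    linarith
  have hmabs : sourceMean n Φ ≤ |sourceMean n Φ| := le_abs_self _
  rcases hs.lt_or_eq with hspos | hs0
  · -- tilt `2s`: `2s|m| ≤ sm + 4Cs²N/D`
    have c2 := chord (2 * s) (by positivity)
    have h4 : s * |sourceMean n Φ| ≤ C * (2 * s) ^ 2 * N / D := by nlinarith
    rw [le_div_iff₀ hDpos]
    rw [le_div_iff₀ hDpos] at h4
    have h5 : |sourceMean n Φ| * D ≤ 4 * C * s * N := by
      refine le_of_mul_le_mul_left ?_ hspos
      have e : s * (4 * C * s * N) = C * (2 * s) ^ 2 * N := by ring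
      rw [e, ← mul_assoc]
      exact h4
    exact (mul_le_mul_of_nonneg_right hmabs hDpos.le).trans h5
  · -- `s = 0`: `t|m| ≤ Ct²N/D` for all `t ≥ 0` forces `|m| ≤ 0`
    subst hs0
    have hRHS : 4 * C * (0 : ℝ) * N / D = 0 := by simp
    rw [hRHS]
    by_contra hmpos
    push Not at hmpos
    have hmp : 0 < |sourceMean n Φ| := hmpos.trans_le hmabs
    have hsub0 : (periodicEnergy w Φ).toReal - (periodicGroundStateEnergy w N L).toReal ≤ 0 := by
      simpa using hsub
    -- tilt `t = |m| D/(C N + 1) > 0`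
    obtain ⟨t, ht_def⟩ : ∃ t : ℝ, t = |sourceMean n Φ| * D / (2 * (C * N + 1)) := ⟨_, rfl⟩
    have hCN : 0 ≤ C * N := by positivity
    have htpos : 0 < t := by rw [ht_def]; positivity
    have c1 := chord t htpos.le
    have h5 : t * |sourceMean n Φ| ≤ C * t ^ 2 * N / D := by linarith
    rw [le_div_iff₀ hDpos] at h5
    -- `t |m| D ≤ C t² N` with `t = |m|D/(2(CN+1))`: `|m| D ≤ C N t = C N |m| D /(2(CN+1)) < |m| D`
    have h6 : |sourceMean n Φ| * D ≤ C * N * t := by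
      have := h5
      nlinarith
    rw [ht_def] at h6
    have h7 : |sourceMean n Φ| * D * (2 * (C * N + 1)) ≤ C * N * (|sourceMean n Φ| * D) := by
      have h8 : C * N * (|sourceMean n Φ| * D / (2 * (C * N + 1))) = C * N * (|sourceMean n Φ| * D) / (2 * (C * N + 1)) := by
        ring
      rw [h8, le_div_iff₀ (by positivity)] at h6
      exact h6
    nlinarith [mul_pos hmp hDpos]

/-- **The crux's conclusion implies the constitutive core** `CoreIneq w a M ρ₀ κ (4C·max κ (3/4)) N₀` for
every `κ ≥ 0` (stationarity turns `K + I` into `sN_eff − (|k|²/4)m`, `|k|² ≤ 3k∞²`). [folklore] -/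
theorem coreIneq_of_holdsWith {w : ℝ → ℝ≥0∞} {a M ρ₀ C : ℝ} (κ : ℝ) {N₀ : ℕ} (ha : 0 ≤ a) (hC : 0 ≤ C)
    (h : HoldsWith w a M ρ₀ C N₀) : CoreIneq w a M ρ₀ κ (4 * C * max κ (3 / 4)) N₀ := by
  refine coreIneq_of_lr_bound fun N hN L hL hNL n hn hwin s hs _ Φ hE _ hsub hm => ?_
  have hmle := sourceMean_le_of_holdsWith ha hC h hN hL hNL hn hwin hs Φ hE hsub
  set D : ℝ := (2 * Real.pi * ‖(fun j => (n j : ℝ))‖ / L) ^ 2 + N / L ^ 3 * a with hD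
  have hq : 0 < (2 * Real.pi * ‖(fun j => (n j : ℝ))‖ / L) ^ 2 := pow_pos (kinf_pos hL hn) 2
  have hDpos : 0 < D := by rw [hD]; positivity
  have hq3 : ksq L n ≤ 3 * (2 * Real.pi * ‖(fun j => (n j : ℝ))‖ / L) ^ 2 := ksq_le_three_mul_ksupSq L n
  have hρa : 0 ≤ (N : ℝ) / L ^ 3 * a := by positivity
  have h1 : κ * (N / L ^ 3 * a) + ksq L n / 4 ≤ max κ (3 / 4) * D := by
    have hκ' : κ * (N / L ^ 3 * a) ≤ max κ (3 / 4) * (N / L ^ 3 * a) :=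
      mul_le_mul_of_nonneg_right (le_max_left _ _) hρa
    have h34 : 3 / 4 * (2 * Real.pi * ‖(fun j => (n j : ℝ))‖ / L) ^ 2 ≤
        max κ (3 / 4) * (2 * Real.pi * ‖(fun j => (n j : ℝ))‖ / L) ^ 2 :=
      mul_le_mul_of_nonneg_right (le_max_right _ _) hq.le
    rw [hD]
    linarith
  calc (κ * (N / L ^ 3 * a) + ksq L n / 4) * sourceMean n Φ ≤ max κ (3 / 4) * D * sourceMean n Φ :=
        mul_le_mul_of_nonneg_right h1 hm
    _ ≤ max κ (3 / 4) * D * (4 * C * s * N / D) := mul_le_mul_of_nonneg_left hmle (by positivity)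
    _ = 4 * C * max κ (3 / 4) * s * N := by field_simp

/-- **S2 for bounded potentials follows from the crux** (with `κ = 1`, `C₁ = 4C`, `t₀ = ⌈B⌉`, where the
truncations are `v` itself). [folklore] -/
theorem constitutiveCore_bounded_of_densityResponse (h : DensityResponse) (v : ℝ → ℝ≥0∞)
    (hv : IsRepulsiveFiniteRange v) (hB : ∃ B : ℝ, ∀ r, v r ≤ ENNReal.ofReal B) (M : ℝ) (hM : 0 < M) :
    ∃ ρ₀ κ C₁ : ℝ, 0 < ρ₀ ∧ 0 < κ ∧ 0 < C₁ ∧ ∃ N₀ t₀ : ℕ, ∀ t : ℕ, t₀ ≤ t →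
      CoreIneq (truncPotential v t) (scatteringLength v).toReal M ρ₀ κ C₁ N₀ := by
  obtain ⟨ρ₀, C, hρ₀, hC, N₀, hH⟩ := h v hv M hM
  have hH' : HoldsWith v (scatteringLength v).toReal M ρ₀ C N₀ := hH
  obtain ⟨B, hB⟩ := hB
  refine ⟨ρ₀, 1, 4 * C * max 1 (3 / 4), hρ₀, one_pos, by positivity, N₀, ⌈B⌉₊, fun t ht => ?_⟩
  rw [truncPotential_eq_self_of_le hB (Nat.ceil_le.mp ht)]
  exact coreIneq_of_holdsWith 1 ENNReal.toReal_nonneg hC.le hH'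

/-- **For every admissible `v` and truncation height `t` with `a(v_t) ≠ 0` the crux gives
`CoreIneq (v_t) a(v) M ρ₀ κ C₁ N₀` with `t`-DEPENDENT constants** (crux for `v_t`, stiffness transfer
`a(v_t) ↦ a(v)` by `HoldsWith.stiffness`, `a(v_t) ≤ a(v) < ∞`).  The uniformity in `t ≥ t₀` demanded
by S2 for unbounded `v` is the only part of S2 not implied by the crux. [folklore] -/
theorem coreIneq_trunc_of_densityResponse (h : DensityResponse) (v : ℝ → ℝ≥0∞)
    (hv : IsRepulsiveFiniteRange v) (M : ℝ) (hM : 0 < M) (t : ℕ)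
    (hat : scatteringLength (truncPotential v t) ≠ 0) (κ : ℝ) :
    ∃ ρ₀ C₁ : ℝ, 0 < ρ₀ ∧ 0 < C₁ ∧ ∃ N₀ : ℕ,
      CoreIneq (truncPotential v t) (scatteringLength v).toReal M ρ₀ κ C₁ N₀ := by
  have hvt : IsRepulsiveFiniteRange (truncPotential v t) := isRepulsiveFiniteRange_truncPotential hv t
  obtain ⟨ρ₀, C, hρ₀, hC, N₀, hH⟩ := h _ hvt M hM
  have hH' : HoldsWith (truncPotential v t) (scatteringLength (truncPotential v t)).toReal M ρ₀ C N₀ := hH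
  obtain ⟨R₀, hR₀⟩ := hv.2
  obtain ⟨R₁, hR₁⟩ := hvt.2
  have hat_top : scatteringLength (truncPotential v t) ≠ ⊤ := scatteringLength_ne_top_of_finiteRange hR₁
  have ha_top : scatteringLength v ≠ ⊤ := scatteringLength_ne_top_of_finiteRange hR₀
  have hat_pos : 0 < (scatteringLength (truncPotential v t)).toReal := ENNReal.toReal_pos hat hat_top
  have hle : scatteringLength (truncPotential v t) ≤ scatteringLength v :=
    scatteringLength_mono fun r => truncPotential_le v t r
  have ha_pos : 0 < (scatteringLength v).toReal :=
    hat_pos.trans_le (ENNReal.toReal_mono ha_top hle)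
  have hH2 := hH'.stiffness hat_pos ha_pos hC.le
  exact ⟨ρ₀, 4 * (C * max 1 ((scatteringLength v).toReal / (scatteringLength (truncPotential v t)).toReal)) *
      max κ (3 / 4), hρ₀, by positivity, N₀, coreIneq_of_holdsWith κ ha_pos.le (by positivity) hH2⟩

end CoreFromChord

/-! ## §17 Tightness `C ≥ 2` for every soft potential: the interaction of the test state is `O(∫v/M²)` (generation 3) -/

section ProdInteraction

variable {L : ℝ}

/-- **One pair against a product density** (Fubini on `cell^{m+2} ≅ cell × cell^{m+1}` at slot `0`,
translation invariance `∫_cell v^per(x − y) dx = ∫_{ℝ³} v`): if `0 ≤ g ≤ B` on the cell and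
`∫_cell g = 1` then `∫_{cell^{m+2}} v^per(x₀ − x₁) ∏ᵢ g(xᵢ) dX ≤ B · ∫_{ℝ³} v(|y|) dy`. [folklore] -/
theorem lintegral_cellN_pair_prod_le {m : ℕ} (hL : 0 < L) {v : ℝ → ℝ≥0∞} (hv : Measurable v)
    {g : Space → ℝ≥0∞} (hg : Measurable g) {B : ℝ≥0∞} (hgB : ∀ x, g x ≤ B)
    (hg1 : ∫⁻ x in cell L, g x = 1) :
    ∫⁻ X in cellN (m + 2) L, periodizedPotential v L (X 0 - X 1) * ∏ i, g (X i) ≤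
      B * ∫⁻ y : Space, v ‖y‖ := by
  -- split off the factor `g(x₀) ≤ B`
  have hpt : ∀ X : Config (m + 2), periodizedPotential v L (X 0 - X 1) * ∏ i, g (X i) ≤
      B * (periodizedPotential v L (X 0 - X 1) * ∏ i : Fin (m + 1), g (X i.succ)) := by
    intro X
    rw [Fin.prod_univ_succ]
    calc periodizedPotential v L (X 0 - X 1) * (g (X 0) * ∏ i : Fin (m + 1), g (X i.succ))
        = g (X 0) * (periodizedPotential v L (X 0 - X 1) * ∏ i : Fin (m + 1), g (X i.succ)) := by ring
      _ ≤ B * (periodizedPotential v L (X 0 - X 1) * ∏ i : Fin (m + 1), g (X i.succ)) :=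
          mul_le_mul' (hgB _) le_rfl
  refine (lintegral_mono hpt).trans ?_
  have hF : Measurable fun X : Config (m + 2) =>
      periodizedPotential v L (X 0 - X 1) * ∏ i : Fin (m + 1), g (X i.succ) :=
    ((measurable_periodizedPotential hv L).comp ((measurable_pi_apply 0).sub (measurable_pi_apply 1))).mul
      (Finset.measurable_prod _ fun i _ => hg.comp (measurable_pi_apply _))
  rw [lintegral_const_mul _ hF]
  refine mul_le_mul' le_rfl ?_
  -- Fubini: `X = x₀ :: X'`
  have hmp := measurePreserving_piFinSuccAbove_cellN (n := m + 1) (0 : Fin (m + 2)) L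
  rw [← hmp.symm.lintegral_comp_emb (MeasurableEquiv.measurableEmbedding _)]
  have hsymm : ∀ z : Space × Config (m + 1),
      (MeasurableEquiv.piFinSuccAbove (fun _ : Fin (m + 2) => Space) 0).symm z = Fin.cons z.1 z.2 :=
    fun z => piFinSuccAbove_symm_apply_cons z.1 z.2
  simp only [hsymm]
  have h0 : ∀ z : Space × Config (m + 1), (Fin.cons z.1 z.2 : Config (m + 2)) 0 = z.1 := fun z => rfl
  have h1 : ∀ z : Space × Config (m + 1), (Fin.cons z.1 z.2 : Config (m + 2)) 1 = z.2 0 := fun z => rfl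
  have hs : ∀ (z : Space × Config (m + 1)) (i : Fin (m + 1)),
      (Fin.cons z.1 z.2 : Config (m + 2)) i.succ = z.2 i := fun z i => rfl
  simp only [h0, h1, hs]
  have hsub : Measurable fun z : Space × Config (m + 1) => z.1 - z.2 0 :=
    measurable_fst.sub ((measurable_pi_apply 0).comp measurable_snd)
  have hmeas : Measurable fun z : Space × Config (m + 1) =>
      periodizedPotential v L (z.1 - z.2 0) * ∏ i : Fin (m + 1), g (z.2 i) :=
    ((measurable_periodizedPotential hv L).comp hsub).mul
      (Finset.measurable_prod _ fun i _ => hg.comp ((measurable_pi_apply i).comp measurable_snd))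
  rw [lintegral_prod_symm _ hmeas.aemeasurable]
  -- inner integral in `x₀`
  have hinner : ∀ X' : Config (m + 1),
      ∫⁻ x in cell L, periodizedPotential v L (x - X' 0) * ∏ i : Fin (m + 1), g (X' i) =
        (∫⁻ y : Space, v ‖y‖) * ∏ i : Fin (m + 1), g (X' i) := by
    intro X'
    rw [lintegral_mul_const (f := fun x => periodizedPotential v L (x - X' 0)) _
        (by exact (measurable_periodizedPotential hv L).comp (measurable_id.sub_const _)),
      lintegral_cell_periodizedPotential_sub hL hv (X' 0)]
  simp only [hinner]
  rw [lintegral_const_mul (f := fun X' : Config (m + 1) => ∏ i : Fin (m + 1), g (X' i)) _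
      (by exact Finset.measurable_prod _ fun i _ => hg.comp (measurable_pi_apply i)),
    volume_restrict_cellN,
    Literature.Probability.Distributions.lintegral_fin_nat_prod_eq_prod _ (fun _ x => g x) fun _ => hg]
  simp [hg1]

/-- **Interaction energy of a product state**: for the `η`-modulated product state
`Φ_η = ∏ᵢ φ(xᵢ)` (`|φ|² ≤ c_η²(1+2|η|)²`), `∫ ∑_{i<j} v^per(xᵢ−xⱼ)|Φ_η|² ≤ N²·c_η²(1+2|η|)²·∫_{ℝ³} v`. [folklore] -/
theorem lintegral_interaction_prodStateη_le (η : ℝ) (N : ℕ) (hL : 0 < L) {v : ℝ → ℝ≥0∞} (hv : Measurable v) :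
    ∫⁻ X in cellN N L, periodicInteraction v L X * (‖(prodStateη η N hL).ψ X‖₊ : ℝ≥0∞) ^ 2 ≤
      (N : ℝ≥0∞) ^ 2 * ENNReal.ofReal ((cη η L * (1 + 2 * |η|)) ^ 2) * ∫⁻ y : Space, v ‖y‖ := by
  rcases Nat.lt_or_ge N 2 with hN | hN
  · -- `N ≤ 1`: no pairs
    have h0 : ∀ X : Config N, periodicInteraction v L X = 0 := by
      intro X
      unfold periodicInteraction
      refine Finset.sum_eq_zero fun i _ => Finset.sum_eq_zero fun j hj => ?_
      have hij := (Finset.mem_filter.1 hj).2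
      have : (j : ℕ) < N := j.isLt
      have : (i : ℕ) < (j : ℕ) := hij
      omega
    simp [h0]
  · obtain ⟨m, rfl⟩ : ∃ m, N = m + 2 := ⟨N - 2, by omega⟩
    set B : ℝ≥0∞ := ENNReal.ofReal ((cη η L * (1 + 2 * |η|)) ^ 2) with hB
    set g : Space → ℝ≥0∞ := fun x => (‖orbη η L x‖₊ : ℝ≥0∞) ^ 2 with hg_def
    have hg : Measurable g := measurable_orbη_sq η L
    have hgB : ∀ x, g x ≤ B := by
      intro x
      change ((‖orbη η L x‖₊ : ℝ≥0∞) ^ 2) ≤ ENNReal.ofReal ((cη η L * (1 + 2 * |η|)) ^ 2)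
      rw [ennnorm_sq_eq]
      exact ENNReal.ofReal_le_ofReal (pow_le_pow_left₀ (norm_nonneg _) (norm_orbη_le η hL x) 2)
    have hg1 : ∫⁻ x in cell L, g x = 1 := lintegral_cell_orbη_sq η hL
    -- the density is the symmetric product `∏ g(xᵢ)`
    have hdens : ∀ X : Config (m + 2), (‖(prodStateη η (m + 2) hL).ψ X‖₊ : ℝ≥0∞) ^ 2 = ∏ i, g (X i) := by
      intro X; rw [prodStateη_ψ, nnnorm_prodFunη_sq]
    simp_rw [hdens]
    have hG : ∀ (σ : Equiv.Perm (Fin (m + 2))) (X : Config (m + 2)), (∏ i, g ((X ∘ σ) i)) = ∏ i, g (X i) := by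
      intro σ X
      exact Equiv.prod_comp σ (fun i => g (X i))
    -- sum over pairs
    unfold periodicInteraction
    simp_rw [Finset.sum_mul]
    have hmeas : ∀ i j : Fin (m + 2), Measurable fun X : Config (m + 2) =>
        periodizedPotential v L (X i - X j) * ∏ l, g (X l) := fun i j =>
      ((measurable_periodizedPotential hv L).comp ((measurable_pi_apply i).sub (measurable_pi_apply j))).mul
        (Finset.measurable_prod _ fun l _ => hg.comp (measurable_pi_apply l))
    rw [lintegral_finsetSum _ fun i _ => Finset.measurable_sum _ fun j _ => hmeas i j]
    have hterm : ∀ i : Fin (m + 2), ∀ j ∈ Finset.univ.filter (fun j : Fin (m + 2) => i < j),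
        ∫⁻ X in cellN (m + 2) L, periodizedPotential v L (X i - X j) * ∏ l, g (X l) ≤
          B * ∫⁻ y : Space, v ‖y‖ := by
      intro i j hj
      have hij : i ≠ j := (Finset.mem_filter.1 hj).2.ne
      rw [lintegral_cellN_periodizedPotential_pair v L hG hij]
      exact lintegral_cellN_pair_prod_le hL hv hg hgB hg1
    calc ∑ i : Fin (m + 2), ∫⁻ X in cellN (m + 2) L,
          ∑ j ∈ Finset.univ.filter (fun j : Fin (m + 2) => i < j), periodizedPotential v L (X i - X j) * ∏ l, g (X l)
        = ∑ i : Fin (m + 2), ∑ j ∈ Finset.univ.filter (fun j : Fin (m + 2) => i < j),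
            ∫⁻ X in cellN (m + 2) L, periodizedPotential v L (X i - X j) * ∏ l, g (X l) := by
          refine Finset.sum_congr rfl fun i _ => ?_
          rw [lintegral_finsetSum _ fun j _ => hmeas i j]
      _ ≤ ∑ i : Fin (m + 2), ∑ _j ∈ Finset.univ.filter (fun j : Fin (m + 2) => i < j), B * ∫⁻ y : Space, v ‖y‖ :=
          Finset.sum_le_sum fun i _ => Finset.sum_le_sum (hterm i)
      _ = (pairCount (m + 2) : ℝ≥0∞) * (B * ∫⁻ y : Space, v ‖y‖) := by
          simp only [Finset.sum_const, nsmul_eq_mul, pairCount, Nat.cast_sum]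
          rw [Finset.sum_mul]
      _ ≤ ((m + 2 : ℕ) : ℝ≥0∞) ^ 2 * (B * ∫⁻ y : Space, v ‖y‖) := by
          gcongr
          exact_mod_cast pairCount_le (m + 2)
      _ = ((m + 2 : ℕ) : ℝ≥0∞) ^ 2 * B * ∫⁻ y : Space, v ‖y‖ := by rw [mul_assoc]

/-- **Energy of the `η`-product state under `v`**: kinetic part exact (`periodicEnergy_zero_prodStateη`)
plus the product-state interaction bound. [folklore] -/
theorem periodicEnergy_prodStateη_le (η : ℝ) (N : ℕ) (hL : 0 < L) {v : ℝ → ℝ≥0∞} (hv : Measurable v) :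
    periodicEnergy v (prodStateη η N hL) ≤
      ENNReal.ofReal (N * (2 * η ^ 2 * (2 * Real.pi / L) ^ 2 / (1 + 2 * η ^ 2))) +
        (N : ℝ≥0∞) ^ 2 * ENNReal.ofReal ((cη η L * (1 + 2 * |η|)) ^ 2) * ∫⁻ y : Space, v ‖y‖ := by
  have hmeas : Measurable fun X : Config N =>
      periodicInteraction v L X * (‖(prodStateη η N hL).ψ X‖₊ : ℝ≥0∞) ^ 2 :=
    (measurable_periodicInteraction hv L).mul
      (((prodStateη η N hL).contDiff.continuous.measurable.nnnorm.coe_nnreal_ennreal).pow_const 2)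
  unfold periodicEnergy
  rw [lintegral_add_right _ hmeas, ← periodicEnergy_zero_eq, periodicEnergy_zero_prodStateη]
  exact add_le_add le_rfl (lintegral_interaction_prodStateη_le η N hL hv)

end ProdInteraction

section TightnessInteracting

variable {L : ℝ}

/-- **TIGHTNESS FOR EVERY SOFT POTENTIAL.** If the crux's conclusion holds for a measurable `v` with
`V = ∫_{ℝ³} v(|y|) dy < ∞`, a stiffness `b ≥ 0` and constants `(M, ρ₀, C, N₀)`, then for every `η > 0`
`2 ≤ C·(1 + 2η²)·(1 + (1+2η)²V/(2η²M²))`.  Test: the `η`-product states at the GP corner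
`L = M²N/(4π²)` (`n = e₀`, window equality, `N` large for diluteness), where `ρb/k² = b/M²` only helps
and the interaction energy of the test state is at most `N²‖φ‖∞²V = (1+2η)²V/(2η²M²) ×` its kinetic
energy (`periodicEnergy_prodStateη_le`); the optimal tilt then forces the displayed bound exactly as in
the free case (`two_le_of_holdsFree`, which is `V = 0`, `η → 0`).  Repulsion cannot push the constant
below the free value `2` at the GP corner. [folklore] -/
theorem two_le_of_holdsWith_soft {v : ℝ → ℝ≥0∞} (hv : Measurable v) (hV : (∫⁻ y : Space, v ‖y‖) ≠ ⊤)
    {b M ρ₀ C : ℝ} {N₀ : ℕ} (hb : 0 ≤ b) (hM : 0 < M) (hρ₀ : 0 < ρ₀) (hC : 0 < C)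
    (h : HoldsWith v b M ρ₀ C N₀) {η : ℝ} (hη : 0 < η) :
    2 ≤ C * (1 + 2 * η ^ 2) * (1 + (1 + 2 * η) ^ 2 * (∫⁻ y : Space, v ‖y‖).toReal / (2 * η ^ 2 * M ^ 2)) := by
  have hπ := Real.pi_pos
  set Vr : ℝ := (∫⁻ y : Space, v ‖y‖).toReal with hVr
  have hVr0 : 0 ≤ Vr := ENNReal.toReal_nonneg
  have hVof : (∫⁻ y : Space, v ‖y‖) = ENNReal.ofReal Vr := (ENNReal.ofReal_toReal hV).symm
  -- a large particle number: window equality `L = M²N/(4π²)` and diluteness `N ≤ ρ₀L³`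
  obtain ⟨N, hN0, hN1, hNbig⟩ : ∃ N : ℕ, N₀ ≤ N ∧ 1 ≤ N ∧ (4 * Real.pi ^ 2) ^ 3 / (ρ₀ * M ^ 6) ≤ N := by
    obtain ⟨m, hm⟩ := exists_nat_ge ((4 * Real.pi ^ 2) ^ 3 / (ρ₀ * M ^ 6))
    exact ⟨max (max N₀ 1) m, (le_max_left _ _).trans (le_max_left _ _),
      (le_max_right _ _).trans (le_max_left _ _), hm.trans (by exact_mod_cast le_max_right _ _)⟩
  have hN1r : (1 : ℝ) ≤ N := by exact_mod_cast hN1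
  have hNpos : (0 : ℝ) < N := by linarith
  obtain ⟨L, hL_def⟩ : ∃ L : ℝ, L = M ^ 2 * N / (4 * Real.pi ^ 2) := ⟨_, rfl⟩
  have hL : 0 < L := by rw [hL_def]; positivity
  have hdil : (N : ℝ) ≤ ρ₀ * L ^ 3 := by
    rw [hL_def]
    rw [div_le_iff₀ (by positivity)] at hNbig
    have key : (N : ℝ) * (4 * Real.pi ^ 2) ^ 3 ≤ ρ₀ * (M ^ 2 * N) ^ 3 := by
      calc (N : ℝ) * (4 * Real.pi ^ 2) ^ 3 ≤ N * (N * (ρ₀ * M ^ 6)) := by gcongr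
        _ ≤ N * (N * (ρ₀ * M ^ 6)) * N := le_mul_of_one_le_right (by positivity) hN1r
        _ = ρ₀ * (M ^ 2 * N) ^ 3 := by ring
    rw [div_pow, mul_div_assoc', le_div_iff₀ (by positivity)]
    exact key
  -- the mode `n = e₀`
  obtain ⟨n, hn_def⟩ : ∃ n : Fin 3 → ℤ, n = Pi.single 0 1 := ⟨_, rfl⟩
  have hn : n ≠ 0 := by
    intro h0; have := congr_fun h0 0; simp [hn_def] at this
  have hnorm : ‖(fun j => (n j : ℝ))‖ = 1 := by
    have : (fun j => (n j : ℝ)) = Pi.single (0 : Fin 3) (1 : ℝ) := by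
      funext j; simp only [hn_def, Pi.single_apply]; split_ifs <;> simp
    rw [this, Pi.norm_single, norm_one]
  have hphase : ∀ x : Space, 2 * Real.pi / L * ∑ j, (n j : ℝ) * x j = θL L x := by
    intro x; simp [hn_def, Pi.single_apply, θL]
  have hwin : 2 * Real.pi * ‖(fun j => (n j : ℝ))‖ / L ≤ M * Real.sqrt (N / L ^ 3) := by
    rw [hnorm, mul_one]
    have hsq : (2 * Real.pi / L) ^ 2 = M ^ 2 * (N / L ^ 3) := by
      rw [hL_def]; field_simp; ring
    have : 2 * Real.pi / L = M * Real.sqrt (N / L ^ 3) := by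
      rw [← Real.sqrt_sq (by positivity : (0 : ℝ) ≤ 2 * Real.pi / L), hsq,
        Real.sqrt_mul (sq_nonneg _), Real.sqrt_sq hM.le]
    exact this.le
  -- quantities
  obtain ⟨q, hq_def⟩ : ∃ q : ℝ, q = (2 * Real.pi / L) ^ 2 := ⟨_, rfl⟩
  have hq : 0 < q := by rw [hq_def]; positivity
  have hqL : q * L ^ 2 = 4 * Real.pi ^ 2 := by rw [hq_def]; field_simp; ring
  have hNL3 : (N : ℝ) / L ^ 3 = q / M ^ 2 := by
    rw [div_eq_div_iff (by positivity) (by positivity), hq_def, hL_def]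
    field_simp
    ring
  obtain ⟨D, hD_def⟩ : ∃ D : ℝ, D = q + N / L ^ 3 * b := ⟨_, rfl⟩
  have hqD : q ≤ D := by
    have : 0 ≤ (N : ℝ) / L ^ 3 * b := by positivity
    rw [hD_def]; linarith only [this]
  have hD : 0 < D := hq.trans_le hqD
  obtain ⟨A, hA_def⟩ : ∃ A : ℝ, A = N * (4 * η / (1 + 2 * η ^ 2)) := ⟨_, rfl⟩
  have hA0 : 0 < A := by rw [hA_def]; positivity
  obtain ⟨T, hT_def⟩ : ∃ T : ℝ, T = N * (2 * η ^ 2 * (2 * Real.pi / L) ^ 2 / (1 + 2 * η ^ 2)) := ⟨_, rfl⟩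
  have hT0 : 0 ≤ T := by rw [hT_def]; positivity
  obtain ⟨J, hJ_def⟩ : ∃ J : ℝ, J = (N : ℝ) ^ 2 * (cη η L * (1 + 2 * |η|)) ^ 2 * Vr := ⟨_, rfl⟩
  have hJ0 : 0 ≤ J := by rw [hJ_def]; positivity
  obtain ⟨s, hs_def⟩ : ∃ s : ℝ, s = A * D / (2 * C * N) := ⟨_, rfl⟩
  have hs : 0 ≤ s := by rw [hs_def]; positivity
  -- the test
  have key := h N hN0 L hL hdil n hn hwin s hs (prodStateη η N hL)
  have hsrc : ∫ X in cellN N L, (∑ i, 2 * Real.cos (2 * Real.pi / L * ∑ j, (n j : ℝ) * X i j)) *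
      ‖(prodStateη η N hL).ψ X‖ ^ 2 = A := by
    simp_rw [hphase]; rw [hA_def]; exact source_prodStateη η N hL
  have hden : (2 * Real.pi * ‖(fun j => (n j : ℝ))‖ / L) ^ 2 + N / L ^ 3 * b = D := by
    rw [hnorm, mul_one, hD_def, hq_def]
  have hE : periodicEnergy v (prodStateη η N hL) ≤ ENNReal.ofReal (T + J) := by
    refine (periodicEnergy_prodStateη_le η N hL hv).trans (le_of_eq ?_)
    rw [← hT_def, hVof, hJ_def, ENNReal.ofReal_add hT0 (by positivity),
      ENNReal.ofReal_mul (by positivity), ENNReal.ofReal_mul (by positivity), ENNReal.ofReal_pow (Nat.cast_nonneg _),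
      ENNReal.ofReal_natCast]
  rw [hsrc, hden, abs_of_pos hA0] at key
  have key2 : ENNReal.ofReal (s * A) ≤ ENNReal.ofReal (T + J + C * s ^ 2 * N / D) := by
    calc ENNReal.ofReal (s * A) ≤ periodicGroundStateEnergy v N L + ENNReal.ofReal (s * A) := le_add_self
      _ ≤ periodicEnergy v (prodStateη η N hL) + ENNReal.ofReal (C * s ^ 2 * N / D) := key
      _ ≤ ENNReal.ofReal (T + J) + ENNReal.ofReal (C * s ^ 2 * N / D) := add_le_add hE le_rfl
      _ = ENNReal.ofReal (T + J + C * s ^ 2 * N / D) := by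
          rw [← ENNReal.ofReal_add (by positivity) (by positivity)]
  rw [ENNReal.ofReal_le_ofReal_iff (by positivity)] at key2
  -- `sA − Cs²N/D = A²D/(4CN) ≥ A²q/(4CN)`
  have h1 : s * A - C * s ^ 2 * N / D = A ^ 2 * D / (4 * C * N) := by
    rw [hs_def]; field_simp; ring
  have h2 : A ^ 2 * q / (4 * C * N) ≤ T + J := by
    have : A ^ 2 * q / (4 * C * N) ≤ A ^ 2 * D / (4 * C * N) := by gcongr
    linarith
  have hr : 0 < 1 + 2 * η ^ 2 := by positivity
  -- everything is a multiple of `N q`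
  have hcη : cη η L ^ 2 = 1 / ((1 + 2 * η ^ 2) * L ^ 3) := cη_sq η hL
  have e1 : A ^ 2 * q / (4 * C * N) = N * q * (4 * η ^ 2 / (C * (1 + 2 * η ^ 2) ^ 2)) := by
    rw [hA_def, div_eq_iff (by positivity)]
    field_simp
  have e2 : T = N * q * (2 * η ^ 2 / (1 + 2 * η ^ 2)) := by
    rw [hT_def, ← hq_def]; ring
  have e3 : J = N * q * ((1 + 2 * η) ^ 2 * Vr / (M ^ 2 * (1 + 2 * η ^ 2))) := by
    rw [hJ_def, abs_of_pos hη, mul_pow, hcη]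
    have : (N : ℝ) ^ 2 * (1 / ((1 + 2 * η ^ 2) * L ^ 3)) = N * (N / L ^ 3) / (1 + 2 * η ^ 2) := by
      rw [eq_div_iff hr.ne']
      field_simp
    rw [show (N : ℝ) ^ 2 * (1 / ((1 + 2 * η ^ 2) * L ^ 3) * (1 + 2 * η) ^ 2) * Vr =
        (N : ℝ) ^ 2 * (1 / ((1 + 2 * η ^ 2) * L ^ 3)) * ((1 + 2 * η) ^ 2 * Vr) by ring, this, hNL3]
    field_simp
  rw [e1, e2, e3] at h2
  have hNq : 0 < (N : ℝ) * q := mul_pos hNpos hq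
  have h3 : 4 * η ^ 2 / (C * (1 + 2 * η ^ 2) ^ 2) ≤
      2 * η ^ 2 / (1 + 2 * η ^ 2) + (1 + 2 * η) ^ 2 * Vr / (M ^ 2 * (1 + 2 * η ^ 2)) := by
    have := h2
    rw [← mul_add] at this
    exact le_of_mul_le_mul_left this hNq
  -- clear denominators
  have hM2 : 0 < M ^ 2 := by positivity
  have hη2 : 0 < η ^ 2 := by positivity
  set t : ℝ := (1 + 2 * η) ^ 2 * Vr with ht
  have ht0 : 0 ≤ t := by positivity
  have h4 : 4 * η ^ 2 * M ^ 2 ≤ C * (1 + 2 * η ^ 2) * (2 * η ^ 2 * M ^ 2 + t) := by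
    have e4 : 2 * η ^ 2 / (1 + 2 * η ^ 2) + t / (M ^ 2 * (1 + 2 * η ^ 2)) =
        (2 * η ^ 2 * M ^ 2 + t) / (M ^ 2 * (1 + 2 * η ^ 2)) := by
      field_simp
    rw [e4, div_le_div_iff₀ (by positivity) (by positivity)] at h3
    -- h3 : 4η² (M²(1+2η²)) ≤ (2η²M² + t) (C (1+2η²)²)
    have h5 : 4 * η ^ 2 * M ^ 2 * (1 + 2 * η ^ 2) ≤
        C * (1 + 2 * η ^ 2) * (2 * η ^ 2 * M ^ 2 + t) * (1 + 2 * η ^ 2) := by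
      have e6 : 4 * η ^ 2 * M ^ 2 * (1 + 2 * η ^ 2) = 4 * η ^ 2 * (M ^ 2 * (1 + 2 * η ^ 2)) := by ring
      have e7 : C * (1 + 2 * η ^ 2) * (2 * η ^ 2 * M ^ 2 + t) * (1 + 2 * η ^ 2) =
          (2 * η ^ 2 * M ^ 2 + t) * (C * (1 + 2 * η ^ 2) ^ 2) := by ring
      rw [e6, e7]
      exact h3
    exact le_of_mul_le_mul_right h5 hr
  have e5 : C * (1 + 2 * η ^ 2) * (1 + t / (2 * η ^ 2 * M ^ 2)) =
      C * (1 + 2 * η ^ 2) * (2 * η ^ 2 * M ^ 2 + t) / (2 * η ^ 2 * M ^ 2) := by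
    field_simp
  rw [e5, le_div_iff₀ (by positivity)]
  linarith only [h4]

/-- **A WINDOW-UNIFORM CONSTANT IS AT LEAST `2` FOR EVERY SOFT POTENTIAL.** If one constant `C` serves
all windows `M` (with `ρ₀, N₀` allowed to depend on `M`), then `C ≥ 2` — for every measurable
repulsive `v` with `∫ v < ∞`, not only for the free gas (`two_le_of_holdsFree`). [folklore] -/
theorem two_le_of_holdsWith_forall_window {v : ℝ → ℝ≥0∞} (hv : Measurable v)
    (hV : (∫⁻ y : Space, v ‖y‖) ≠ ⊤) {b C : ℝ} (hb : 0 ≤ b) (hC : 0 < C)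
    (h : ∀ M : ℝ, 0 < M → ∃ ρ₀ : ℝ, 0 < ρ₀ ∧ ∃ N₀ : ℕ, HoldsWith v b M ρ₀ C N₀) : 2 ≤ C := by
  by_contra hlt
  push Not at hlt
  -- a small modulation with `C (1 + 2η²) < 2`
  obtain ⟨η, hη0, hηC⟩ : ∃ η : ℝ, 0 < η ∧ C * (1 + 2 * η ^ 2) < 2 := by
    refine ⟨min (1 / 2) ((2 - C) / (4 * C)), by positivity, ?_⟩
    have h1 : min (1 / 2) ((2 - C) / (4 * C)) ≤ (2 - C) / (4 * C) := min_le_right _ _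
    have h2 : min (1 / 2) ((2 - C) / (4 * C)) ≤ 1 / 2 := min_le_left _ _
    have h3 : 0 < min (1 / 2) ((2 - C) / (4 * C)) := by positivity
    have h4 : (min (1 / 2) ((2 - C) / (4 * C))) ^ 2 ≤ (2 - C) / (4 * C) * (1 / 2) := by
      rw [sq]; exact mul_le_mul h1 h2 h3.le (by positivity)
    have h5 : C * (2 * ((2 - C) / (4 * C) * (1 / 2))) = (2 - C) / 4 := by field_simp
    nlinarith
  set g : ℝ := C * (1 + 2 * η ^ 2) with hg
  have hg0 : 0 < g := by positivity
  set X : ℝ := (1 + 2 * η) ^ 2 * (∫⁻ y : Space, v ‖y‖).toReal with hX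
  have hX0 : 0 ≤ X := by positivity
  -- a large window: `g X/(2η²M²) < 2 − g`
  obtain ⟨M, hM_def⟩ : ∃ M : ℝ, M = g * X / (2 * η ^ 2 * (2 - g)) + 1 := ⟨_, rfl⟩
  have h2g : 0 < 2 - g := by linarith
  have hM1 : 1 ≤ M := by rw [hM_def]; linarith [div_nonneg (mul_nonneg hg0.le hX0) (by positivity : (0:ℝ) ≤ 2 * η ^ 2 * (2 - g))]
  have hM : 0 < M := by linarith
  obtain ⟨ρ₀, hρ₀, N₀, hH⟩ := h M hM
  have key := two_le_of_holdsWith_soft hv hV hb hM hρ₀ hC hH hη0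
  -- key : 2 ≤ g (1 + X/(2η²M²)); but M > gX/(2η²(2−g)) and M² ≥ M
  have hMM : M ≤ M ^ 2 := by nlinarith only [hM1]
  have hbound : g * X / (2 * η ^ 2 * (2 - g)) < M ^ 2 := by
    have : g * X / (2 * η ^ 2 * (2 - g)) < M := by rw [hM_def]; linarith
    exact this.trans_le hMM
  rw [div_lt_iff₀ (by positivity)] at hbound
  have e : g * (1 + X / (2 * η ^ 2 * M ^ 2)) = g + g * X / (2 * η ^ 2 * M ^ 2) := by ring
  change 2 ≤ g * (1 + X / (2 * η ^ 2 * M ^ 2)) at key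
  rw [e] at key
  have h3 : g * X / (2 * η ^ 2 * M ^ 2) < 2 - g := by
    rw [div_lt_iff₀ (by positivity)]
    nlinarith [hbound]
  linarith

end TightnessInteracting



end Generation3

end Summit.AtomisticToContinuum.BoseEinsteinCondensation.Cruxes.DensityResponse.Disproof

end
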